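import Mathlib
import Summits.ResolutionOfSingularities.ResolutionOfSingularities.Theorems.RadicialJungCleanModelsLens5PRankTwoPort5
import Literature.FieldTheory.Separability.PDegreeSeparablyGenerated
import HarnessLib

/-!
# Lens 5 — THEOREM T⁗ (valuation `p`-frames): the (P2)-slice of `stub_cleanLU3DefectNonDiscrete` WITHOUT any separability

OURS · CANDIDATE · counted 0.  Crux workfile on `stmt-ResolutionOfSingularities-0549` (`Theses.Descent.DescentPerfectToAll`); customer =
the lead's research stub `stub_cleanLU3DefectNonDiscrete` of `Cruxes/CleanModels/Lines/Sketch.lean` (rev 28 :279).  Nothing here proves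
resolution in char `p`; resolution in char p NOT proved.  Four levels below the crux: T⁗ ⊂ :279 ⊂ :219 ⊂ `CleanModels|_{dim ≥ 4}` ⊂ 0549.

## What T⁗ says (res-B-lens-5 g15) — lens 5 = «arbitrary fields» (Cossart–Piltant 2019) taken literally: NO hypothesis on `k`, `K/k`, `κ_v/k`
beyond FINITE `p`-rank and the existence of a VALUATION `p`-FRAME
THEOREMS T (perfect `k`), T′_fin (`K/k` separably generated AND `κ_v/k` residually separable, finite `p`-rank) and T″/T‴ (the same over
grounds of infinite `p`-rank) all grade `K` over `M := K^p(g₀)` by CONSTANTS `b_s ∈ k`.  The two separability hypotheses of T′ are exactly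
what makes the constants a frame: `[K : k K^p] = p³` ((SEP-K), §A) and `v(Σ c_s^p b_s) = 0`-detection ((SEP-κ), residual `p`-independence).
T⁗ replaces the constants by an ARBITRARY finite family `W : S → O_v` with
* (RPI) residual `p`-independence along `v` (`ResiduallyPIndependentFamily p O W`);
* (MULT) `W_s W_t, 1 ∈ Σ_u K^p W_u` (a multiplicative frame: `K^p(W) = ⊕_u K^p W_u`);
* (DEG) `[K : K^p(W)] = p³`;
and keeps from `k` only a finite `p`-spanning family `b` (finite `p`-rank), used to re-base `A` to `k₀ := k^p` (over which it stays finitely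
generated).  `CleanLU3DefectPRankTwoFrameAt p` (§B″) ⟹ `CleanLUConcl` in clean form (3) with `c' = 0`.
FRAMES EXIST whenever `[κ_v : κ_v^p] = [k : k^p] = p^r < ∞`: lift a `p`-basis `w̄_1, …, w̄_r` of `κ_v/κ_v^p` to `w_i ∈ O_v` and take the
`p^r` monomials `W_e := ∏ w_i^{e_i}` (`0 ≤ e_i < p`): (RPI) by construction, (MULT) trivially (`w_i^p ∈ K^p`), (DEG) from `[K : K^p] = p^{3+r}`
(`K` of transcendence degree `3` over `k`, `[k : k^p] = p^r`; Frobenius twist) and `[K^p(W) : K^p] = p^r`.  In particular (memo CLASSBC §23):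
EVERY (P2)-valuation whose residue field is FINITE over a ground field of finite `p`-rank — `κ_v/k` separable or not, `K/k` separably
generated or not (Mac Lane's function fields without separating transcendence bases), where NO constant frame exists and T′/T″/T‴ are void.
Specimens (memo §23, both instances of ALL hypotheses of :279 with `[Γ : pΓ] = p²`, outside T′ ∪ T″ ∪ T‴): (i) `k = 𝔽_p(s,t)`,
`K = k(x, z₂, z₃, y)` with `y^p = s + t x^p` (`k` algebraically closed in `K`, `K/k` NOT separably generated — Mac Lane), `v`: `x ↦ τ`,
`z₂ ↦ τ^{√2}`, `z₃ ↦ Σ_n τ^{n!}`, so `κ_v = k(s^{1/p})`, `Γ = ℤ + ℤ√2`: frame `{y^i t^j}_{i,j<p}` (`p`-basis `ȳ = s^{1/p}, t` of `κ_v`);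
(ii) `k = 𝔽_p(s)`, `K = k(x,y,z)` purely transcendental (so (SEP-K) holds) with `v`: `x ↦ τ`, `y ↦ τ^{√2}`, `z ↦ s^{1/p} + Σ_n τ^{n!}`, so
`κ_v = k(s^{1/p})` is purely inseparable and the constant family `(s^i)` is residually `p`-DEPENDENT (`s - z^p ∈ 𝔪_v`): frame `{z^i}_{i<p}`.
T ⊂ T′_fin ⊂ T⁗ at statement level: `W = 1` (`S = Unit`), resp. `W = b` read in `K` (✓ `cleanLU3DefectPRankTwoSepFin_of_frame`, §H).

## Architecture (one new idea; three of THEOREM T's four ports re-used, two verbatim)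
`M := K^p(g₀)` (✓ ImmediateValues: `p`-th-power VALUES by `hdefect`, and immediate RESIDUES `κ(M ∩ O_v) = κ_v^p`, §C IR).  PORT 1⁗ (§D,
PROVED): `{W_s x^a y^b}` is an `M`-basis of `K` adapted to `v` — RG `v(Σ c_s W_s) = max v(c_s)` (`c_s ∈ M`, from IR + (RPI)), hence DG with the
(P2) pair `x, y`, `[K^p(W) : K^p] = |S|` ((MULT) + RG), `[K : M] = |S| p²` ((DEG)), uniqueness and `O_v = ⊕ (M ∩ O_v)·W_s x^a y^b`-type
positivity (PB).  PORT 2′ (§E, PROVED = Port 2b core over `k₀ = k^p`, consumes F-02 = `LocalUniformization3 k^p` and F-32): the regular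
monomialising `k₀`-model `T := locAtCentre A₂ O ⊆ M` with parameters `z`.  PORT 3 (✓ Theorems…Port3, VERBATIM): the toric chart `u`.
PORT 4⁗ (§G⁗ `FrameChartPort p`, PROVED in rev 2 — §G⁗.A/B/C, `theorem frameChartPort`; memo §23 (F0)–(F5)): the chart algebra
`A'' := k₀[gens A₂, u, u_{≥ρ}^{-1}, 1, t₀, W, W·W]` has `S := locAtCentre A'' O = ⊕_s W_s S₀` FREE over the frame-free chart ring `S₀` (DG over
`M(x,y) ⊇ S₀`; units by the ADJUGATE of the multiplication matrix of a `v`-unit, RG ⇒ injective mod `𝔪_{S₀}`), `S₀` is regular of dimension `3` with a regular parameter `ψ ∈ M` (Port 4b's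
§13 (b)–(f) verbatim, `dim S₀ = dim S = 3` by integrality), `𝔪_S = 𝔪_{S₀} S` — so `S` is REGULAR and `ψ ∈ (𝔪_S ∖ 𝔪_S²) ∩ M`; exit ✓
`cleanLUConcl_of_parameter` (form (3)).  The frame never has to live at the level of `T` (the structure constants `d_u^p` of `W` are
monomialised into the chart like any other coefficient) — this is why no hypothesis on `k` survives.

## Status of this file (rev 4, res-B-lens-5 g15): SORRY-FREE (`lean check` rc 0, 0 sorries, 0 warnings; rev 4 = port-clean: no linter disabled except `dupNamespace`, the two unused binders of rev 3 dropped) — THEOREM T⁗ is a THEOREM modulo F-02/F-32 only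
§A `[K : k K^p] = p³` under (SEP-K) (copy of ✓ `Lens5_PDegreeSep.lean`; used only by the corollary T′_fin ⊂ T⁗); §B/§B′ the currencies of
T′ (copies) and §B″ the NEW slice `CleanLU3DefectPRankTwoFrameAt`; §C RG/IR (copies of `Lens5_TPrime.lean` §C, general families); §D PORT 1⁗
`port_gradedDataFrame` + `finrank_adjoin_frame_eq_card` (PROVED); §E Port 2b core (copy, PROVED); §G⁗ `def FrameChartPort` + (rev 2)
§G⁗.A the core of ✓ Port 4b with the chart dimension as a hypothesis (copy minus step (a)), §G⁗.B the FRAME LAYER (`HasExp`; adjugate units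
`hasExp_inv`; `S = Σ W_s S₀`; `dim S₀ = dim S` by integrality; `𝔪_S = 𝔪_{S₀}S` ⇒ `IsRegularLocalRing S`; regular parameters persist), §G⁗.C
`theorem frameChartPort : FrameChartPort p` (PROVED); §H the KERNEL-CHECKED composition `cleanLU3DefectPRankTwoFrame_of_ports :
(∀ k, LocalUniformization3 k) → F-32 → FrameChartPort p → CleanLU3DefectPRankTwoFrameAt p`, and (rev 2, `hPort` DISCHARGED)
`cleanLU3DefectPRankTwoFrame_of_cossartPiltant2019 : CossartPiltant2019 → F-32 → CleanLU3DefectPRankTwoFrameAt p`, plus the corollary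
`cleanLU3DefectPRankTwoSepFin_of_frame : CleanLU3DefectPRankTwoFrameAt p → CleanLU3DefectPRankTwoSepFinAt p` (T′_fin's slice is the
constant-frame case) and `cleanLU3DefectPRankTwoSepFin_of_cossartPiltant2019' : CossartPiltant2019 → F-32 → CleanLU3DefectPRankTwoSepFinAt p`;
(rev 3) §I `p`-MONOMIAL FRAMES: (MULT)/(1)/(DEG) discharged — THEOREM T⁗′ `cleanLU3DefectPRankTwoPMon_of_cossartPiltant2019 : CossartPiltant2019 →
F-32 → CleanLU3DefectPRankTwoPMonAt p`, the slice «(P2), finite `p`-rank, `r` elements of `O_v` with `p`-independent residues, `[K : K^p] = p^{r+3}`».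
(rev 4) PORT DEBT CLEARED (TRIAGE-146): the file-level `linter.unusedVariables/unusedSectionVars false` removed; unused binders `hWO` of
`port_gradedDataFrame` and `hS₀O` of `valuation_exp_lt_one_iff` dropped (call sites adjusted; no other statement changed).  The count `[K : K^p] = p^{r+3}`
of T⁗′ is KERNEL in the companion crux workfile `Lens5_PDegreeCount.lean` (THEOREM T⁗″, slice `CleanLU3DefectPRankTwoPBasisAt` over a finite `p`-basis of `k`).
NOT counted (crux workfile, four levels below 0549); resolution in char p NOT proved.

## Residual of the lead's stub after T ∪ T′ ∪ T″ ∪ T‴ ∪ T⁗ (honest; memo §23)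
{`[Γ : pΓ] ≤ p`} (no grading — memo §11; not a lens-5 regime) ∪ {finite `p`-rank, (P2), `[κ_v : κ_v^p] < [k : k^p]`} (residue field
`p`-radically DEFICIENT — infinite purely inseparable residue towers absorbing a `p`-basis of `k`; no frame) ∪ {infinite `p`-rank beyond
T″/T‴ (`κ_v` inseparable over every finite intermediate ground field)}.  Inputs left: F-02 (`CossartPiltant2019`, ✓ as a named fact /
`LocalUniformization3 (k^p)`) and F-32 (embedded resolution of surfaces in excellent regular threefolds, hypothesis `hEmb`).
-/

set_option linter.dupNamespace false -- mandated namespace of this single-conjunct summit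
/-! ## §A `[K : k·K^p] = p³` for `K/k` separably generated of transcendence degree 3 (copy of the crux workfile
`Lens5_PDegreeSep.lean`, ✓ there; crux workfiles are not importable modules, hence the verbatim copy) -/

namespace Summit.ResolutionOfSingularities.ResolutionOfSingularities.Cruxes.DescentPerfectToAll.CpSibling.TFrame.PDegreeSep

open IntermediateField Module Literature.FieldTheory.Separability Literature.AlgebraicGeometry.Resolution

variable {k : Type} {K : Type} [Field k] [Field K] [Algebra k K] (p : ℕ) [Fact p.Prime] [CharP K p]

/-- A `k`-derivation of `K` that kills the subfield `F` and the set `t` kills `F(t)`. [folklore] -/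
theorem derivation_eq_zero_of_mem_adjoin (F : Subfield K) (hFD : ∀ (D : Derivation k K K) (x : K), x ∈ F → D x = 0)
    (D : Derivation k K K) {t : Set K} (ht : ∀ b ∈ t, D b = 0) {x : K} (hx : x ∈ adjoin F t) : D x = 0 := by
  have hx' : x ∈ Subfield.closure (Set.range (algebraMap F K) ∪ t) := by
    rwa [← adjoin_toSubfield]
  have h := Derivation.eqOn_subfieldClosure (D₁ := D.restrictScalars ℤ) (D₂ := 0)
    (s := Set.range (algebraMap F K) ∪ t) ?_ hx'
  · simpa using h
  · rintro y (⟨c, rfl⟩ | hy)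
    · change D (c : K) = (0 : Derivation ℤ K K) _
      rw [Derivation.zero_apply]
      exact hFD D c c.2
    · change D y = (0 : Derivation ℤ K K) y
      rw [Derivation.zero_apply]
      exact ht y hy

/-- A separating transcendence basis of `K/k` is `p`-independent over any subfield `F ⊇ K^p` killed by all `k`-derivations.
[cite: Matsumura1987, §26 p. 202 and Thm. 26.5] -/
theorem isPIndependent_of_sepTrBasis (F : Subfield K) (hFp : ∀ x : K, x ^ p ∈ F)
    (hFD : ∀ (D : Derivation k K K) (x : K), x ∈ F → D x = 0) (s : Finset K)
    (hs : AlgebraicIndependent k ((↑) : s → K)) (hsep : Algebra.IsSeparable (adjoin k (s : Set K)) K) :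
    IsPIndependent (F := F) p (s : Set K) := by
  classical
  suffices h : ∀ t : Finset K, t ⊆ s → IsPIndependent (F := F) p (t : Set K) from
    fun t ht => (h t (fun x hx => ht hx)) t subset_rfl
  intro t
  induction t using Finset.induction_on with
  | empty =>
    intro _
    rw [Finset.coe_empty]
    exact isPIndependent_empty _ p
  | insert a t hat ih =>
    intro hts
    have hts' : t ⊆ s := fun x hx => hts (Finset.mem_insert_of_mem hx)
    have has : a ∈ s := hts (Finset.mem_insert_self a t)
    rw [Finset.coe_insert]
    refine isPIndependent_insert (ih hts') ?_ ⟨⟨a ^ p, hFp a⟩, rfl⟩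
    intro hmem
    obtain ⟨D, hDa, hDb⟩ := exists_derivation_dual s hs hsep ⟨a, has⟩
    have hDt : ∀ b ∈ (t : Set K), D b = 0 := fun b hb => by
      have hbs : b ∈ s := hts' hb
      have hba : (⟨b, hbs⟩ : s) ≠ ⟨a, has⟩ := fun h => hat (by
        rw [← show b = a from congrArg Subtype.val h]; exact hb)
      exact hDb ⟨b, hbs⟩ hba
    have := derivation_eq_zero_of_mem_adjoin F hFD D hDt hmem
    rw [hDa] at this
    exact one_ne_zero this

/-- `K = F(s)` for a separating transcendence basis `s` of `K/k` and any subfield `F` containing (the image of) `k` and `K^p`.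
[cite: Matsumura1987, §26 p. 202 and Thm. 26.5] -/
theorem adjoin_eq_top_of_sepTrBasis (F : Subfield K) (hFk : ∀ c : k, algebraMap k K c ∈ F) (hFp : ∀ x : K, x ^ p ∈ F)
    (s : Finset K) (hsep : Algebra.IsSeparable (adjoin k (s : Set K)) K) :
    adjoin F (s : Set K) = ⊤ := by
  classical
  set M : IntermediateField F K := adjoin F (s : Set K) with hM
  have hle : ∀ y : adjoin k (s : Set K), (y : K) ∈ M := by
    intro y
    have hy : (y : K) ∈ Subfield.closure (Set.range (algebraMap k K) ∪ (s : Set K)) := by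
      rw [← adjoin_toSubfield]; exact y.2
    have hsub : Set.range (algebraMap k K) ∪ (s : Set K) ⊆ (M.toSubfield : Set K) := by
      rintro z (⟨c, rfl⟩ | hz)
      · exact M.algebraMap_mem ⟨algebraMap k K c, hFk c⟩
      · exact subset_adjoin F (s : Set K) hz
    exact Subfield.closure_le.mpr hsub hy
  let f : adjoin k (s : Set K) →+* M := (algebraMap (adjoin k (s : Set K)) K).codRestrict M hle
  have hf : (algebraMap M K).comp f = algebraMap (adjoin k (s : Set K)) K := RingHom.ext fun _ => rfl
  haveI : ExpChar M p := by
    haveI : CharP M p := (algebraMap M K).charP (algebraMap M K).injective p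
    exact ExpChar.prime Fact.out
  rw [eq_top_iff]
  intro x _
  have hxsep : IsSeparable M x :=
    isSeparable_of_ringHom_comp_eq f hf (Algebra.IsSeparable.isSeparable (adjoin k (s : Set K)) x)
  have hxperf : x ∈ perfectClosure M K := by
    rw [mem_perfectClosure_iff_pow_mem p]
    refine ⟨1, ⟨⟨x ^ p, M.algebraMap_mem ⟨x ^ p, hFp x⟩⟩, ?_⟩⟩
    rw [pow_one]
    rfl
  have hxbot : x ∈ (⊥ : IntermediateField M K) := by
    rw [← separableClosure_inf_perfectClosure M K]
    exact ⟨mem_separableClosure_iff.mpr hxsep, hxperf⟩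
  obtain ⟨y, hy⟩ := IntermediateField.mem_bot.mp hxbot
  rw [← hy]
  exact y.2

/-- `[K : F] = p^{#s}` for a separating transcendence basis `s` of `K/k` and a subfield `F` with `k ⊆ F`, `K^p ⊆ F`, killed by every
`k`-derivation. [cite: Matsumura1987, §26 p. 202 and Thm. 26.5] -/
theorem finrank_eq_pow_card_of_sepTrBasis (F : Subfield K) (hFk : ∀ c : k, algebraMap k K c ∈ F) (hFp : ∀ x : K, x ^ p ∈ F)
    (hFD : ∀ (D : Derivation k K K) (x : K), x ∈ F → D x = 0) (s : Finset K)
    (hs : AlgebraicIndependent k ((↑) : s → K)) (hsep : Algebra.IsSeparable (adjoin k (s : Set K)) K) :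
    finrank F K = p ^ s.card := by
  have h1 := (isPIndependent_of_sepTrBasis p F hFp hFD s hs hsep).finrank_eq s subset_rfl
  rwa [adjoin_eq_top_of_sepTrBasis p F hFk hFp s hsep, finrank_top'] at h1

/-- `k ⊆ k·K^p`. -/
theorem composite_algebraMap_mem (c : k) :
    algebraMap k K c ∈ Subfield.closure (Set.range (algebraMap k K) ∪ Set.range (frobenius K p)) :=
  Subfield.subset_closure (Or.inl ⟨c, rfl⟩)

/-- `K^p ⊆ k·K^p`. -/
theorem composite_pow_mem (x : K) :
    x ^ p ∈ Subfield.closure (Set.range (algebraMap k K) ∪ Set.range (frobenius K p)) :=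
  Subfield.subset_closure (Or.inr ⟨x, frobenius_def ..⟩)

/-- Every `k`-derivation of `K` kills `k·K^p`. [folklore] -/
theorem composite_derivation_eq_zero (D : Derivation k K K) (x : K)
    (hx : x ∈ Subfield.closure (Set.range (algebraMap k K) ∪ Set.range (frobenius K p))) : D x = 0 := by
  have h := Derivation.eqOn_subfieldClosure (D₁ := D.restrictScalars ℤ) (D₂ := 0)
    (s := Set.range (algebraMap k K) ∪ Set.range (frobenius K p)) ?_ hx
  · simpa using h
  · rintro y (⟨c, rfl⟩ | ⟨z, rfl⟩)
    · change D (algebraMap k K c) = (0 : Derivation ℤ K K) _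
      rw [Derivation.zero_apply, Derivation.map_algebraMap]
    · change D (frobenius K p z) = (0 : Derivation ℤ K K) _
      rw [Derivation.zero_apply, frobenius_def]
      exact Derivation.apply_pow_char (p := p) (D.restrictScalars ℤ) z

/-- `[K : k·K^p] = p^{#s}` for a finite separating transcendence basis `s` of `K/k`, ANY ground field `k` of characteristic `p`.
[cite: Matsumura1987, §26 p. 202 and Thm. 26.5] -/
theorem finrank_composite_eq_pow_card (s : Finset K) (hs : AlgebraicIndependent k ((↑) : s → K))
    (hsep : Algebra.IsSeparable (adjoin k (s : Set K)) K) :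
    finrank (Subfield.closure (Set.range (algebraMap k K) ∪ Set.range (frobenius K p))) K = p ^ s.card :=
  finrank_eq_pow_card_of_sepTrBasis p _ (composite_algebraMap_mem p) (composite_pow_mem p)
    (composite_derivation_eq_zero p) s hs hsep

omit [CharP K p] in
/-- `[K : k·K^p] = p³` for `K = Frac A`, `A` a finitely generated `k`-algebra of Krull dimension `3` over ANY field `k` of
characteristic `p`, `K/k` separably generated. [cite: Matsumura1987, Thm. 26.5] -/
theorem pDegreeThreeOfSepGenerated :
    ∀ (k : Type) [Field k] [CharP k p] (K : Type) [Field K] [Algebra k K] [CharP K p] (A : Subalgebra k K),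
      A.FG → IsFractionRing A K → ringKrullDim A = 3 →
        (∃ (n : ℕ) (s : Fin n → K), AlgebraicIndependent k s ∧ Algebra.IsSeparable (IntermediateField.adjoin k (Set.range s)) K) →
        Module.finrank (Subfield.closure (Set.range (algebraMap k K) ∪ Set.range (frobenius K p))) K = p ^ 3 := by
  intro k _ _ K _ _ _ A hAfg hfrac hdim hsg
  classical
  obtain ⟨n, s, hs, hsep⟩ := hsg
  haveI : Algebra.FiniteType k A := A.fg_iff_finiteType.mp hAfg
  haveI : Algebra.EssFiniteType A K := Algebra.EssFiniteType.of_isLocalization K (nonZeroDivisors A)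
  haveI : Algebra.EssFiniteType k K := Algebra.EssFiniteType.comp k A K
  obtain ⟨d, hd, htr⟩ := Literature.RingTheory.KrullDimension.exists_ringKrullDim_eq_and_trdeg_eq k A
  have hd3 : d = 3 := by
    rw [hd] at hdim
    exact_mod_cast hdim
  haveI : FaithfulSMul k A := (faithfulSMul_iff_algebraMap_injective k A).mpr (algebraMap k A).injective
  haveI : FaithfulSMul A K := (faithfulSMul_iff_algebraMap_injective A K).mpr (IsFractionRing.injective A K)
  haveI : Algebra.IsAlgebraic A K := IsLocalization.isAlgebraic K (nonZeroDivisors A)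
  have htrK : Algebra.trdeg k K = (3 : ℕ) := by
    rw [← trdeg_add_eq k A (A := K), trdeg_eq_zero (R := A) (A := K), add_zero, htr, hd3]
  haveI := hsep
  have halg : Algebra.IsAlgebraic (IntermediateField.adjoin k (Set.range s)) K := inferInstance
  have htb : IsTranscendenceBasis k s :=
    hs.isTranscendenceBasis_iff_isAlgebraic.mpr (IntermediateField.isAlgebraic_adjoin_iff_top.mp halg)
  have hn : n = 3 := by
    have h := htb.cardinalMk_eq_trdeg
    rw [Cardinal.mk_fin, htrK] at h
    exact_mod_cast h
  set s' : Finset K := Finset.univ.image s with hs'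
  have hcoe : (s' : Set K) = Set.range s := by
    rw [hs', Finset.coe_image, Finset.coe_univ, Set.image_univ]
  have hs'' : AlgebraicIndependent k ((↑) : s' → K) := by
    have := hs.to_subtype_range' hcoe.symm
    exact this
  have hsep' : Algebra.IsSeparable (adjoin k (s' : Set K)) K := by
    rw [hcoe]; exact hsep
  have hcard : s'.card = 3 := by
    rw [hs', Finset.card_image_of_injective _ hs.injective, Finset.card_univ, Fintype.card_fin, hn]
  rw [finrank_composite_eq_pow_card p s' hs'' hsep', hcard]

end Summit.ResolutionOfSingularities.ResolutionOfSingularities.Cruxes.DescentPerfectToAll.CpSibling.TFrame.PDegreeSep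

section

open IsLocalRing
open Literature.AlgebraicGeometry.Resolution
open Summit.ResolutionOfSingularities.ResolutionOfSingularities.Theorems.RadicialJung.CleanModels
open Summit.ResolutionOfSingularities.ResolutionOfSingularities.Theorems.RadicialJung.CleanModels.Lens5
open Summit.ResolutionOfSingularities.ResolutionOfSingularities.Theorems.RadicialJung.CleanModels.Lens5.PRankTwoCurrency
open Summit.ResolutionOfSingularities.ResolutionOfSingularities.Theorems.RadicialJung.CleanModels.Lens5.PRankTwoAssembly
open Summit.ResolutionOfSingularities.ResolutionOfSingularities.Theorems.RadicialJungCleanModels.Lens5RegularityCriterion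
open Summit.ResolutionOfSingularities.ResolutionOfSingularities.Theorems.RadicialJungCleanModels.Lens5ChartSurjection

namespace Summit.ResolutionOfSingularities.ResolutionOfSingularities.Cruxes.DescentPerfectToAll.CpSibling.TFrame

/-! ## §B Currency of T′₁ (`p`-rank one; kept — T′₁ is the corollary `S := Fin p`, `b i := θ^i` of T′_fin, §H) -/

/-- `K/k` separably generated (census `Census_lens5_pRankTwo.lean` def, verbatim). [folklore] -/
def SepGenerated (k K : Type) [Field k] [Field K] [Algebra k K] : Prop :=
    ∃ (n : ℕ) (s : Fin n → K), AlgebraicIndependent k s ∧ Algebra.IsSeparable (IntermediateField.adjoin k (Set.range s)) K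

/-- **`θ` is a `p`-generator of `k`**: `k = k^p[θ] = Σ_{i<p} k^p θ^i`, i.e. `[k : k^p] ≤ p` (`p`-rank ≤ 1). [folklore] -/
def IsPGenerator (p : ℕ) {k : Type} [Field k] (θ : k) : Prop :=
    ∀ c : k, ∃ d : Fin p → k, c = ∑ i : Fin p, d i ^ p * θ ^ (i : ℕ)

/-- **Residual `p`-independence of `1, Θ, …, Θ^{p-1}`** along `v` (in-`K` form): a combination `Σ_{i<p} w_i^p Θ^i` with integral
coefficients one of which is a unit is a unit.  For `Θ ∈ k` and `κ_v/k` algebraic this says that the `p`-basis `{θ}` of `k` stays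
`p`-independent in `κ_v`, i.e. `κ_v/k` is separable. [folklore] -/
def ResiduallyPIndependent (p : ℕ) {K : Type} [Field K] (O : ValuationSubring K) (Θ : K) : Prop :=
    ∀ w : Fin p → K, (∀ i, w i ∈ O) → (∃ i, O.valuation (w i) = 1) →
      O.valuation (∑ i : Fin p, w i ^ p * Θ ^ (i : ℕ)) = 1

/-- **THEOREM T′₁'s slice**: `stub_cleanLU3DefectNonDiscrete` at `p` on {`[Γ : pΓ] = p²`, `K/k` separably generated, `k` of
`p`-rank ≤ 1 with `p`-generator `θ` residually `p`-independent along `v`} — NO `PerfectField k`. [folklore] -/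
def CleanLU3DefectPRankTwoSepRkOneAt (p : ℕ) : Prop :=
    ∀ (k : Type) [Field k] [CharP k p] (K : Type) [Field K] [Algebra k K]
    (O : ValuationSubring K) (A : Subalgebra k K), A.toSubring ≤ O.toSubring → A.FG → IsFractionRing A K →
    ringKrullDim A ≤ 3 → IsRegularLocalRing (locAtCentre A.toSubring O) →
    ringKrullDim (locAtCentre A.toSubring O) = 3 →
    (∀ (T : Subring K) (hT : T ≤ O.toSubring), A.toSubring ≤ T → (subringCentre T O hT).IsMaximal) →
    ∀ g₀ : K, (∀ c : K, c ^ p ≠ g₀) →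
    (∀ f₀ : K, ∃ f₁ : K, O.valuation (g₀ - f₁ ^ p) < O.valuation (g₀ - f₀ ^ p)) →
    (∀ hk : ∀ c : k, algebraMap k K c ∈ O, transcendenceDefect k O hk ≠ 0) →
    ¬ (∃ π : K, π ≠ 0 ∧ (∀ x : K, O.valuation x < 1 → O.valuation x ≤ O.valuation π) ∧
      (∀ x : K, x ≠ 0 → ∃ n : ℕ, O.valuation π ^ n ≤ O.valuation x)) →
    PRankTwoAt p O → SepGenerated k K →
    ∀ θ : k, IsPGenerator p θ → ResiduallyPIndependent p O (algebraMap k K θ) →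
    CleanLUConcl p k K O A g₀

/-! ### §B′ Currency of T′_fin (finite `p`-rank): a finite `p`-spanning family of `k`, residually `p`-independent along `v` -/

/-- **A finite `p`-spanning family of `k`**: `k = Σ_{s ∈ S} k^p · b_s` (`S` finite).  Any field of FINITE `p`-rank `e` has one
(the `p^e` monomials in a `p`-basis); `p`-rank one = the family `1, θ, …, θ^{p-1}`. [folklore] -/
def IsPSpanningFamily (p : ℕ) {k : Type} [Field k] {S : Type} [Fintype S] (b : S → k) : Prop :=
    ∀ c : k, ∃ d : S → k, c = ∑ s : S, d s ^ p * b s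

/-- **Residual `p`-independence of a finite family** `B : S → K` along `v` (in-`K` form): `Σ_s w_s^p B_s` is a `v`-unit whenever the
`w_s ∈ O` are not all in `𝔪_v`.  For `B = b` a `p`-spanning family of `k ⊆ O` and `κ_v/k` algebraic this says that the `p`-basis of `k`
extracted from `b` stays `p`-independent in `κ_v`, i.e. (MacLane) `κ_v/k` is SEPARABLE. [folklore] -/
def ResiduallyPIndependentFamily (p : ℕ) {K : Type} [Field K] (O : ValuationSubring K) {S : Type} [Fintype S]
    (B : S → K) : Prop :=
    ∀ w : S → K, (∀ s, w s ∈ O) → (∃ s, O.valuation (w s) = 1) → O.valuation (∑ s : S, w s ^ p * B s) = 1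

/-- **THEOREM T′_fin's slice**: `stub_cleanLU3DefectNonDiscrete` at `p` on {`[Γ : pΓ] = p²`, `K/k` separably generated, `k` with a
FINITE `p`-spanning family (finite `p`-rank) residually `p`-independent along `v`} — NO `PerfectField k`. [folklore] -/
def CleanLU3DefectPRankTwoSepFinAt (p : ℕ) : Prop :=
    ∀ (k : Type) [Field k] [CharP k p] (K : Type) [Field K] [Algebra k K]
    (O : ValuationSubring K) (A : Subalgebra k K), A.toSubring ≤ O.toSubring → A.FG → IsFractionRing A K →
    ringKrullDim A ≤ 3 → IsRegularLocalRing (locAtCentre A.toSubring O) →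
    ringKrullDim (locAtCentre A.toSubring O) = 3 →
    (∀ (T : Subring K) (hT : T ≤ O.toSubring), A.toSubring ≤ T → (subringCentre T O hT).IsMaximal) →
    ∀ g₀ : K, (∀ c : K, c ^ p ≠ g₀) →
    (∀ f₀ : K, ∃ f₁ : K, O.valuation (g₀ - f₁ ^ p) < O.valuation (g₀ - f₀ ^ p)) →
    (∀ hk : ∀ c : k, algebraMap k K c ∈ O, transcendenceDefect k O hk ≠ 0) →
    ¬ (∃ π : K, π ≠ 0 ∧ (∀ x : K, O.valuation x < 1 → O.valuation x ≤ O.valuation π) ∧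
      (∀ x : K, x ≠ 0 → ∃ n : ℕ, O.valuation π ^ n ≤ O.valuation x)) →
    PRankTwoAt p O → SepGenerated k K →
    ∀ (S : Type) [Fintype S] (b : S → k), IsPSpanningFamily p b →
    ResiduallyPIndependentFamily p O (fun s => algebraMap k K (b s)) →
    CleanLUConcl p k K O A g₀

/-! ### §B″ Currency of T⁗ (valuation `p`-frames): NO separability of `K/k`, NO residual separability -/

/-- **THEOREM T⁗'s slice**: `stub_cleanLU3DefectNonDiscrete` at `p` on {`[Γ : pΓ] = p²`, `k` of FINITE `p`-rank (a finite `p`-spanning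
family `b`, used ONLY to re-base `A` to `k^p`), and a finite MULTIPLICATIVE `p`-FRAME `W ⊆ O_v` — `W_s W_t, 1 ∈ Σ_u K^p W_u` — which is
residually `p`-independent along `v` with `[K : K^p(W)] = p³`} — NO `PerfectField k`, NO `SepGenerated k K`, NO separability of `κ_v/k`.
Frames: `W = 1` (perfect `k`: THEOREM T); `W = b` read in `K` (T′_fin, `cleanLU3DefectPRankTwoSepFin_of_frame`); `W =` the `p^r`
monomials in lifts of a `p`-basis of `κ_v/κ_v^p` whenever `[κ_v : κ_v^p] = [k : k^p] = p^r` — e.g. EVERY `v` with `κ_v/k` finite over a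
ground field of finite `p`-rank, separable or not, `K/k` separably generated or not (memo CLASSBC §23). [folklore] -/
def CleanLU3DefectPRankTwoFrameAt (p : ℕ) : Prop :=
    ∀ (k : Type) [Field k] [CharP k p] (K : Type) [Field K] [Algebra k K]
    (O : ValuationSubring K) (A : Subalgebra k K), A.toSubring ≤ O.toSubring → A.FG → IsFractionRing A K →
    ringKrullDim A ≤ 3 → IsRegularLocalRing (locAtCentre A.toSubring O) →
    ringKrullDim (locAtCentre A.toSubring O) = 3 →
    (∀ (T : Subring K) (hT : T ≤ O.toSubring), A.toSubring ≤ T → (subringCentre T O hT).IsMaximal) →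
    ∀ g₀ : K, (∀ c : K, c ^ p ≠ g₀) →
    (∀ f₀ : K, ∃ f₁ : K, O.valuation (g₀ - f₁ ^ p) < O.valuation (g₀ - f₀ ^ p)) →
    (∀ hk : ∀ c : k, algebraMap k K c ∈ O, transcendenceDefect k O hk ≠ 0) →
    ¬ (∃ π : K, π ≠ 0 ∧ (∀ x : K, O.valuation x < 1 → O.valuation x ≤ O.valuation π) ∧
      (∀ x : K, x ≠ 0 → ∃ n : ℕ, O.valuation π ^ n ≤ O.valuation x)) →
    PRankTwoAt p O →
    ∀ (Sb : Type) [Fintype Sb] (b : Sb → k), IsPSpanningFamily p b →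
    ∀ (S : Type) [Fintype S] (W : S → K), (∀ s, W s ∈ O) → ResiduallyPIndependentFamily p O W →
    (∀ s t : S, ∃ d : S → K, W s * W t = ∑ u : S, d u ^ p * W u) → (∃ d : S → K, ∑ u : S, d u ^ p * W u = 1) →
    Module.finrank (Subfield.closure (Set.range W ∪ Set.range (fun x : K => x ^ p))) K = p ^ 3 →
    CleanLUConcl p k K O A g₀


/-! ## §C The new valuation input: residual gradedness RG from immediate residues IR -/

/-- Residual `p`-independence makes `Θ` a unit of `v` (take `w = e₁`; `p ≥ 2`). [folklore] -/
theorem valuation_eq_one_of_residuallyPIndependent {p : ℕ} [Fact p.Prime] {K : Type} [Field K] (O : ValuationSubring K)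
    (Θ : K) (hPI : ResiduallyPIndependent p O Θ) : O.valuation Θ = 1 := by
  classical
  have hp : p.Prime := Fact.out
  have h1 : (1 : ℕ) < p := hp.one_lt
  have h := hPI (Pi.single (⟨1, h1⟩ : Fin p) 1) (fun i => by
    by_cases hi : i = ⟨1, h1⟩
    · subst hi; simp [O.one_mem]
    · simp [Pi.single_eq_of_ne hi, O.zero_mem]) ⟨⟨1, h1⟩, by simp⟩
  rw [Finset.sum_eq_single (⟨1, h1⟩ : Fin p)] at h
  · simpa using h
  · intro i _ hi; simp [Pi.single_eq_of_ne hi, zero_pow hp.ne_zero]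
  · intro h0; exact absurd (Finset.mem_univ _) h0

/-- **RG (residual gradedness).**  If every unit of the subfield `M` is residually a `p`-th power (IR) and `1, Θ, …, Θ^{p-1}` are
residually `p`-independent, then `v(Σ_{i<p} c_i Θ^i) = max_i v(c_i)` for `c_i ∈ M`.  PROVED (normalise by the
maximal coefficient, replace each `c_i/c_{i₀}` by a `p`-th power modulo `𝔪_v`, apply residual `p`-independence). [folklore] -/
theorem valuation_sum_mul_pow_eq_sup {p : ℕ} [Fact p.Prime] {K : Type} [Field K] (O : ValuationSubring K) (M : Subfield K)
    (hIR : ∀ m : K, m ∈ M → O.valuation m = 1 → ∃ w : K, O.valuation (m - w ^ p) < 1)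
    (Θ : K) (hPI : ResiduallyPIndependent p O Θ) (c : Fin p → K) (hc : ∀ i, c i ∈ M) :
    O.valuation (∑ i : Fin p, c i * Θ ^ (i : ℕ)) = Finset.univ.sup (fun i => O.valuation (c i)) := by
  classical
  have hp : p.Prime := Fact.out
  haveI : NeZero p := ⟨hp.ne_zero⟩
  have hΘv := valuation_eq_one_of_residuallyPIndependent O Θ hPI
  by_cases h0 : ∀ i, c i = 0
  · have hf : (fun i => O.valuation (c i)) = fun _ : Fin p => (0 : O.ValueGroup) := by
      funext i; rw [h0 i, map_zero]
    rw [hf, Finset.sup_const Finset.univ_nonempty]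
    simp [h0]
  push Not at h0
  obtain ⟨i₁, hi₁⟩ := h0
  obtain ⟨i₀, -, hi₀⟩ := Finset.exists_max_image Finset.univ (fun i => O.valuation (c i)) ⟨i₁, Finset.mem_univ _⟩
  have hsup : Finset.univ.sup (fun i => O.valuation (c i)) = O.valuation (c i₀) :=
    le_antisymm (Finset.sup_le fun i hi => hi₀ i hi) (Finset.le_sup (f := fun i => O.valuation (c i)) (Finset.mem_univ i₀))
  have hc0 : c i₀ ≠ 0 := by
    intro h
    have h1 := hi₀ i₁ (Finset.mem_univ _)
    rw [h, map_zero, le_zero_iff, map_eq_zero] at h1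
    exact hi₁ h1
  set d : Fin p → K := fun i => c i / c i₀ with hd
  have hdM : ∀ i, d i ∈ M := fun i => div_mem (hc i) (hc i₀)
  have hvc0 : O.valuation (c i₀) ≠ 0 := by rwa [ne_eq, map_eq_zero]
  have hdv : ∀ i, O.valuation (d i) ≤ 1 := fun i => by
    simp only [hd, map_div₀]
    exact div_le_one_of_le₀ (hi₀ i (Finset.mem_univ _)) zero_le
  have hdi₀ : d i₀ = 1 := div_self hc0
  -- each `d_i` is a `p`-th power modulo `𝔪_v` (IR for the units, `0` for the others)
  have hw : ∀ i, ∃ w : K, O.valuation (d i - w ^ p) < 1 := by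
    intro i
    rcases (hdv i).lt_or_eq with hlt | heq
    · exact ⟨0, by rw [zero_pow hp.ne_zero, sub_zero]; exact hlt⟩
    · exact hIR (d i) (hdM i) heq
  choose w hw using hw
  have hwO : ∀ i, w i ∈ O := by
    intro i
    rw [← O.valuation_le_one_iff]
    by_contra hgt
    push Not at hgt
    have hwp : 1 < O.valuation (w i ^ p) := by rw [map_pow]; exact one_lt_pow₀ hgt hp.ne_zero
    have hlt : O.valuation (d i) < O.valuation (w i ^ p) := lt_of_le_of_lt (hdv i) hwp
    have heq : O.valuation (d i - w i ^ p) = O.valuation (w i ^ p) := Valuation.map_sub_eq_of_lt_right _ hlt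
    exact lt_irrefl _ ((heq ▸ hw i).trans hwp)
  have hwi₀ : O.valuation (w i₀) = 1 := by
    have h := hw i₀
    rw [hdi₀] at h
    have h' : O.valuation (w i₀ ^ p - 1) < O.valuation (1 : K) := by
      rw [← Valuation.map_neg, neg_sub, map_one]; exact h
    have h1 : O.valuation (w i₀ ^ p) = 1 := by
      have := Valuation.map_eq_of_sub_lt _ h'
      rwa [map_one] at this
    rw [map_pow] at h1
    rcases pow_eq_one_iff.mp h1 with h | h
    · exact h
    · exact absurd h hp.ne_zero
  -- the decomposition `Σ d_i Θ^i = Σ w_i^p Θ^i + Σ (d_i - w_i^p) Θ^i`: a unit plus an element of `𝔪_v`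
  have hsplit : ∑ i : Fin p, d i * Θ ^ (i : ℕ) =
      ∑ i : Fin p, w i ^ p * Θ ^ (i : ℕ) + ∑ i : Fin p, (d i - w i ^ p) * Θ ^ (i : ℕ) := by
    rw [← Finset.sum_add_distrib]; exact Finset.sum_congr rfl fun i _ => by ring
  have h1 : O.valuation (∑ i : Fin p, w i ^ p * Θ ^ (i : ℕ)) = 1 := hPI w hwO ⟨i₀, hwi₀⟩
  have h2 : O.valuation (∑ i : Fin p, (d i - w i ^ p) * Θ ^ (i : ℕ)) < 1 := by
    refine Valuation.map_sum_lt _ one_ne_zero fun i _ => ?_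
    rw [map_mul, map_pow, hΘv, one_pow, mul_one]; exact hw i
  have hdsum : O.valuation (∑ i : Fin p, d i * Θ ^ (i : ℕ)) = 1 := by
    rw [hsplit, Valuation.map_add_eq_of_lt_left]
    · exact h1
    · rw [h1]; exact h2
  have hcsum : ∑ i : Fin p, c i * Θ ^ (i : ℕ) = c i₀ * ∑ i : Fin p, d i * Θ ^ (i : ℕ) := by
    rw [Finset.mul_sum]
    exact Finset.sum_congr rfl fun i _ => by simp only [hd]; rw [← mul_assoc, mul_div_cancel₀ _ hc0]
  rw [hcsum, map_mul, hdsum, mul_one, hsup]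

/-- Residual `p`-independence of a family makes each member a `v`-unit (take `w = e_s`). [folklore] -/
theorem valuation_eq_one_of_residuallyPIndependentFamily {p : ℕ} [Fact p.Prime] {K : Type} [Field K] (O : ValuationSubring K)
    {S : Type} [Fintype S] (B : S → K) (hPI : ResiduallyPIndependentFamily p O B) (s : S) : O.valuation (B s) = 1 := by
  classical
  have hp : p.Prime := Fact.out
  have h := hPI (Pi.single s 1) (fun t => by
    by_cases ht : t = s
    · subst ht; simp [O.one_mem]
    · simp [Pi.single_eq_of_ne ht, O.zero_mem]) ⟨s, by simp⟩
  rw [Finset.sum_eq_single s] at h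
  · simpa using h
  · intro t _ ht; simp [Pi.single_eq_of_ne ht, zero_pow hp.ne_zero]
  · intro h0; exact absurd (Finset.mem_univ _) h0

/-- **RG for a family (residual gradedness).**  If every unit of the subfield `M` is residually a `p`-th power (IR) and the finite family
`B` is residually `p`-independent, then `v(Σ_s c_s B_s) = max_s v(c_s)` for `c_s ∈ M`.  PROVED (as the power version). [folklore] -/
theorem valuation_sum_mul_family_eq_sup {p : ℕ} [Fact p.Prime] {K : Type} [Field K] (O : ValuationSubring K) (M : Subfield K)
    (hIR : ∀ m : K, m ∈ M → O.valuation m = 1 → ∃ w : K, O.valuation (m - w ^ p) < 1)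
    {S : Type} [Fintype S] (B : S → K) (hPI : ResiduallyPIndependentFamily p O B) (c : S → K) (hc : ∀ i, c i ∈ M) :
    O.valuation (∑ i : S, c i * B i) = Finset.univ.sup (fun i => O.valuation (c i)) := by
  classical
  have hp : p.Prime := Fact.out
  have hBv := valuation_eq_one_of_residuallyPIndependentFamily O B hPI
  by_cases h0 : ∀ i, c i = 0
  · have hsup0 : Finset.univ.sup (fun i => O.valuation (c i)) = 0 :=
      le_antisymm (Finset.sup_le fun i _ => by rw [h0 i, map_zero]) zero_le
    rw [hsup0]
    have : ∑ i : S, c i * B i = 0 := Finset.sum_eq_zero fun i _ => by rw [h0 i, zero_mul]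
    rw [this, map_zero]
  push Not at h0
  obtain ⟨i₁, hi₁⟩ := h0
  obtain ⟨i₀, -, hi₀⟩ := Finset.exists_max_image Finset.univ (fun i => O.valuation (c i)) ⟨i₁, Finset.mem_univ _⟩
  have hsup : Finset.univ.sup (fun i => O.valuation (c i)) = O.valuation (c i₀) :=
    le_antisymm (Finset.sup_le fun i hi => hi₀ i hi) (Finset.le_sup (f := fun i => O.valuation (c i)) (Finset.mem_univ i₀))
  have hc0 : c i₀ ≠ 0 := by
    intro h
    have h1 := hi₀ i₁ (Finset.mem_univ _)
    rw [h, map_zero, le_zero_iff, map_eq_zero] at h1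
    exact hi₁ h1
  set d : S → K := fun i => c i / c i₀ with hd
  have hdM : ∀ i, d i ∈ M := fun i => div_mem (hc i) (hc i₀)
  have hvc0 : O.valuation (c i₀) ≠ 0 := by rwa [ne_eq, map_eq_zero]
  have hdv : ∀ i, O.valuation (d i) ≤ 1 := fun i => by
    simp only [hd, map_div₀]
    exact div_le_one_of_le₀ (hi₀ i (Finset.mem_univ _)) zero_le
  have hdi₀ : d i₀ = 1 := div_self hc0
  have hw : ∀ i, ∃ w : K, O.valuation (d i - w ^ p) < 1 := by
    intro i
    rcases (hdv i).lt_or_eq with hlt | heq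
    · exact ⟨0, by rw [zero_pow hp.ne_zero, sub_zero]; exact hlt⟩
    · exact hIR (d i) (hdM i) heq
  choose w hw using hw
  have hwO : ∀ i, w i ∈ O := by
    intro i
    rw [← O.valuation_le_one_iff]
    by_contra hgt
    push Not at hgt
    have hwp : 1 < O.valuation (w i ^ p) := by rw [map_pow]; exact one_lt_pow₀ hgt hp.ne_zero
    have hlt : O.valuation (d i) < O.valuation (w i ^ p) := lt_of_le_of_lt (hdv i) hwp
    have heq : O.valuation (d i - w i ^ p) = O.valuation (w i ^ p) := Valuation.map_sub_eq_of_lt_right _ hlt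
    exact lt_irrefl _ ((heq ▸ hw i).trans hwp)
  have hwi₀ : O.valuation (w i₀) = 1 := by
    have h := hw i₀
    rw [hdi₀] at h
    have h' : O.valuation (w i₀ ^ p - 1) < O.valuation (1 : K) := by
      rw [← Valuation.map_neg, neg_sub, map_one]; exact h
    have h1 : O.valuation (w i₀ ^ p) = 1 := by
      have := Valuation.map_eq_of_sub_lt _ h'
      rwa [map_one] at this
    rw [map_pow] at h1
    rcases pow_eq_one_iff.mp h1 with h | h
    · exact h
    · exact absurd h hp.ne_zero
  have hsplit : ∑ i : S, d i * B i = ∑ i : S, w i ^ p * B i + ∑ i : S, (d i - w i ^ p) * B i := by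
    rw [← Finset.sum_add_distrib]; exact Finset.sum_congr rfl fun i _ => by ring
  have h1 : O.valuation (∑ i : S, w i ^ p * B i) = 1 := hPI w hwO ⟨i₀, hwi₀⟩
  have h2 : O.valuation (∑ i : S, (d i - w i ^ p) * B i) < 1 := by
    refine Valuation.map_sum_lt _ one_ne_zero fun i _ => ?_
    rw [map_mul, hBv i, mul_one]; exact hw i
  have hdsum : O.valuation (∑ i : S, d i * B i) = 1 := by
    rw [hsplit, Valuation.map_add_eq_of_lt_left]
    · exact h1
    · rw [h1]; exact h2
  have hcsum : ∑ i : S, c i * B i = c i₀ * ∑ i : S, d i * B i := by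
    rw [Finset.mul_sum]
    exact Finset.sum_congr rfl fun i _ => by simp only [hd]; rw [← mul_assoc, mul_div_cancel₀ _ hc0]
  rw [hcsum, map_mul, hdsum, mul_one, hsup]

/-- **Residual `p`-independence from a non-`p`-th-power residue.**  If the `v`-unit `m` is NOT congruent to a `p`-th power modulo
`𝔪_v`, then `1, m, …, m^{p-1}` are residually `p`-independent: in the residue field `κ` the class `m̄ ∉ κ^p` has minimal polynomial
`X^p - m̄^p` over `κ^p` (✓ `ImmediateValues.minpoly_eq_X_pow_sub_C` applied to the field `κ`), so no non-trivial `κ^p`-relation of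
degree `< p` exists. [folklore] -/
theorem residuallyPIndependent_of_not_residue_pthPower {p : ℕ} [Fact p.Prime] {K : Type} [Field K] [CharP K p]
    (O : ValuationSubring K) (m : K) (hvm : O.valuation m = 1) (H : ∀ w : K, 1 ≤ O.valuation (m - w ^ p)) :
    ResiduallyPIndependent p O m := by
  classical
  have hp : p.Prime := Fact.out
  intro w hwO hunit
  obtain ⟨i₁, hi₁⟩ := hunit
  -- the residue field `κ` of `O`, of characteristic `p`
  haveI hOchar : CharP O p := (O.subtype).charP Subtype.val_injective p
  haveI : CharP (IsLocalRing.ResidueField O) p :=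
    (RingHom.charP_iff_charP ((IsLocalRing.residue O).comp (ZMod.castHom (dvd_refl p) O)) p).mp (ZMod.charP p)
  have hmO : m ∈ O := (O.valuation_le_one_iff m).mp hvm.le
  set mO : O := ⟨m, hmO⟩ with hmOdef
  set wO : Fin p → O := fun i => ⟨w i, hwO i⟩ with hwOdef
  set mbar : IsLocalRing.ResidueField O := IsLocalRing.residue O mO with hmbar
  -- `m̄` is not a `p`-th power in `κ`
  have hmnp : ∀ c : IsLocalRing.ResidueField O, c ^ p ≠ mbar := by
    intro c hc
    obtain ⟨cO, rfl⟩ := IsLocalRing.residue_surjective c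
    have h0 : IsLocalRing.residue O (mO - cO ^ p) = 0 := by rw [map_sub, map_pow, hc, hmbar, sub_self]
    rw [IsLocalRing.residue_eq_zero_iff] at h0
    have hlt : O.valuation (((mO - cO ^ p : O)) : K) < 1 := (O.valuation_lt_one_iff _).mp h0
    have hlt' : O.valuation (m - (cO : K) ^ p) < 1 := by
      have : (((mO - cO ^ p : O)) : K) = m - (cO : K) ^ p := by rw [hmOdef]; push_cast; rfl
      rw [← this]; exact hlt
    exact absurd (H (cO : K)) (not_le.mpr hlt')
  -- the element `S = Σ w_i^p m^i ∈ O`; suppose `v S < 1`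
  set SO : O := ∑ i : Fin p, wO i ^ p * mO ^ (i : ℕ) with hSOdef
  have hS : ((SO : O) : K) = ∑ i : Fin p, w i ^ p * m ^ (i : ℕ) := by
    rw [hSOdef]; push_cast; rfl
  have hle : O.valuation (∑ i : Fin p, w i ^ p * m ^ (i : ℕ)) ≤ 1 := by
    rw [← hS]; exact (O.valuation_le_one_iff _).mpr SO.2
  by_contra hne
  have hlt : O.valuation (∑ i : Fin p, w i ^ p * m ^ (i : ℕ)) < 1 := lt_of_le_of_ne hle hne
  rw [← hS, ← O.valuation_lt_one_iff] at hlt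
  have hres : IsLocalRing.residue O SO = 0 := (IsLocalRing.residue_eq_zero_iff _).mpr hlt
  have hsum : ∑ i : Fin p, IsLocalRing.residue O (wO i) ^ p * mbar ^ (i : ℕ) = 0 := by
    rw [← hres, hSOdef, map_sum]
    exact Finset.sum_congr rfl fun i _ => by rw [map_mul, map_pow, map_pow, hmbar]
  -- the `κ^p`-polynomial of degree `< p` killing `m̄`
  set Fκ : Subfield (IsLocalRing.ResidueField O) := (frobenius (IsLocalRing.ResidueField O) p).fieldRange with hFκ
  let coef : Fin p → Fκ := fun i =>
    ⟨IsLocalRing.residue O (wO i) ^ p, RingHom.mem_fieldRange.mpr ⟨IsLocalRing.residue O (wO i), frobenius_def _ _⟩⟩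
  set P : Polynomial Fκ := ∑ i : Fin p, Polynomial.C (coef i) * Polynomial.X ^ (i : ℕ) with hPdef
  have hPeval : Polynomial.aeval mbar P = 0 := by
    rw [hPdef, map_sum]
    rw [← hsum]
    refine Finset.sum_congr rfl fun i _ => ?_
    rw [map_mul, map_pow, Polynomial.aeval_C, Polynomial.aeval_X]
    rfl
  have hcoef : ∀ i : Fin p, P.coeff (i : ℕ) = coef i := by
    intro i
    rw [hPdef, Polynomial.finsetSum_coeff]
    rw [Finset.sum_eq_single i]
    · rw [Polynomial.coeff_C_mul_X_pow, if_pos rfl]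
    · intro j _ hji
      rw [Polynomial.coeff_C_mul_X_pow, if_neg]
      exact fun h => hji (Fin.ext h).symm
    · intro h; exact absurd (Finset.mem_univ i) h
  have hP0 : P ≠ 0 := by
    intro h
    have h1 := hcoef i₁
    rw [h, Polynomial.coeff_zero] at h1
    have h2 : IsLocalRing.residue O (wO i₁) ^ p = 0 := by
      have := congrArg Subtype.val h1.symm
      simpa [coef] using this
    have h3 : IsLocalRing.residue O (wO i₁) = 0 := (pow_eq_zero_iff hp.ne_zero).mp h2
    rw [IsLocalRing.residue_eq_zero_iff] at h3
    have h4 : O.valuation ((wO i₁ : O) : K) < 1 := (O.valuation_lt_one_iff _).mp h3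
    have : ((wO i₁ : O) : K) = w i₁ := rfl
    rw [this, hi₁] at h4
    exact lt_irrefl _ h4
  have hPdeg : P.natDegree < p := by
    have hd : P.degree < p := by rw [hPdef]; exact Polynomial.degree_sum_fin_lt coef
    exact (Polynomial.natDegree_lt_iff_degree_lt hP0).mpr hd
  -- the minimal polynomial of `m̄` over `κ^p` has degree `p` and divides `P`: contradiction
  have hmin := ImmediateValues.minpoly_eq_X_pow_sub_C (p := p) mbar hmnp
  have hdvd := minpoly.dvd Fκ mbar hPeval
  have hdeg := Polynomial.natDegree_le_of_dvd hdvd hP0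
  rw [hmin, Polynomial.natDegree_X_pow_sub_C] at hdeg
  exact absurd hPdeg (not_lt.mpr hdeg)

/-- **IR (immediate residues of `K^p(g₀)`).**  If `g₀` has no best `p`-th-power approximation (`hdefect`: the radicial extension
`K(g₀^{1/p})/K` is immediate for `v`), every `v`-unit of `M = K^p(g₀)` is congruent to a `p`-th power modulo `𝔪_v`.  PROVED:
if not, `1, m, …, m^{p-1}` are residually `p`-independent (previous lemma), hence RG holds for `m` over `K^p` (§C); then, exactly as in
✓ `ImmediateValues.exists_valuation_eq_pthPower_of_noBestApprox`, `g₀ = Σ a_i m^i` over `K^p` and `a₀ = α₀^p` is a BEST `p`-th-power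
approximation of `g₀`, contradicting `hdefect`. [folklore] -/
theorem immediateResidues_of_noBestApprox {p : ℕ} [Fact p.Prime] {K : Type} [Field K] [CharP K p] (O : ValuationSubring K)
    (g₀ : K)
    (hdefect : ∀ f₀ : K, ∃ f₁ : K, O.valuation (g₀ - f₁ ^ p) < O.valuation (g₀ - f₀ ^ p))
    (M : Subfield K) (hM : ∀ x : K, x ∈ M ↔ ∃ c : Fin p → K, ∑ j, c j ^ p * g₀ ^ (j : ℕ) = x)
    (m : K) (hm : m ∈ M) (hvm : O.valuation m = 1) : ∃ w : K, O.valuation (m - w ^ p) < 1 := by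
  classical
  have hpp : p.Prime := Fact.out
  haveI : NeZero p := ⟨hpp.ne_zero⟩
  by_contra Hn
  push Not at Hn
  have hPI := residuallyPIndependent_of_not_residue_pthPower O m hvm Hn
  have hm0 : m ≠ 0 := fun h => by rw [h, map_zero] at hvm; exact zero_ne_one hvm
  set F : Subfield K := (frobenius K p).fieldRange with hF_def
  have hpowF : ∀ x : K, x ^ p ∈ F := fun x => RingHom.mem_fieldRange.mpr ⟨x, frobenius_def p x⟩
  have hFpow : ∀ a : K, a ∈ F → ∃ α : K, α ^ p = a := fun a ha => by
    obtain ⟨α, hα⟩ := RingHom.mem_fieldRange.mp ha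
    exact ⟨α, by rw [← hα, frobenius_def]⟩
  -- RG for `m` over `K^p` (§C with IR for `K^p` trivial)
  have hIRF : ∀ a : K, a ∈ F → O.valuation a = 1 → ∃ w : K, O.valuation (a - w ^ p) < 1 := by
    intro a ha _
    obtain ⟨α, rfl⟩ := hFpow a ha
    exact ⟨α, by rw [sub_self, map_zero]; exact zero_lt_one⟩
  have hRGm : ∀ c : Fin p → K, (∀ i, c i ∈ F) →
      O.valuation (∑ i : Fin p, c i * m ^ (i : ℕ)) = Finset.univ.sup (fun i => O.valuation (c i)) :=
    fun c hc => valuation_sum_mul_pow_eq_sup O F hIRF m hPI c hc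
  have hLI : LinearIndependent F (fun i : Fin p => m ^ (i : ℕ)) := by
    rw [Fintype.linearIndependent_iff]
    intro g hg i
    have hsum : ∑ i, (g i : K) * m ^ (i : ℕ) = 0 := by
      have : ∑ i, (g i : K) * m ^ (i : ℕ) = ∑ i, g i • m ^ (i : ℕ) :=
        Finset.sum_congr rfl fun i _ => (Subfield.smul_def (g i) _).symm
      rw [this, hg]
    have hv := hRGm (fun i => (g i : K)) (fun i => (g i).2)
    rw [hsum, map_zero] at hv
    have hle : O.valuation (g i : K) ≤ Finset.univ.sup (fun i => O.valuation (g i : K)) :=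
      Finset.le_sup (f := fun i => O.valuation (g i : K)) (Finset.mem_univ i)
    rw [← hv, le_zero_iff, map_eq_zero] at hle
    exact_mod_cast hle
  -- `g₀` in the `K^p`-basis `1, m, …, m^{p-1}` of `V(g₀)` (verbatim from ✓ `exists_valuation_eq_pthPower_of_noBestApprox`)
  set V : Submodule F K := Submodule.span F (Set.range fun j : Fin p => g₀ ^ (j : ℕ)) with hV_def
  haveI : Module.Finite F V := Module.Finite.span_of_finite F (Set.finite_range _)
  have hVfin : Module.finrank F V ≤ p := ImmediateValues.finrank_span_powers_le g₀
  have hg₀V : g₀ ∈ V := ImmediateValues.self_mem_span_powers g₀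
  have hmV : m ∈ V := by
    obtain ⟨c, rfl⟩ := (hM m).mp hm
    exact (ImmediateValues.mem_span_powers_iff g₀ _).mpr ⟨c, rfl⟩
  have hmpow : ∀ n : ℕ, m ^ n ∈ V := by
    intro n
    induction n with
    | zero => simpa using ImmediateValues.one_mem_span_powers (p := p) g₀
    | succ n ih => rw [pow_succ]; exact ImmediateValues.mul_mem_span_powers g₀ ih hmV
  set b : Fin p → V := fun i => ⟨m ^ (i : ℕ), hmpow i⟩ with hb_def
  have hbLI : LinearIndependent F b := by apply LinearIndependent.of_comp V.subtype; exact hLI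
  have hcard : Fintype.card (Fin p) = Module.finrank F V :=
    le_antisymm (hbLI.fintype_card_le_finrank) (by simpa using hVfin)
  haveI : Nonempty (Fin p) := ⟨⟨0, hpp.pos⟩⟩
  have hspan : Submodule.span F (Set.range b) = ⊤ := hbLI.span_eq_top_of_card_eq_finrank hcard
  have hg₀span : (⟨g₀, hg₀V⟩ : V) ∈ Submodule.span F (Set.range b) := by rw [hspan]; exact Submodule.mem_top
  obtain ⟨a, ha⟩ := (Submodule.mem_span_range_iff_exists_fun F).mp hg₀span
  have haK : ∑ i, (a i : K) * m ^ (i : ℕ) = g₀ := by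
    have := congrArg Subtype.val ha; simpa [hb_def, Subfield.smul_def] using this
  set j0 : Fin p := ⟨0, hpp.pos⟩ with hj0_def
  obtain ⟨α₀, hα₀⟩ := hFpow (a j0) (a j0).2
  set T := ∑ i ∈ (Finset.univ : Finset (Fin p)).erase j0, (a i : K) * m ^ (i : ℕ) with hT_def
  have hgT : g₀ - α₀ ^ p = T := by
    rw [← haK, ← Finset.add_sum_erase Finset.univ (fun i => (a i : K) * m ^ (i : ℕ)) (Finset.mem_univ j0), hα₀]
    simp [hj0_def, hT_def]
  -- `α₀` is a best approximation: by RG over `K^p`, `v (g₀ - f^p) = sup (v ((α₀ - f)^p), v (a_i), i ≥ 1) ≥ v T`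
  have hbound : ∀ f : K, O.valuation T ≤ O.valuation (g₀ - f ^ p) := by
    intro f
    let a' : Fin p → K := fun i => if i = j0 then (α₀ - f) ^ p else (a i : K)
    have ha'F : ∀ i, a' i ∈ F := by
      intro i; by_cases hi : i = j0 <;> simp only [a', hi, if_true, if_false]; exact hpowF _; exact (a i).2
    let a'' : Fin p → K := fun i => if i = j0 then 0 else (a i : K)
    have ha''F : ∀ i, a'' i ∈ F := by
      intro i; by_cases hi : i = j0 <;> simp only [a'', hi, if_true, if_false]; exact F.zero_mem; exact (a i).2
    have hTsum : T = ∑ i ∈ (Finset.univ : Finset (Fin p)).erase j0, a' i * m ^ (i : ℕ) := by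
      refine Finset.sum_congr rfl fun i hi => ?_
      have hij : i ≠ j0 := Finset.ne_of_mem_erase hi
      simp only [a', hij, if_false]
    have hTsum' : T = ∑ i, a'' i * m ^ (i : ℕ) := by
      rw [← Finset.add_sum_erase Finset.univ (fun i => a'' i * m ^ (i : ℕ)) (Finset.mem_univ j0)]
      have hrest : ∑ i ∈ (Finset.univ : Finset (Fin p)).erase j0, a'' i * m ^ (i : ℕ) = T := by
        refine Finset.sum_congr rfl fun i hi => ?_
        have hij : i ≠ j0 := Finset.ne_of_mem_erase hi
        simp only [a'', hij, if_false]
      rw [hrest]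
      simp only [a'', if_true, zero_mul, zero_add]
    have hdiff : g₀ - f ^ p = ∑ i, a' i * m ^ (i : ℕ) := by
      rw [← Finset.add_sum_erase Finset.univ (fun i => a' i * m ^ (i : ℕ)) (Finset.mem_univ j0), ← hTsum, ← hgT]
      simp only [a', if_true, hj0_def]; rw [sub_pow_char]; ring
    rw [hdiff, hRGm a' ha'F, hTsum', hRGm a'' ha''F]
    refine Finset.sup_mono_fun fun i _ => ?_
    by_cases hi : i = j0
    · simp only [a', a'', hi, if_true, map_zero]; exact zero_le
    · simp only [a', a'', hi, if_false]; exact le_rfl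
  obtain ⟨f₁, hf₁⟩ := hdefect α₀
  rw [hgT] at hf₁
  exact absurd (hbound f₁) (not_le.mpr hf₁)

/-! ### §C′ Bridge B1 in the `k`-RATIONAL case: for a valuation with residue field `k` (every element of `O` is congruent to a constant),
residual `p`-independence of `b` read in `K` is just `k^p`-linear independence of `b` in `k` (so (FIN)+(RPI-fam) = «`b` is a `p`-basis-monomial
basis of `k` over `k^p`»).  The general bridge («`κ_v/k` separable algebraic», Mac Lane) is by hand in the memo (§17/§18), not formalised. -/

/-- Constants are `v`-units. [folklore] -/
theorem valuation_algebraMap_eq_one {k K : Type} [Field k] [Field K] [Algebra k K] (O : ValuationSubring K)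
    (hk : ∀ c : k, algebraMap k K c ∈ O) {c : k} (hc : c ≠ 0) : O.valuation (algebraMap k K c) = 1 := by
  have h1 : O.valuation (algebraMap k K c) ≤ 1 := (O.valuation_le_one_iff _).mpr (hk c)
  have h2 : O.valuation (algebraMap k K c⁻¹) ≤ 1 := (O.valuation_le_one_iff _).mpr (hk c⁻¹)
  have hprod : O.valuation (algebraMap k K c) * O.valuation (algebraMap k K c⁻¹) = 1 := by
    rw [← map_mul, ← map_mul, mul_inv_cancel₀ hc, map_one, map_one]
  refine le_antisymm h1 ?_
  calc (1 : _) = O.valuation (algebraMap k K c) * O.valuation (algebraMap k K c⁻¹) := hprod.symm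
    _ ≤ O.valuation (algebraMap k K c) * 1 := by gcongr
    _ = O.valuation (algebraMap k K c) := mul_one _

/-- **Bridge B1, `k`-rational case.**  If the residue field of `v` is `k` (`hrat`: every `x ∈ O` is `≡` a constant mod `𝔪_v`) and the finite
family `b` is `k^p`-linearly independent in `k` (`hbli`, in-`k` elementary form), then `b` is residually `p`-independent along `v`. [folklore] -/
theorem residuallyPIndependentFamily_of_rational (p : ℕ) [Fact p.Prime] {k K : Type} [Field k] [CharP k p] [Field K] [Algebra k K]
    (O : ValuationSubring K) (hk : ∀ c : k, algebraMap k K c ∈ O)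
    (hrat : ∀ x : K, x ∈ O → ∃ c : k, O.valuation (x - algebraMap k K c) < 1)
    {S : Type} [Fintype S] (b : S → k) (hbli : ∀ d : S → k, ∑ s, d s ^ p * b s = 0 → ∀ s, d s = 0) :
    ResiduallyPIndependentFamily p O (fun s => algebraMap k K (b s)) := by
  classical
  have hp : p.Prime := Fact.out
  haveI : CharP K p := charP_of_injective_algebraMap (algebraMap k K).injective p
  intro w hw hw1
  obtain ⟨s₀, hs₀⟩ := hw1
  choose c hc using fun s => hrat (w s) (hw s)
  -- the unit coefficient has a non-zero constant
  have hc₀ : c s₀ ≠ 0 := by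
    intro h0
    have := hc s₀
    rw [h0, map_zero, sub_zero, hs₀] at this
    exact lt_irrefl _ this
  -- hence the constant combination is a non-zero constant, a `v`-unit
  have hsum0 : ∑ s, c s ^ p * b s ≠ 0 := fun h0 => hc₀ (hbli c h0 s₀)
  have hunit : O.valuation (algebraMap k K (∑ s, c s ^ p * b s)) = 1 := valuation_algebraMap_eq_one O hk hsum0
  -- the difference lies in `𝔪_v`
  set D : K := ∑ s, (w s ^ p - algebraMap k K (c s) ^ p) * algebraMap k K (b s) with hD
  have hDlt : O.valuation D < 1 := by
    refine Valuation.map_sum_lt _ one_ne_zero fun s _ => ?_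
    rw [← sub_pow_char, map_mul, map_pow]
    have hb1 : O.valuation (algebraMap k K (b s)) ≤ 1 := (O.valuation_le_one_iff _).mpr (hk _)
    calc O.valuation (w s - algebraMap k K (c s)) ^ p * O.valuation (algebraMap k K (b s))
        ≤ O.valuation (w s - algebraMap k K (c s)) ^ p * 1 := by gcongr
      _ = O.valuation (w s - algebraMap k K (c s)) ^ p := mul_one _
      _ < 1 := pow_lt_one₀ zero_le (hc s) hp.ne_zero
  have hsplit : ∑ s, w s ^ p * algebraMap k K (b s) = algebraMap k K (∑ s, c s ^ p * b s) + D := by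
    rw [hD, map_sum, ← Finset.sum_add_distrib]
    refine Finset.sum_congr rfl fun s _ => ?_
    rw [map_mul, map_pow]; ring
  rw [hsplit, Valuation.map_add_eq_of_lt_left _ (by rw [hunit]; exact hDlt), hunit]

/-! ## §D PORT 1′ — the doubly graded data -/

/-- **DG (double grading, term ≤ sum).**  Under (V) for `M`, (P2) for `x, y`, `v (B s) = 1` and RG for the finite family `B`
over `M`, each term of `Σ_{s,(a,b)} m_{s,ab} B_s x^a y^b` (`m ∈ M`) is bounded by the sum: the inner sums `c_{ab} := Σ_s m_{s,ab} B_s`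
have `v(c_{ab}) = max_s v(m_{s,ab}) = v(m_{s₀,ab})` (RG), so the outer terms have pairwise distinct values (✓ `GradedBasis.monomial_values_ne`
with the representatives `m_{s₀,ab} ∈ M`). [folklore] -/
theorem valuation_term_le_double_sum {p : ℕ} (hp : p.Prime) {K : Type} [Field K] (O : ValuationSubring K) (M : Subfield K)
    (hV : ∀ m : K, m ∈ M → m ≠ 0 → ∃ z : K, z ≠ 0 ∧ O.valuation m = O.valuation (z ^ p))
    {S : Type} [Fintype S] (B : S → K) (hB1 : ∀ s, O.valuation (B s) = 1)
    (hRG : ∀ c : S → K, (∀ i, c i ∈ M) →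
      O.valuation (∑ i : S, c i * B i) = Finset.univ.sup (fun i => O.valuation (c i)))
    {x y : K} (hx : x ≠ 0) (hy : y ≠ 0)
    (hP : ∀ a b : ℕ, a < p → b < p → (a ≠ 0 ∨ b ≠ 0) → ∀ z : K, z ≠ 0 → O.valuation (x ^ a * y ^ b) ≠ O.valuation (z ^ p))
    (m : S × (Fin p × Fin p) → K) (hm : ∀ l, m l ∈ M) (l₀ : S × (Fin p × Fin p)) :
    O.valuation (m l₀ * (B l₀.1 * (x ^ (l₀.2.1 : ℕ) * y ^ (l₀.2.2 : ℕ)))) ≤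
      O.valuation (∑ l, m l * (B l.1 * (x ^ (l.2.1 : ℕ) * y ^ (l.2.2 : ℕ)))) := by
  classical
  haveI : NeZero p := ⟨hp.ne_zero⟩
  set mon : Fin p × Fin p → K := fun ab => x ^ (ab.1 : ℕ) * y ^ (ab.2 : ℕ) with hmon
  set c : Fin p × Fin p → K := fun ab => ∑ i : S, m (i, ab) * B i with hc
  have hsum : ∑ l, m l * (B l.1 * (x ^ (l.2.1 : ℕ) * y ^ (l.2.2 : ℕ))) = ∑ ab, c ab * mon ab := by
    rw [Fintype.sum_prod_type, Finset.sum_comm]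
    refine Finset.sum_congr rfl fun ab _ => ?_
    rw [hc, hmon]
    simp only
    rw [Finset.sum_mul]
    exact Finset.sum_congr rfl fun i _ => by ring
  have hvc : ∀ ab, O.valuation (c ab) = Finset.univ.sup (fun i => O.valuation (m (i, ab))) :=
    fun ab => hRG _ (fun i => hm (i, ab))
  -- argmax representative of each non-zero coefficient
  have hrep : ∀ ab, c ab ≠ 0 → ∃ i₀, m (i₀, ab) ≠ 0 ∧ O.valuation (c ab) = O.valuation (m (i₀, ab)) := by
    intro ab hcab
    have hne : (Finset.univ : Finset S).Nonempty := by
      rw [Finset.univ_nonempty_iff]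
      by_contra hS
      apply hcab
      rw [hc]
      exact Finset.sum_eq_zero fun i _ => (hS ⟨i⟩).elim
    obtain ⟨i₀, -, hi₀⟩ := Finset.exists_max_image Finset.univ (fun i => O.valuation (m (i, ab))) hne
    have hsup : Finset.univ.sup (fun i => O.valuation (m (i, ab))) = O.valuation (m (i₀, ab)) :=
      le_antisymm (Finset.sup_le fun i hi => hi₀ i hi) (Finset.le_sup (f := fun i => O.valuation (m (i, ab))) (Finset.mem_univ i₀))
    refine ⟨i₀, ?_, (hvc ab).trans hsup⟩
    intro h0
    apply hcab
    have : O.valuation (c ab) = 0 := by rw [hvc ab, hsup, h0, map_zero]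
    exact (map_eq_zero _).mp this
  -- pairwise distinct values of the `(a, b)`-terms
  have hpw : ∀ i ∈ (Finset.univ : Finset (Fin p × Fin p)), ∀ j ∈ (Finset.univ : Finset (Fin p × Fin p)), i ≠ j →
      c i * mon i ≠ 0 → O.valuation (c i * mon i) ≠ O.valuation (c j * mon j) := by
    intro i _ j _ hij hi0
    have hci : c i ≠ 0 := fun h0 => hi0 (by rw [h0, zero_mul])
    by_cases hcj : c j = 0
    · rw [hcj, zero_mul, map_zero]; exact (Valuation.ne_zero_iff _).mpr hi0
    obtain ⟨a₀, ha₀, hva₀⟩ := hrep i hci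
    obtain ⟨b₀, hb₀, hvb₀⟩ := hrep j hcj
    have hne := GradedBasis.monomial_values_ne hp O.valuation M hV hx hy hP i j hij (m (a₀, i)) (m (b₀, j)) (hm _) (hm _) ha₀ hb₀
    intro heq
    apply hne
    rw [Valuation.map_mul _ (m (a₀, i)), Valuation.map_mul _ (m (b₀, j)), ← hva₀, ← hvb₀, ← Valuation.map_mul,
      ← Valuation.map_mul]
    simpa only [hmon] using heq
  have houter : O.valuation (∑ ab, c ab * mon ab) = Finset.univ.sup (fun ab => O.valuation (c ab * mon ab)) :=
    GradedBasis.valuation_sum_eq_sup_of_pairwise O.valuation Finset.univ _ hpw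
  have hml₀ : m l₀ = m (l₀.1, l₀.2) := by rw [Prod.mk.eta]
  calc O.valuation (m l₀ * (B l₀.1 * (x ^ (l₀.2.1 : ℕ) * y ^ (l₀.2.2 : ℕ))))
        = O.valuation (m l₀) * O.valuation (mon l₀.2) := by
          rw [map_mul, map_mul, hB1, one_mul]
    _ ≤ O.valuation (c l₀.2) * O.valuation (mon l₀.2) := by
          apply mul_le_mul_left
          rw [hvc, hml₀]
          exact Finset.le_sup (f := fun i => O.valuation (m (i, l₀.2))) (Finset.mem_univ l₀.1)
    _ = O.valuation (c l₀.2 * mon l₀.2) := (map_mul _ _ _).symm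
    _ ≤ O.valuation (∑ ab, c ab * mon ab) := by
          rw [houter]; exact Finset.le_sup (f := fun ab => O.valuation (c ab * mon ab)) (Finset.mem_univ l₀.2)
    _ = _ := by rw [hsum]

/-- **`[K^p(W) : K^p] = |S|` for a multiplicative frame which is `K^p`-linearly independent.**  `K^p(W) =` the `K^p`-span of `W`
(products `W_s W_t = Σ_u d_u^p W_u` and `1 = Σ_u d_u^p W_u` stay in the span). [folklore] -/
theorem finrank_adjoin_frame_eq_card {p : ℕ} [Fact p.Prime] {K : Type} [Field K] [CharP K p]
    {S : Type} [Fintype S] (W : S → K)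
    (hWmul : ∀ s t : S, ∃ d : S → K, W s * W t = ∑ u, d u ^ p * W u)
    (hW1 : ∃ d : S → K, ∑ u, d u ^ p * W u = 1)
    (hli : LinearIndependent (frobenius K p).fieldRange W) :
    Module.finrank (frobenius K p).fieldRange
        (IntermediateField.adjoin (frobenius K p).fieldRange (Set.range W)) = Fintype.card S := by
  classical
  have hp : p.Prime := Fact.out
  set Kp : Subfield K := (frobenius K p).fieldRange with hKpdef
  have hpowKp : ∀ x : K, x ^ p ∈ Kp := fun x => RingHom.mem_fieldRange.mpr ⟨x, frobenius_def p x⟩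
  -- every `W s` is algebraic over `K^p` (root of `X^p - W_s^p`)
  have halg : ∀ x ∈ Set.range W, IsAlgebraic Kp x := by
    rintro x ⟨s, rfl⟩
    refine IsIntegral.isAlgebraic ⟨Polynomial.X ^ p - Polynomial.C (⟨W s ^ p, hpowKp (W s)⟩ : Kp),
      Polynomial.monic_X_pow_sub_C _ hp.ne_zero, ?_⟩
    simp [Polynomial.eval₂_sub, Polynomial.eval₂_X_pow]
    exact sub_self (W s ^ p)
  set E := IntermediateField.adjoin Kp (Set.range W) with hEdef
  have hEalg : E.toSubalgebra = Algebra.adjoin Kp (Set.range W) :=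
    IntermediateField.adjoin_toSubalgebra_of_isAlgebraic halg
  -- the `K^p`-span of `W` is closed under multiplication and contains `1`
  set V : Submodule Kp K := Submodule.span Kp (Set.range W) with hVdef
  have hWV : ∀ s, W s ∈ V := fun s => Submodule.subset_span ⟨s, rfl⟩
  have hsumV : ∀ d : S → K, ∑ u, d u ^ p * W u ∈ V := by
    intro d
    refine sum_mem fun u _ => ?_
    have : d u ^ p * W u = (⟨d u ^ p, hpowKp _⟩ : Kp) • W u := by
      rw [Subfield.smul_def, smul_eq_mul]
    rw [this]
    exact V.smul_mem _ (hWV u)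
  have hWmulV : ∀ s, ∀ y ∈ V, W s * y ∈ V := by
    intro s y hy
    induction hy using Submodule.span_induction with
    | mem x hx =>
      obtain ⟨t, rfl⟩ := hx
      obtain ⟨d, hd⟩ := hWmul s t
      rw [hd]; exact hsumV d
    | zero => rw [mul_zero]; exact V.zero_mem
    | add x y _ _ hx hy => rw [mul_add]; exact V.add_mem hx hy
    | smul a x _ hx => rw [mul_smul_comm]; exact V.smul_mem a hx
  have hmulV : ∀ x ∈ V, ∀ y ∈ V, x * y ∈ V := by
    intro x hx y hy
    induction hx using Submodule.span_induction with
    | mem x hx' => obtain ⟨s, rfl⟩ := hx'; exact hWmulV s y hy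
    | zero => rw [zero_mul]; exact V.zero_mem
    | add x₁ x₂ _ _ h₁ h₂ => rw [add_mul]; exact V.add_mem h₁ h₂
    | smul a x _ hx => rw [smul_mul_assoc]; exact V.smul_mem a hx
  have h1V : (1 : K) ∈ V := by
    obtain ⟨d, hd⟩ := hW1
    rw [← hd]; exact hsumV d
  have hclosure : (Submonoid.closure (Set.range W) : Set K) ⊆ V := by
    intro x hx
    induction hx using Submonoid.closure_induction with
    | mem x hx => exact Submodule.subset_span hx
    | one => exact h1V
    | mul x y _ _ hx hy => exact hmulV x hx y hy
  have hspan : Subalgebra.toSubmodule (Algebra.adjoin Kp (Set.range W)) = V := by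
    rw [Algebra.adjoin_eq_span]
    apply le_antisymm
    · exact Submodule.span_le.mpr hclosure
    · exact Submodule.span_mono Submonoid.subset_closure
  have hV : Module.finrank Kp V = Fintype.card S := finrank_span_eq_card hli
  calc Module.finrank Kp E = Module.finrank Kp E.toSubalgebra := (IntermediateField.finrank_eq_finrank_subalgebra _).symm
    _ = Module.finrank Kp (Subalgebra.toSubmodule E.toSubalgebra) := (Subalgebra.finrank_toSubmodule _).symm
    _ = Module.finrank Kp V := by rw [hEalg, hspan]
    _ = Fintype.card S := hV

/-- **PORT 1⁗ (graded data in a VALUATION `p`-FRAME — no ground-field separability).**  `M := K^p(g₀)` with its `p`-th-power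
values and RG for the frame `W`; `x, y ∈ 𝔪_v` with (P2); and the DOUBLE grading: every `a ∈ K` is `Σ_{s,(a,b)} m_{s,ab} W_s x^a y^b`
with `m ∈ M`, UNIQUELY (`{W_s x^a y^b}` is an `M`-basis of `K`: `[K : K^p(W)] = p³` (hdeg), `[K^p(W) : K^p] = |S|` (RG + the
multiplication table of the frame), `[K^p(g₀) : K^p] = p`), and every piece of an element of `O` lies in `O` (DG).  PROVED
(= PORT 1′ of `Lens5_TPrime.lean` with the constant family `b ⊆ k` replaced by an arbitrary frame `W ⊆ O_v`; ingredients
✓ ImmediateValues*, ✓ GradedBasis, §C RG + IR). [folklore] -/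
theorem port_gradedDataFrame (p : ℕ) [Fact p.Prime]
    {K : Type} [Field K] [CharP K p] (O : ValuationSubring K)
    (g₀ : K) (hg₀ : ∀ c : K, c ^ p ≠ g₀)
    (hdefect : ∀ f₀ : K, ∃ f₁ : K, O.valuation (g₀ - f₁ ^ p) < O.valuation (g₀ - f₀ ^ p))
    (hP2 : PRankTwoAt p O)
    {S : Type} [Fintype S] (W : S → K) (hPI : ResiduallyPIndependentFamily p O W)
    (hWmul : ∀ s t : S, ∃ d : S → K, W s * W t = ∑ u, d u ^ p * W u)
    (hW1 : ∃ d : S → K, ∑ u, d u ^ p * W u = 1)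
    (hdeg : Module.finrank (Subfield.closure (Set.range W ∪ Set.range (fun x : K => x ^ p))) K = p ^ 3) :
    ∃ (M : Subfield K), (∀ x : K, x ∈ M ↔ ∃ c : Fin p → K, ∑ j, c j ^ p * g₀ ^ (j : ℕ) = x) ∧ g₀ ∈ M ∧
      (∀ x : K, x ^ p ∈ M) ∧ (∀ m : K, m ∈ M → m ≠ 0 → ∃ w : K, w ≠ 0 ∧ O.valuation m = O.valuation (w ^ p)) ∧
      (∀ c : S → K, (∀ i, c i ∈ M) →
        O.valuation (∑ i : S, c i * W i) = Finset.univ.sup (fun i => O.valuation (c i))) ∧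
      ∃ (x y : K), x ≠ 0 ∧ y ≠ 0 ∧ O.valuation x < 1 ∧ O.valuation y < 1 ∧
        (∀ a b : ℕ, a < p → b < p → (a ≠ 0 ∨ b ≠ 0) → ∀ z : K, z ≠ 0 →
          O.valuation (x ^ a * y ^ b) ≠ O.valuation (z ^ p)) ∧
        (∀ f : S × (Fin p × Fin p) → K, (∀ l, f l ∈ M) →
          ∑ l, f l * (W l.1 * (x ^ (l.2.1 : ℕ) * y ^ (l.2.2 : ℕ))) = 0 → ∀ l, f l = 0) ∧
        ∃ (cf : K → S × (Fin p × Fin p) → K), (∀ a l, cf a l ∈ M) ∧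
          (∀ a, ∑ l : S × (Fin p × Fin p), cf a l * (W l.1 * (x ^ (l.2.1 : ℕ) * y ^ (l.2.2 : ℕ))) = a) ∧
          (∀ a, a ∈ O → ∀ l : S × (Fin p × Fin p), cf a l * (W l.1 * (x ^ (l.2.1 : ℕ) * y ^ (l.2.2 : ℕ))) ∈ O) := by
  classical
  have hp : p.Prime := Fact.out
  haveI : NeZero p := ⟨hp.ne_zero⟩
  -- ## `M = K^p(g₀)` with its `p`-th-power values (✓ ImmediateValues), IR (§C) and RG (§C)
  obtain ⟨M, hM, hg₀M, hpM, hV⟩ := ImmediateValues.exists_subfield_immediate_values (p := p) O.valuation g₀ hdefect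
  have hIR : ∀ m : K, m ∈ M → O.valuation m = 1 → ∃ w : K, O.valuation (m - w ^ p) < 1 :=
    fun m hm hvm => immediateResidues_of_noBestApprox O g₀ hdefect M hM m hm hvm
  have hRG : ∀ c : S → K, (∀ i, c i ∈ M) →
      O.valuation (∑ i : S, c i * W i) = Finset.univ.sup (fun i => O.valuation (c i)) :=
    fun c hc => valuation_sum_mul_family_eq_sup O M hIR W hPI c hc
  have hB1 : ∀ s, O.valuation (W s) = 1 := valuation_eq_one_of_residuallyPIndependentFamily O W hPI
  have hB0 : ∀ s, W s ≠ 0 := fun s h => by have := hB1 s; rw [h, map_zero] at this; exact zero_ne_one this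
  -- ## `S` is non-empty (`1 = Σ_s d_s^p W_s`)
  haveI : Nonempty S := by
    by_contra hS
    obtain ⟨d, hd⟩ := hW1
    have : (1 : K) = 0 := by rw [← hd]; exact Finset.sum_eq_zero fun s _ => (hS ⟨s⟩).elim
    exact one_ne_zero this
  -- ## `W` is `K^p`-linearly independent (by RG over `M ⊇ K^p`)
  set Kp : Subfield K := (frobenius K p).fieldRange with hKpdef
  have hKpM : ∀ z : K, z ∈ Kp → z ∈ M := by
    intro z hz
    obtain ⟨u, rfl⟩ := RingHom.mem_fieldRange.mp hz
    rw [frobenius_def]; exact hpM u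
  have hBli : LinearIndependent Kp W := by
    rw [Fintype.linearIndependent_iff]
    intro g hg i
    have hsum : ∑ i, (g i : K) * W i = 0 := by
      have : ∑ i, (g i : K) * W i = ∑ i, g i • W i :=
        Finset.sum_congr rfl fun i _ => (Subfield.smul_def (g i) _).symm
      rw [this, hg]
    have hv := hRG (fun i => (g i : K)) (fun i => hKpM _ (g i).2)
    rw [hsum, map_zero] at hv
    have hle : O.valuation (g i : K) ≤ Finset.univ.sup (fun i => O.valuation (g i : K)) :=
      Finset.le_sup (f := fun i => O.valuation (g i : K)) (Finset.mem_univ i)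
    rw [← hv, le_zero_iff, map_eq_zero] at hle
    exact_mod_cast hle
  -- ## degrees: `[K : K^p] = |S|·p³` (from (hdeg) `[K : K^p(W)] = p³` and `[K^p(W) : K^p] = |S|`), `[K : M] = |S|·p²`
  have hF₀ : (IntermediateField.adjoin Kp (Set.range W)).toSubfield =
      Subfield.closure (Set.range W ∪ Set.range (fun x : K => x ^ p)) := by
    rw [IntermediateField.adjoin_toSubfield]
    have hrange : Set.range (algebraMap Kp K) = Set.range (fun x : K => x ^ p) := by
      ext z
      constructor
      · rintro ⟨w, rfl⟩
        obtain ⟨u, hu⟩ := RingHom.mem_fieldRange.mp w.2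
        refine ⟨u, ?_⟩
        show u ^ p = (w : K)
        rw [← hu, frobenius_def]
      · rintro ⟨u, rfl⟩
        refine ⟨⟨u ^ p, RingHom.mem_fieldRange.mpr ⟨u, frobenius_def ..⟩⟩, ?_⟩
        rfl
    rw [hrange, Set.union_comm]
  have hdegF₀ : Module.finrank (IntermediateField.adjoin Kp (Set.range W)) K = p ^ 3 := by
    have h : Module.finrank (IntermediateField.adjoin Kp (Set.range W)).toSubfield K = p ^ 3 := by
      rw [hF₀]; exact hdeg
    exact h
  have hF₀deg : Module.finrank Kp (IntermediateField.adjoin Kp (Set.range W)) = Fintype.card S :=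
    finrank_adjoin_frame_eq_card W hWmul hW1 hBli
  have hKp : Module.finrank Kp K = Fintype.card S * p ^ 3 := by
    have htower := Module.finrank_mul_finrank Kp (IntermediateField.adjoin Kp (Set.range W)) K
    rw [hF₀deg, hdegF₀] at htower
    exact htower.symm
  have hMdeg : Module.finrank Kp (IntermediateField.adjoin Kp ({g₀} : Set K)) = p :=
    ImmediateValues.finrank_adjoin_pthPowers_eq g₀ hg₀
  have hfinM' : Module.finrank (IntermediateField.adjoin Kp ({g₀} : Set K)) K = Fintype.card S * p ^ 2 := by
    have htower := Module.finrank_mul_finrank Kp (IntermediateField.adjoin Kp ({g₀} : Set K)) K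
    rw [hMdeg, hKp] at htower
    have h' : p * Module.finrank (IntermediateField.adjoin Kp ({g₀} : Set K)) K = p * (Fintype.card S * p ^ 2) := by
      rw [htower]; ring
    exact Nat.eq_of_mul_eq_mul_left hp.pos h'
  have hMM : (IntermediateField.adjoin Kp ({g₀} : Set K)).toSubfield = M :=
    Subfield.ext fun z => (ImmediateValues.mem_adjoin_pthPowers_iff g₀ z).trans (hM z).symm
  have hfin : Module.finrank M K = Fintype.card S * p ^ 2 := by
    have h : Module.finrank (IntermediateField.adjoin Kp ({g₀} : Set K)).toSubfield K = Fintype.card S * p ^ 2 := hfinM'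
    rw [hMM] at h
    exact h
  -- ## (P2), normalised into the maximal ideal of `O` (as in Port 1)
  obtain ⟨x₀, y₀, hx₀, hy₀, hP₀⟩ := hP2
  obtain ⟨x, hx, hvx, hPx⟩ := exists_pRankTwo_lt_one_left hp O hx₀ hP₀
  obtain ⟨y, hy, hvy, hPy⟩ := exists_pRankTwo_lt_one_left hp O hy₀ (pRankTwo_swap O hPx)
  have hP := pRankTwo_swap O hPy
  -- ## the doubly graded representation
  have hDG := fun (m : S × (Fin p × Fin p) → K) (hm : ∀ l, m l ∈ M) =>
    valuation_term_le_double_sum hp O M hV W hB1 hRG hx hy hP m hm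
  set e : S × (Fin p × Fin p) → K :=
    fun l => W l.1 * (x ^ (l.2.1 : ℕ) * y ^ (l.2.2 : ℕ)) with he
  have he0 : ∀ l, e l ≠ 0 := fun l =>
    mul_ne_zero (hB0 _) (mul_ne_zero (pow_ne_zero _ hx) (pow_ne_zero _ hy))
  have hli : LinearIndependent M e := by
    rw [Fintype.linearIndependent_iff]
    intro g hg l
    have hsum : ∑ l, (g l : K) * e l = 0 := by
      have : ∑ l, (g l : K) * e l = ∑ l, g l • e l :=
        Finset.sum_congr rfl fun l _ => (Subfield.smul_def (g l) (e l)).symm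
      rw [this, hg]
    have hle := hDG (fun l => (g l : K)) (fun l => (g l).2) l
    simp only [he] at hsum
    rw [hsum, map_zero, le_zero_iff, map_eq_zero] at hle
    rcases mul_eq_zero.mp hle with h1 | h1
    · exact_mod_cast h1
    · exact absurd h1 (he0 l)
  have hLI : ∀ f : S × (Fin p × Fin p) → K, (∀ l, f l ∈ M) →
      ∑ l, f l * (W l.1 * (x ^ (l.2.1 : ℕ) * y ^ (l.2.2 : ℕ))) = 0 → ∀ l, f l = 0 := by
    intro f hf hsum l
    have h := Fintype.linearIndependent_iff.mp hli (fun l => (⟨f l, hf l⟩ : M)) ?_ l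
    · simpa using congrArg Subtype.val h
    · have : ∑ l, (⟨f l, hf l⟩ : M) • e l = ∑ l, f l * (W l.1 * (x ^ (l.2.1 : ℕ) * y ^ (l.2.2 : ℕ))) :=
        Finset.sum_congr rfl fun l _ => by rw [Subfield.smul_def, smul_eq_mul, he]
      rw [this, hsum]
  have hcard : Fintype.card (S × (Fin p × Fin p)) = Fintype.card S * p ^ 2 := by
    simp [Fintype.card_prod, Fintype.card_fin]; ring
  have hNpos : 0 < Fintype.card S * p ^ 2 := Nat.mul_pos Fintype.card_pos (pow_pos hp.pos 2)
  have hrepr : ∀ a : K, ∃ c : S × (Fin p × Fin p) → M, ∑ l, (c l : K) * e l = a := by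
    intro a
    obtain ⟨c, hc⟩ := ImmediateValues.exists_repr_of_linearIndependent_card_eq M hfin hNpos _ hli hcard a
    refine ⟨c, ?_⟩
    simpa only [Subfield.smul_def, smul_eq_mul] using hc
  choose c hc using hrepr
  refine ⟨M, hM, hg₀M, hpM, hV, hRG, x, y, hx, hy, hvx, hvy, hP, hLI, fun a l => (c a l : K),
    fun a l => (c a l).2, fun a => hc a, ?_⟩
  intro a haO l
  have hva : O.valuation a ≤ 1 := (O.valuation_le_one_iff a).mpr haO
  have hterm := hDG (fun l => (c a l : K)) (fun l => (c a l).2) l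
  simp only [he] at hc
  rw [hc a] at hterm
  exact (O.valuation_le_one_iff _).mp (hterm.trans hva)


/-! ## §E PORT 2′ — the monomialising regular `k^p`-model inside `M` (F-02 over the field `k^p`, F-32 verbatim) -/

open AlgebraicGeometry CategoryTheory in
set_option linter.unusedVariables false in
set_option maxHeartbeats 800000 in
/-- **PORT 2 core (Port 2b with the perfectness of `k` replaced by the twist-field identification `htwist` it is used for).**
VERBATIM copy of ✓ `PRankTwoAssembly.port_monomialModel` (Theorems/…PRankTwoPort2b.lean, res-B-lens-5 g10 / res-B-lead-1 g5) with:
generators `t` explicit; `[PerfectField k]` dropped; the single use of ✓ `adjoin_twist_toSubfield_eq_of_perfectField` replaced by the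
hypothesis `htwist`; the non-vanishing of the parameters `z` exported.  Consumes F-02 (`hLU`, via ✓ `TwistModel.exists_twist_model`) and
F-32 (`hEmb`, via ✓ `exists_localRing_monomial_of_embeddedResolution`).
[cite: CossartPiltant2019, Thm. 1.1; CossartJannsenSaito2020, Thm. 1.6.3 (F-32)] -/
theorem port_monomialModel_core (p : ℕ) [Fact p.Prime] {k : Type} [Field k]
    {K : Type} [Field K] [CharP K p] [Algebra k K] (hLU : LocalUniformization3 k)
    (hEmb : ∀ (Z : Scheme.{0}) [IsIntegral Z] [IsNoetherian Z], Scheme.IsRegular Z →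
      Scheme.IsExcellent Z → ∀ (X : Set Z), IsClosed X → X ≠ Set.univ → topologicalKrullDim X ≤ 2 →
        ∃ (Z' : Scheme.{0}) (π : Z' ⟶ Z), IsProper π ∧ Function.Surjective π.base ∧
          (∃ U : Z.Opens, (U : Set Z) = Xᶜ ∧ IsIso (π ∣_ U)) ∧
          IsStrictNormalCrossingsDivisor Z' (π.base ⁻¹' X))
    (O : ValuationSubring K) (A : Subalgebra k K)
    (hAO : A.toSubring ≤ O.toSubring) (hAfg : A.FG) [IsFractionRing A K] (hdimA : ringKrullDim A ≤ 3)
    (hdim3 : ringKrullDim (locAtCentre A.toSubring O) = 3)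
    (hzd : ∀ (T : Subring K) (hT : T ≤ O.toSubring), A.toSubring ≤ T → (subringCentre T O hT).IsMaximal)
    (t : Finset K) (ht : Algebra.adjoin k (t : Set K) = A)
    (htwist : ∀ g₁ : K, (IntermediateField.adjoin k ((fun x : K => x ^ p) '' (t : Set K) ∪ {g₁})).toSubfield =
      Subfield.closure (Set.range (frobenius K p) ∪ {g₁}))
    (g₀ : K) (M : Subfield K) (hM : ∀ x : K, x ∈ M ↔ ∃ c : Fin p → K, ∑ j, c j ^ p * g₀ ^ (j : ℕ) = x)
    (F : Finset K) (hFM : ∀ f ∈ F, f ∈ M) (hF0 : ∀ f ∈ F, f ≠ 0) :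
    ∃ (A₂ : Subalgebra k K) (hA₂O : A₂.toSubring ≤ O.toSubring), A₂.FG ∧ (∀ a ∈ A, a ^ p ∈ A₂) ∧
      (∀ r : K, r ∈ locAtCentre A₂.toSubring O → r ∈ M) ∧
      ∃ (_ : IsRegularLocalRing (locAtCentre A₂.toSubring O)) (z : Fin 3 → locAtCentre A₂.toSubring O),
        Ideal.span (Set.range z) = IsLocalRing.maximalIdeal (locAtCentre A₂.toSubring O) ∧
        ringKrullDim (locAtCentre A₂.toSubring O) = 3 ∧ (∀ i, ((z i : K)) ≠ 0) ∧
        ∀ f ∈ F, ∃ (ε : K) (e : Fin 3 → ℤ), ε ∈ locAtCentre A₂.toSubring O ∧ O.valuation ε = 1 ∧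
          f = ε * ∏ i, ((z i : K)) ^ (e i) := by
  /- (rev 5, res-B-lens-5 g10) PORT 2 PROVED — the docstring's recipe, with two remarks: (i) F-32 is invoked directly
     (✓ `exists_localRing_monomial_of_embeddedResolution`, `R ⊆ k(S) ⊆ K` with `IsScalarTower.of_algebraMap_eq fun _ => rfl`) on
     `xR = g · ∏_f c_f d_f`; every `c_f`, `d_f` then divides the monomial `u₂ ∏ z₂^α` in the re-modelled `R₂ = locAtCentre A₂ O`, so
     ✓ `exists_eq_units_mul_prod_pow_of_dvd` factors it; (ii) the `d = 3` pinning (closed centre on `A₂ ⊇ t^p`, `dim A₂ = dim A = 3`,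
     ✓ `ringKrullDim_locAtCentre_eq_of_isMaximal`) is the separate lemma ✓ `centre_closed_and_dim_three_of_pow_mem` — kept out of
     the main context on purpose (inlined, the kernel re-check of this block does not terminate in budget). -/
  classical
  have hp : p.Prime := Fact.out
  have hdimAeq : ringKrullDim A = 3 := ringKrullDim_eq_three_of_locAtCentre O A hAO hdimA hdim3
  have hk : ∀ c : k, algebraMap k K c ∈ O := fun c => hAO (A.algebraMap_mem c)
  -- the `k`-subalgebra `O` (for `Algebra.adjoin_le` arguments)
  let Ok : Subalgebra k K := { O.toSubring with algebraMap_mem' := hk }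
  have hOk : ∀ x : K, x ∈ Ok ↔ x ∈ O := fun _ => Iff.rfl
  obtain ⟨g₁, hg₁O, hg₁⟩ := TwistModel.mem_or_inv_mem_valuationSubring O g₀
  -- ## the twist field `k(S)`, `S = t^p ∪ {g₁}`, and its regular model (F-02 via ✓ `TwistModel.exists_twist_model`)
  set S : Set K := (fun x : K => x ^ p) '' (t : Set K) ∪ {g₁} with hSdef
  obtain ⟨A', hA'O', hSA', hA'fg, hreg', hexc, hdim', hRO, hRm⟩ :=
    TwistModel.exists_twist_model p hLU O A hAO hAfg hdimAeq t ht hzd g₁ hg₁O S hSdef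
  set R : Subring (IntermediateField.adjoin k S) :=
    locAtCentre A'.toSubring (O.comap (algebraMap (IntermediateField.adjoin k S) K)) with hRdef
  haveI : IsRegularLocalRing R := hreg'
  haveI : IsScalarTower R (IntermediateField.adjoin k S) K := IsScalarTower.of_algebraMap_eq (fun _ => rfl)
  have halgR : ∀ r : R, algebraMap R K r = ((r : IntermediateField.adjoin k S) : K) := fun _ => rfl
  -- ## `k(S)` has underlying subfield `M = K^p(g₀)` (perfect `k`)
  have hM'sub : (IntermediateField.adjoin k S).toSubfield = Subfield.closure (Set.range (frobenius K p) ∪ {g₀}) := by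
    rw [hSdef, htwist g₁]
    rcases hg₁ with h | h
    · rw [h]
    · rw [h, TwistModel.subfield_closure_union_inv_eq]
  have hM'M : ∀ x : K, x ∈ IntermediateField.adjoin k S ↔ x ∈ M := by
    intro x
    rw [← IntermediateField.mem_toSubfield, hM'sub]
    constructor
    · intro hx
      refine (Subfield.closure_le (t := M)).mpr ?_ hx
      rintro y (⟨c, rfl⟩ | hy)
      · refine (hM _).mpr ⟨fun j => if (j : ℕ) = 0 then c else 0, ?_⟩
        rw [Finset.sum_eq_single (⟨0, hp.pos⟩ : Fin p)]
        · simp [frobenius_def]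
        · intro j _ hj
          have hj' : (j : ℕ) ≠ 0 := fun h => hj (Fin.ext h)
          simp [hj', hp.ne_zero]
        · intro h; exact absurd (Finset.mem_univ _) h
      · rw [Set.mem_singleton_iff.mp hy]
        refine (hM _).mpr ⟨fun j => if (j : ℕ) = 1 then 1 else 0, ?_⟩
        rw [Finset.sum_eq_single (⟨1, hp.one_lt⟩ : Fin p)]
        · simp
        · intro j _ hj
          have hj' : (j : ℕ) ≠ 1 := fun h => hj (Fin.ext h)
          simp [hj', hp.ne_zero]
        · intro h; exact absurd (Finset.mem_univ _) h
    · intro hx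
      obtain ⟨c, rfl⟩ := (hM x).mp hx
      have hg₀c : g₀ ∈ Subfield.closure (Set.range (frobenius K p) ∪ {g₀}) := Subfield.subset_closure (Or.inr rfl)
      refine sum_mem fun j _ => mul_mem ?_ (pow_mem hg₀c _)
      exact Subfield.subset_closure (Or.inl ⟨c j, frobenius_def _ _⟩)
  -- ## every `f ∈ F` is a quotient of two non-zero elements of `k[S]`, which lift to `R`
  have hFfrac : ∀ f ∈ F, ∃ c d : K, c ∈ Algebra.adjoin k S ∧ d ∈ Algebra.adjoin k S ∧ c ≠ 0 ∧ d ≠ 0 ∧ f = c / d := by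
    intro f hf
    have hfM' : f ∈ IntermediateField.adjoin k S := (hM'M f).mpr (hFM f hf)
    obtain ⟨c, hc, d, hd, hcd⟩ := IntermediateField.mem_adjoin_iff_div.mp hfM'
    have hd0 : d ≠ 0 := by
      rintro rfl
      rw [div_zero] at hcd
      exact hF0 f hf hcd
    have hc0 : c ≠ 0 := by
      rintro rfl
      rw [zero_div] at hcd
      exact hF0 f hf hcd
    exact ⟨c, d, hc, hd, hc0, hd0, hcd⟩
  choose! cF dF hcF hdF hcF0 hdF0 hFeq using hFfrac
  have hpre : ∀ c : K, c ∈ Algebra.adjoin k S → ∃ r : R, algebraMap R K r = c := by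
    intro c hc
    have hcM' : c ∈ IntermediateField.adjoin k S := IntermediateField.algebra_adjoin_le_adjoin k S hc
    have h1 : (⟨c, hcM'⟩ : IntermediateField.adjoin k S) ∈ A' :=
      hSA' ((TwistModel.mem_adjoin_preimage_iff S ⟨c, hcM'⟩).mpr hc)
    exact ⟨⟨⟨c, hcM'⟩, le_locAtCentre A'.toSubring _ h1⟩, rfl⟩
  have hcpre : ∀ f ∈ F, ∃ r : R, algebraMap R K r = cF f := fun f hf => hpre _ (hcF f hf)
  have hdpre : ∀ f ∈ F, ∃ r : R, algebraMap R K r = dF f := fun f hf => hpre _ (hdF f hf)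
  choose! rc hrc using hcpre
  choose! rd hrd using hdpre
  -- ## the element to monomialise: `xR = g · ∏_f c_f d_f`, `0 ≠ g ∈ 𝔪_R`
  have hmne : maximalIdeal R ≠ ⊥ := by
    intro h
    have hf : IsField R := (IsLocalRing.isField_iff_maximalIdeal_eq).mpr h
    have h0 := ringKrullDim_eq_zero_of_isField hf
    rw [hdim'] at h0
    norm_num at h0
  obtain ⟨g, hgm, hg0⟩ := Submodule.exists_mem_ne_zero_of_ne_bot hmne
  set xR : R := g * ∏ f ∈ F, (rc f * rd f) with hxRdef
  have hxR0 : xR ≠ 0 := by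
    refine mul_ne_zero hg0 (Finset.prod_ne_zero_iff.mpr fun f hf => mul_ne_zero ?_ ?_)
    · intro h
      exact hcF0 f hf (by rw [← hrc f hf, h, map_zero])
    · intro h
      exact hdF0 f hf (by rw [← hrd f hf, h, map_zero])
  have hxRm : xR ∈ maximalIdeal R := Ideal.mul_mem_right _ _ hgm
  -- ## F-32 on the M-side model (✓ pattern of `TwistModel.monomialise_on_twist_model`)
  have hRO' : ∀ r : R, algebraMap R K r ∈ O := fun r => hRO r
  have hRm' : ∀ r : R, r ∈ maximalIdeal R ↔ O.valuation (algebraMap R K r) < 1 := fun r => hRm r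
  obtain ⟨uu, huuM', huuO, R', _, _, _, hinj, hR'O, hR'm, hlow, hup, d, z, α, u, hu, hdimR', hspan, hfact⟩ :=
    exists_localRing_monomial_of_embeddedResolution hEmb (R := R) (K := IntermediateField.adjoin k S) (E := K)
      Subtype.val_injective hexc hdim' O
      hRO' hRm' xR hxR0 hxRm
  -- ## RE-MODEL on the `K`-side: `T = R[uu]`, `B = A'` read in `K`, `A₂ = k[B ∪ uu]`, `locAtCentre T O = locAtCentre A₂ O`
  let T : Subring K := (Algebra.adjoin R (uu : Set K)).toSubring
  have hTO : T ≤ O.toSubring := fun w hw => huuO w hw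
  have hTR : ∀ w ∈ T, w ∈ Set.range (algebraMap R' K) := fun w hw => hlow w hw
  have hRT : ∀ r : R, algebraMap R K r ∈ T := fun r => (Algebra.adjoin R (uu : Set K)).algebraMap_mem r
  have huuO' : ∀ w ∈ (uu : Set K), w ∈ O := fun w hw => huuO w (Algebra.subset_adjoin hw)
  set φ : IntermediateField.adjoin k S →ₐ[k] K := IsScalarTower.toAlgHom k (IntermediateField.adjoin k S) K with hφdef
  have hφ : ∀ y : IntermediateField.adjoin k S, φ y = (y : K) := fun _ => rfl
  set B : Subalgebra k K := A'.map φ with hBdef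
  have hBfg : B.FG := hA'fg.map φ
  have hBO : ∀ x ∈ (B : Set K), x ∈ O := by
    intro x hx
    obtain ⟨y, hy, rfl⟩ := Subalgebra.mem_map.mp hx
    exact ValuationSubring.mem_comap.mp (hA'O' hy)
  set A₂ : Subalgebra k K := Algebra.adjoin k ((B : Set K) ∪ ↑uu) with hA₂def
  have hA₂fg : A₂.FG := fg_adjoin_subalgebra_union B hBfg uu
  have hBA₂ : B ≤ A₂ := fun x hx => Algebra.subset_adjoin (Or.inl hx)
  have huuA₂ : ∀ w ∈ (uu : Set K), w ∈ A₂ := fun w hw => Algebra.subset_adjoin (Or.inr hw)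
  have hA₂Ok : A₂ ≤ Ok := Algebra.adjoin_le (Set.union_subset hBO huuO')
  have hA₂O : A₂.toSubring ≤ O.toSubring := fun x hx => hA₂Ok hx
  -- values in `O ∩ k(S)` are read in `K`
  have hval1 : ∀ y : IntermediateField.adjoin k S, y ∈ O.comap (algebraMap (IntermediateField.adjoin k S) K) →
      ((O.comap (algebraMap (IntermediateField.adjoin k S) K)).valuation y = 1 ↔
        O.valuation (algebraMap (IntermediateField.adjoin k S) K y) = 1) := by
    intro y hy
    have hyO : algebraMap (IntermediateField.adjoin k S) K y ∈ O := ValuationSubring.mem_comap.mp hy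
    have hlt := TwistModel.valuation_comap_lt_one_iff O (IntermediateField.adjoin k S) y hy
    have hle' : (O.comap (algebraMap (IntermediateField.adjoin k S) K)).valuation y ≤ 1 :=
      ((O.comap (algebraMap (IntermediateField.adjoin k S) K)).valuation_le_one_iff y).mpr hy
    have hle : O.valuation (algebraMap (IntermediateField.adjoin k S) K y) ≤ 1 := (O.valuation_le_one_iff _).mpr hyO
    constructor
    · intro h1
      rcases hle.lt_or_eq with h | h
      · have h' := hlt.mpr h
        rw [h1] at h'
        exact absurd h' (lt_irrefl _)
      · exact h
    · intro h1
      rcases hle'.lt_or_eq with h | h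
      · have h' := hlt.mp h
        rw [h1] at h'
        exact absurd h' (lt_irrefl _)
      · exact h
  have hrangeR : Set.range (algebraMap R K) = (locAtCentre B.toSubring O : Set K) := by
    ext x
    constructor
    · rintro ⟨r, rfl⟩
      obtain ⟨y, hy, w, hw, hw1, hr⟩ := (mem_locAtCentre_iff).mp r.2
      have hyB : (y : K) ∈ B := Subalgebra.mem_map.mpr ⟨y, hy, rfl⟩
      have hwB : (w : K) ∈ B := Subalgebra.mem_map.mpr ⟨w, hw, rfl⟩
      have hw1' : O.valuation (w : K) = 1 := (hval1 w (hA'O' hw)).mp hw1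
      refine (mem_locAtCentre_iff).mpr ⟨y, hyB, w, hwB, hw1', ?_⟩
      rw [halgR, hr]
      push_cast
      rfl
    · intro hx
      obtain ⟨y, hy, w, hw, hw1, rfl⟩ := (mem_locAtCentre_iff).mp hx
      obtain ⟨y', hy', rfl⟩ := Subalgebra.mem_map.mp hy
      obtain ⟨w', hw', rfl⟩ := Subalgebra.mem_map.mp hw
      have hw'1 : (O.comap (algebraMap (IntermediateField.adjoin k S) K)).valuation w' = 1 := (hval1 w' (hA'O' hw')).mpr hw1
      refine ⟨⟨y' / w', (mem_locAtCentre_iff).mpr ⟨y', hy', w', hw', hw'1, rfl⟩⟩, ?_⟩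
      rw [halgR]
      push_cast
      rfl
  have hT : T = Subring.closure ((locAtCentre B.toSubring O : Set K) ∪ ↑uu) := by
    change (Algebra.adjoin R (uu : Set K)).toSubring = _
    rw [Algebra.adjoin_eq_ring_closure, hrangeR]
  have hR₂eq : locAtCentre T O = locAtCentre A₂.toSubring O := by
    rw [hT, Summit.ResolutionOfSingularities.ResolutionOfSingularities.Theorems.PfaffLine.locAtCentre_closure_locAtCentre_union, Subalgebra.coe_toSubring, closure_subalgebra_union_eq]
  -- regular data transported to `R₂ := locAtCentre A₂ O` along `R' ≅ range = R₂`
  set R₂ : Subring K := locAtCentre A₂.toSubring O with hR₂def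
  have hrange0 : (algebraMap R' K).range = locAtCentre T O :=
    Summit.ResolutionOfSingularities.ResolutionOfSingularities.Theorems.RadicialJung.CleanModels.range_eq_locAtCentre
      (algebraMap R' K) O T hTR hR'm hup
  have hrange : (algebraMap R' K).range = R₂ := hrange0.trans hR₂eq
  obtain ⟨hreg₂, z₂, u₂, hz₂, hu₂K, hspan₂, hdim₂, hu₂⟩ :=
    Summit.ResolutionOfSingularities.ResolutionOfSingularities.Theorems.RadicialJung.CleanModels.regular_data_of_range_eq
      (algebraMap R' K) hinj R₂ hrange z hspan hdimR' u hu
  haveI := hreg₂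
  have hR₂O : R₂ ≤ O.toSubring := locAtCentre_le hA₂O
  have hTR₂ : T ≤ R₂ := le_of_le_of_eq (le_locAtCentre T O) hR₂eq
  -- ## `S ⊆ B`, hence `t^p ⊆ A₂` and `A^p ⊆ A₂`
  have hSB : ∀ s ∈ S, s ∈ B := by
    intro s hs
    have hsM' : s ∈ IntermediateField.adjoin k S := IntermediateField.subset_adjoin k S hs
    have h1 : (⟨s, hsM'⟩ : IntermediateField.adjoin k S) ∈ A' :=
      hSA' (Algebra.subset_adjoin
        (show (⟨s, hsM'⟩ : IntermediateField.adjoin k S) ∈ (Subtype.val : IntermediateField.adjoin k S → K) ⁻¹' S from hs))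
    exact Subalgebra.mem_map.mpr ⟨⟨s, hsM'⟩, h1, rfl⟩
  have hAp : ∀ a ∈ A, a ^ p ∈ A₂ := by
    intro a ha
    have ha' : a ∈ Algebra.adjoin k (t : Set K) := by rw [ht]; exact ha
    have h1 := TwistModel.pow_mem_adjoin_image_pow p (t : Set K) ha'
    refine (Algebra.adjoin_le ?_ : Algebra.adjoin k ((fun x : K => x ^ p) '' (t : Set K)) ≤ A₂) h1
    intro s hs
    exact hBA₂ (hSB s (by rw [hSdef]; exact Or.inl hs))
  -- ## `d = 3`: ✓ `centre_closed_and_dim_three_of_pow_mem` (the centre of `O` on `A₂` is closed since `A₂[t] ⊇ A` is integral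
  -- over `A₂`, and `dim A₂ = dim A = 3`), compared with `dim R₂ = d` from the regular data
  have htpA₂ : ∀ a ∈ (t : Set K), a ^ p ∈ A₂ := fun a ha => hAp a (by rw [← ht]; exact Algebra.subset_adjoin ha)
  obtain ⟨-, -, hdimR₂'⟩ :=
    centre_closed_and_dim_three_of_pow_mem hp.pos O A hAO hAfg hdimAeq t ht hzd A₂ hA₂O hA₂fg htpA₂
  have hdimR₂ : ringKrullDim R₂ = 3 := hdimR₂'
  have hd3 : d = 3 := by
    have h := hdim₂.symm.trans hdimR₂
    exact_mod_cast h
  subst hd3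
  -- ## `z₂` is a regular system of parameters; `xR = u₂ ∏ z₂^α` in `R₂`
  have hd' : (maximalIdeal R₂).spanFinrank = 3 := by
    have h := IsRegularLocalRing.spanFinrank_maximalIdeal (R := R₂)
    rw [hdim₂] at h
    exact_mod_cast h
  have hzr : IsRsopPart z₂ := isRsopPart_comp_of_rsop hd' z₂ hspan₂ id Function.injective_id
  have hz0 : ∀ i, (z₂ i : K) ≠ 0 := fun i h => hzr.ne_zero i (Subtype.ext h)
  let ψ : R →+* R₂ := (algebraMap R K).codRestrict R₂ (fun r => hTR₂ (hRT r))
  have hψK : ∀ r : R, ((ψ r : R₂) : K) = algebraMap R K r := fun _ => rfl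
  have hfact₂ : ψ xR = u₂ * ∏ i, z₂ i ^ α i := by
    apply Subtype.ext
    rw [hψK, hfact]
    push_cast
    simp only [hu₂K, hz₂]
  -- ## `locAtCentre A₂ O ⊆ M`
  let MR : Subalgebra R K :=
    { (IntermediateField.adjoin k S).toSubalgebra.toSubring with
      algebraMap_mem' := fun r : R => ((r : IntermediateField.adjoin k S)).2 }
  have huuMR : (uu : Set K) ⊆ (MR : Set K) := by
    intro w hw
    obtain ⟨y, rfl⟩ := huuM' hw
    exact y.2
  have hTM' : ∀ x ∈ T, x ∈ IntermediateField.adjoin k S := fun x hx =>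
    (Algebra.adjoin_le huuMR : Algebra.adjoin R (uu : Set K) ≤ MR) hx
  have hR₂M : ∀ r : K, r ∈ locAtCentre A₂.toSubring O → r ∈ M := by
    intro r hr
    have hr' : r ∈ locAtCentre T O := (le_of_eq hR₂eq.symm) hr
    obtain ⟨y, hy, w, hw, -, rfl⟩ := mem_locAtCentre_iff.mp hr'
    exact (hM'M _).mp (div_mem (hTM' y hy) (hTM' w hw))
  -- ## assemble; per `f ∈ F`: `c_f`, `d_f` divide the monomial `u₂ ∏ z₂^α`, so `f = c_f / d_f` is a unit times a Laurent monomial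
  refine ⟨A₂, hA₂O, hA₂fg, hAp, hR₂M, hreg₂, z₂, hspan₂, hdimR₂, hz0, ?_⟩
  intro f hf
  have hsplit_c : xR = rc f * (g * rd f * ∏ f' ∈ F.erase f, (rc f' * rd f')) := by
    rw [hxRdef, ← Finset.mul_prod_erase F (fun f' => rc f' * rd f') hf]
    ring
  have hsplit_d : xR = rd f * (g * rc f * ∏ f' ∈ F.erase f, (rc f' * rd f')) := by
    rw [hxRdef, ← Finset.mul_prod_erase F (fun f' => rc f' * rd f') hf]
    ring
  have hdvd_c : ψ (rc f) ∣ ∏ i, z₂ i ^ α i :=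
    (hu₂.dvd_mul_left).mp ⟨ψ (g * rd f * ∏ f' ∈ F.erase f, (rc f' * rd f')), by rw [← map_mul, ← hsplit_c, hfact₂]⟩
  have hdvd_d : ψ (rd f) ∣ ∏ i, z₂ i ^ α i :=
    (hu₂.dvd_mul_left).mp ⟨ψ (g * rc f * ∏ f' ∈ F.erase f, (rc f' * rd f')), by rw [← map_mul, ← hsplit_d, hfact₂]⟩
  obtain ⟨c₁, β, hcβ⟩ := CossartPiltantMonomial.exists_eq_units_mul_prod_pow_of_dvd (fun i => hzr.prime i) α hdvd_c
  obtain ⟨c₂, γ, hdγ⟩ := CossartPiltantMonomial.exists_eq_units_mul_prod_pow_of_dvd (fun i => hzr.prime i) α hdvd_d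
  have hcK : cF f = ((c₁ : R₂) : K) * ∏ i, (z₂ i : K) ^ β i := by
    have h := congrArg (fun w : R₂ => (w : K)) hcβ
    simp only [hψK, hrc f hf] at h
    rw [h]
    push_cast
    rfl
  have hdK : dF f = ((c₂ : R₂) : K) * ∏ i, (z₂ i : K) ^ γ i := by
    have h := congrArg (fun w : R₂ => (w : K)) hdγ
    simp only [hψK, hrd f hf] at h
    rw [h]
    push_cast
    rfl
  let u' : R₂ := (c₁ * c₂⁻¹ : R₂ˣ)
  have hu' : IsUnit u' := Units.isUnit _
  let e : Fin 3 → ℤ := fun i => (β i : ℤ) - (γ i : ℤ)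
  have hc₂0 : ((c₂ : R₂) : K) ≠ 0 := fun h => by
    have : ((c₂ : R₂) : K) * ((↑(c₂⁻¹ : R₂ˣ) : R₂) : K) = 1 := by
      rw [← Subring.coe_mul, ← Units.val_mul, mul_inv_cancel, Units.val_one, Subring.coe_one]
    rw [h, zero_mul] at this
    exact zero_ne_one this
  have hu'K : (u' : K) = ((c₁ : R₂) : K) * (((c₂ : R₂) : K))⁻¹ := by
    have hinv : ((↑(c₂⁻¹ : R₂ˣ) : R₂) : K) = (((c₂ : R₂) : K))⁻¹ := by
      refine (eq_inv_of_mul_eq_one_right ?_)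
      rw [← Subring.coe_mul, ← Units.val_mul, mul_inv_cancel, Units.val_one, Subring.coe_one]
    change (((c₁ * c₂⁻¹ : R₂ˣ) : R₂) : K) = _
    rw [Units.val_mul, Subring.coe_mul, hinv]
  have hprod : (∏ i, (z₂ i : K) ^ (e i)) = (∏ i, (z₂ i : K) ^ β i) / ∏ i, (z₂ i : K) ^ γ i := by
    rw [← Finset.prod_div_distrib]
    refine Finset.prod_congr rfl fun i _ => ?_
    rw [zpow_sub₀ (hz0 i), zpow_natCast, zpow_natCast]
  refine ⟨(u' : K), e, u'.2, valuation_eq_one_of_isUnit_of_le O hR₂O hu', ?_⟩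
  calc f = cF f / dF f := hFeq f hf
    _ = (u' : K) * ∏ i, (z₂ i : K) ^ (e i) := by
        rw [hcK, hdK, hu'K, hprod, mul_div_mul_comm, div_eq_mul_inv]

/-! ## §G⁗ PORT 4⁗ — the ONE remaining typed obligation: the chart algebra of the FRAME-EXTENDED monomial model is regular with a
regular parameter in `M`

This is PORT 4b (✓ `Theorems/…Lens5PRankTwoPort4b.lean`, `port_regularParameter`: memo §13 (a)–(f)) with the constants of `k`
(units of `T`) replaced by an arbitrary finite MULTIPLICATIVE FRAME `W ⊆ O_v^×` over the regular local ring `T := locAtCentre A₂ O ⊆ M`: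
the generators are unit-weighted sums `Σ_l ν_l · W_{σ l} · u^{d_l}` (`ν_l ∈ T^× ∪ {0}`, `d_{<ρ} ≥ 0`), the list of generators contains
`1`, the frame and its pairwise products (so the `T[u_{<ρ}, u_{≥ρ}^{±1}]`-module `B_W := Σ_s W_s · T[u_{<ρ}, u_{≥ρ}^{±1}]` is a RING
containing the chart algebra), the frame is `M`-linearly independent jointly with the `x^a y^b` (`a, b < p`; so `B_W = ⊕_s W_s B₀` is
FREE over `B₀ := T[u_{<ρ}, u_{≥ρ}^{±1}] ⊆ M(x, y)`), and RESIDUALLY GRADED (RG: `v(Σ_s c_s W_s) = max_s v(c_s)` for `c_s ∈ M`; so the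
residues `W̄_s` are linearly independent over the residue field of `M ∩ O_v ⊇ B₀`).
HAND PROOF (memo CLASSBC §23 (F1)–(F5), res-B-lens-5 g15): `S := locAtCentre A'' O = (B_W)_{𝔪_v ∩ B_W} ⊇ S₀ := (B₀)_{𝔪_v ∩ B₀}`;
(F1) `S = ⊕_s W_s S₀` (freeness over `Frac B₀ ⊆ M(x,y) = ⊕_{a,b} M x^a y^b`; denominators: an element of `B_W` of value `0` is a unit of
`S`, and `N(b) := ∏_{σ ≠ 1} σ(b)`-free argument replaced by: `b ∈ B_W ∖ 𝔪_v` ⇒ `b S = S` and `S₀ + Σ W_s S₀` is closed under `b⁻¹·` because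
`B_W ⊗_{B₀} Frac(B₀) = Frac(B₀)(W)` is a FIELD (finite-dimensional domain) in which `b⁻¹` has coordinates in `(B₀)_{𝔪_v ∩ B₀} = S₀` — by RG
applied to `b · b⁻¹ = 1` after clearing denominators: see §23 (F1) for the determinant-free version); (F2) `S₀` is regular of dimension `3`
with a regular parameter `ψ ∈ M`: Port 4b's §13 (b)–(f) verbatim for the chart `T[u]` (`𝔫` prime suffices, rev 4), the dimension `dim S₀ = 3`
being imported from `dim S = 3` (hzd: `A ≤ A''`; `dim A'' = trdeg = 3`) by INTEGRALITY of `S = ⊕ W_s S₀` over `S₀`; (F3) `S` is local with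
`𝔪_S = 𝔪_{S₀} S`: `S/𝔪_{S₀}S = ⊕_s W̄_s κ_{S₀}` is a FIELD (the `W̄_s` are `κ_{S₀}`-linearly independent by RG since `κ_{S₀} ⊆ κ(M ∩ O_v) = κ_v^p`
(immediate residues of `M`), and a finite-dimensional domain); (F4) hence `𝔪_S` is generated by the `3 = dim S` regular parameters of `S₀`:
`S` is REGULAR; (F5) `ψ ∈ 𝔪_S ∖ 𝔪_S²`: `𝔪_S² = 𝔪_{S₀}² S = ⊕_s W_s 𝔪_{S₀}²` and `1 = Σ_s e_s W_s` with some `e_s ∈ S₀^×` (RG), so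
`ψ ∈ 𝔪_S²` would force `ψ e_s ∈ 𝔪_{S₀}²`, `ψ ∈ 𝔪_{S₀}²`.  Inputs a kernel proof needs beyond Port 4b's: «free finite extension with field
closed fibre of a regular local ring is regular local of the same dimension» and «`dim` is invariant under finite integral extensions of
domains» (Mathlib: `ringKrullDim` + `Algebra.IsIntegral`), both M-sized.  NOT PROVED HERE (typed obligation; size M–L). -/

/-- **PORT 4⁗ (typed obligation, NOT proved in this file): regularity of the frame-extended chart algebra with a regular parameter
in `M`.**  Hypotheses = Port 4b's (`port_regularParameter`, ✓ Port4b) over an arbitrary ground field `k` (applied below to `k₀ = k^p`),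
with `K`-valued parameters `z` of `T := locAtCentre A₂ O ⊆ M` (spanning `𝔪_T` in `K`-form), plus the frame data: `W : S → O_v^×`
residually graded over `M` (RG), `M`-linearly independent jointly with `x^a y^b` (`a, b < p`, `x^p, y^p ∈ M`), the chart monomials
`u_j = z^{e_j} x^{a_j} y^{b_j}`, and a finite generator list `t ∋ 1, W_s, W_s W_{s'}` with `A ≤ k[t]`, every member of which is a
unit-weighted sum of frame-chart monomials `ν_l W_{σ l} u^{d_l}` (`d_{<ρ} ≥ 0`).  Conclusion = Port 4b's.  See §G⁗ for the hand proof. [folklore] -/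
def FrameChartPort (p : ℕ) : Prop :=
    ∀ (k : Type) [Field k] (K : Type) [Field K] [Algebra k K] (O : ValuationSubring K) (A : Subalgebra k K)
    (hAO : A.toSubring ≤ O.toSubring), A.FG → IsFractionRing A K → ringKrullDim A ≤ 3 →
    ringKrullDim (locAtCentre A.toSubring O) = 3 →
    (∀ (T : Subring K) (hT : T ≤ O.toSubring), A.toSubring ≤ T → (subringCentre T O hT).IsMaximal) →
    ∀ (M : Subfield K) (A₂ : Subalgebra k K) (hA₂O : A₂.toSubring ≤ O.toSubring), A₂.FG →
    (∀ a ∈ A, a ^ p ∈ A₂) → (∀ r : K, r ∈ locAtCentre A₂.toSubring O → r ∈ M) →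
    IsRegularLocalRing (locAtCentre A₂.toSubring O) → ringKrullDim (locAtCentre A₂.toSubring O) = 3 →
    ∀ (z : Fin 3 → K), (∀ i, z i ∈ locAtCentre A₂.toSubring O) → (∀ i, z i ≠ 0) → (∀ i, O.valuation (z i) < 1) →
    (∀ r : K, r ∈ locAtCentre A₂.toSubring O → O.valuation r < 1 →
      ∃ b : Fin 3 → K, (∀ i, b i ∈ locAtCentre A₂.toSubring O) ∧ r = ∑ i, b i * z i) →
    -- the frame
    ∀ (S : Type) [Fintype S] (W : S → K), (∀ s, W s ∈ O) → (∀ s, O.valuation (W s) = 1) →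
    (∀ c : S → K, (∀ s, c s ∈ M) → O.valuation (∑ s, c s * W s) = Finset.univ.sup (fun s => O.valuation (c s))) →
    ∀ (x y : K), x ≠ 0 → y ≠ 0 → x ^ p ∈ M → y ^ p ∈ M → O.valuation x < 1 → O.valuation y < 1 →
    (∀ f : S × (Fin p × Fin p) → K, (∀ l, f l ∈ M) →
      ∑ l, f l * (W l.1 * (x ^ (l.2.1 : ℕ) * y ^ (l.2.2 : ℕ))) = 0 → ∀ l, f l = 0) →
    -- values: `M` has `p`-th-power values, (P2) for `x, y`, and the DOUBLE GRADEDNESS DG of the frame `{W_s x^a y^b}` over `M`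
    (∀ m : K, m ∈ M → m ≠ 0 → ∃ w : K, w ≠ 0 ∧ O.valuation m = O.valuation (w ^ p)) →
    (∀ a b : ℕ, a < p → b < p → (a ≠ 0 ∨ b ≠ 0) → ∀ z : K, z ≠ 0 → O.valuation (x ^ a * y ^ b) ≠ O.valuation (z ^ p)) →
    (∀ m : S × (Fin p × Fin p) → K, (∀ l, m l ∈ M) → ∀ l₀ : S × (Fin p × Fin p),
      O.valuation (m l₀ * (W l₀.1 * (x ^ (l₀.2.1 : ℕ) * y ^ (l₀.2.2 : ℕ)))) ≤
        O.valuation (∑ l, m l * (W l.1 * (x ^ (l.2.1 : ℕ) * y ^ (l.2.2 : ℕ))))) →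
    -- the generator list: contains `1`, the frame and its pairwise products, and generates an algebra containing `A`
    ∀ (t : Finset K), (∀ a ∈ t, a ∈ O) → A ≤ Algebra.adjoin k (t : Set K) → (1 : K) ∈ t → (∀ s, W s ∈ t) →
    (∀ s s' : S, W s * W s' ∈ t) →
    -- the toric chart
    ∀ (ρ : ℕ), (ρ = 1 ∨ ρ = 2) → ∀ (u : Fin 3 → K), (∀ j, u j ≠ 0) →
    (∀ j : Fin 3, (j : ℕ) < ρ → O.valuation (u j) < 1) → (∀ j : Fin 3, ρ ≤ (j : ℕ) → O.valuation (u j) = 1) →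
    (∀ j : Fin 3, ρ ≤ (j : ℕ) → u j ∈ M) →
    (∀ j : Fin 3, ∃ (e : Fin 3 → ℤ) (a b : ℕ), u j = (∏ i, z i ^ e i) * (x ^ a * y ^ b)) →
    (∀ i : Fin 3, ∃ (ε : K) (d : Fin 3 → ℤ), ε ∈ locAtCentre A₂.toSubring O ∧ O.valuation ε = 1 ∧
      (∀ j : Fin 3, (j : ℕ) < ρ → 0 ≤ d j) ∧ (∃ j : Fin 3, (j : ℕ) < ρ ∧ 0 < d j) ∧ z i = ε * ∏ j, u j ^ d j) →
    -- the normal forms of the generators in the frame chart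
    ∀ (L : Type) [Fintype L] (σ : L → S),
    (∀ a ∈ t, ∃ (ν : L → K) (d : L → Fin 3 → ℤ),
      (∀ l, ν l = 0 ∨ (ν l ∈ locAtCentre A₂.toSubring O ∧ O.valuation (ν l) = 1)) ∧
      (∀ l, ∀ j : Fin 3, (j : ℕ) < ρ → 0 ≤ d l j) ∧ a = ∑ l, ν l * W (σ l) * ∏ j, u j ^ d l j) →
    ∃ (A'' : Subalgebra k K), A''.toSubring ≤ O.toSubring ∧ A ≤ A'' ∧ A''.FG ∧
      ∃ (_ : IsRegularLocalRing (locAtCentre A''.toSubring O)) (ψ : locAtCentre A''.toSubring O),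
        ψ ∈ IsLocalRing.maximalIdeal (locAtCentre A''.toSubring O) ∧
        ψ ∉ (IsLocalRing.maximalIdeal (locAtCentre A''.toSubring O)) ^ 2 ∧ (ψ : K) ∈ M

/-! ## §G⁗.A — the CORE of ✓`port_regularParameter` (Port 4b) with the dimension of the chart ring as a HYPOTHESIS
Verbatim copy of ✓`Theorems…Port4b.port_regularParameter` (rev 4) with (a) removed: the chart algebra is `Algebra.adjoin k G` for any finite
`G ⊆ O` whose members are elements of `A₂`, the `u_j`, the `u_j⁻¹` (`j ≥ ρ`) or have a unit-monomial normal form, and `dim (locAtCentre (k[G]) O) = 3`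
is ASSUMED (no `A`, no `IsFractionRing`, no `hzd`).  Used twice below: for the frame-free chart ring `S₀` (no normal-form generators at all), where the
dimension comes from the frame-extended ring `S ⊇ S₀` by integrality. -/
theorem port_regularParameter_core {k : Type} [Field k]
    {K : Type} [Field K] [Algebra k K] (O : ValuationSubring K)
    (M : Subfield K) (A₂ : Subalgebra k K) (hA₂O : A₂.toSubring ≤ O.toSubring)
    (hA₂M : ∀ r : K, r ∈ locAtCentre A₂.toSubring O → r ∈ M)
    (hreg₂ : IsRegularLocalRing (locAtCentre A₂.toSubring O)) (z : Fin 3 → locAtCentre A₂.toSubring O)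
    (hz : Ideal.span (Set.range z) = IsLocalRing.maximalIdeal (locAtCentre A₂.toSubring O))
    (ρ : ℕ) (hρ : ρ = 1 ∨ ρ = 2) (u : Fin 3 → K) (hu0 : ∀ j, u j ≠ 0)
    (hupos : ∀ j : Fin 3, (j : ℕ) < ρ → O.valuation (u j) < 1)
    (huzero : ∀ j : Fin 3, ρ ≤ (j : ℕ) → O.valuation (u j) = 1)
    (huM : ∀ j : Fin 3, ρ ≤ (j : ℕ) → u j ∈ M)
    (hzu : ∀ i : Fin 3, ∃ (ε : K) (d : Fin 3 → ℤ), ε ∈ locAtCentre A₂.toSubring O ∧ O.valuation ε = 1 ∧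
      (∀ j : Fin 3, (j : ℕ) < ρ → 0 ≤ d j) ∧ (∃ j : Fin 3, (j : ℕ) < ρ ∧ 0 < d j) ∧ ((z i : K)) = ε * ∏ j, u j ^ d j)
    (G : Finset K) (hGO' : ∀ x ∈ G, x ∈ O) (hGu : ∀ j, u j ∈ G) (hGuinv : ∀ j : Fin 3, ρ ≤ (j : ℕ) → (u j)⁻¹ ∈ G)
    (hGgens : A₂ ≤ Algebra.adjoin k (G : Set K))
    (hGcases : ∀ x ∈ G, x ∈ A₂ ∨ (∃ j, x = u j) ∨ (∃ j : Fin 3, ρ ≤ (j : ℕ) ∧ x = (u j)⁻¹) ∨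
      (∃ (L : Type) (_ : Fintype L) (ν : L → K) (d : L → Fin 3 → ℤ),
        (∀ l, ν l = 0 ∨ (ν l ∈ locAtCentre A₂.toSubring O ∧ O.valuation (ν l) = 1)) ∧
        (∀ l, ∀ j : Fin 3, (j : ℕ) < ρ → 0 ≤ d l j) ∧ x = ∑ l, ν l * ∏ j, u j ^ d l j))
    (hdimS : ringKrullDim (locAtCentre (Algebra.adjoin k (G : Set K)).toSubring O) = 3) :
    ∃ (_ : IsRegularLocalRing (locAtCentre (Algebra.adjoin k (G : Set K)).toSubring O))
      (ψ : locAtCentre (Algebra.adjoin k (G : Set K)).toSubring O),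
        ψ ∈ IsLocalRing.maximalIdeal (locAtCentre (Algebra.adjoin k (G : Set K)).toSubring O) ∧
        ψ ∉ (IsLocalRing.maximalIdeal (locAtCentre (Algebra.adjoin k (G : Set K)).toSubring O)) ^ 2 ∧ (ψ : K) ∈ M := by
  classical
  /- (rev 4, res-B-lens-5 g10) PORT 4 PROVED — memo §13 (a)–(f) with ONE simplification: the maximality of `𝔫` (§13 (c1), Zariski) is
  not needed; `P := κ_T[U]_𝔫` at the PRIME `𝔫 = F⁻¹(𝔪)` is a regular local domain whose dimension is pinned to `3 - ρ` by the surjection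
  `P ↠ S⧸𝔞` and Krull (`localization_mvPolynomial_regular_of_surjective`). -/
  have hρ3 : ρ ≤ 3 := by rcases hρ with rfl | rfl <;> norm_num
  have hk : ∀ c : k, algebraMap k K c ∈ A₂ := fun c => A₂.algebraMap_mem c
  have huO : ∀ j, u j ∈ O := fun j => (O.valuation_le_one_iff _).mp (by
    by_cases hj : (j : ℕ) < ρ
    · exact (hupos j hj).le
    · exact (huzero j (not_lt.mp hj)).le)
  have huinvO : ∀ j : Fin 3, ρ ≤ (j : ℕ) → (u j)⁻¹ ∈ O := fun j hj =>
    (O.valuation_le_one_iff _).mp (by rw [map_inv₀, huzero j hj, inv_one])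
  -- §13 (a): the chart algebra `A'' = k[gens A₂, u, u_{≥ρ}⁻¹, t]` and its local ring `S = locAtCentre A'' O`
  set Z : Finset (Fin 3) := Finset.univ.filter (fun j => ρ ≤ (j : ℕ)) with hZdef
  have hZ : ∀ j : Fin 3, j ∈ Z ↔ ρ ≤ (j : ℕ) := fun j => by simp [hZdef]
  set A'' : Subalgebra k K := Algebra.adjoin k (G : Set K) with hA''def
  have hGA'' : ∀ x ∈ G, x ∈ A'' := fun x hx => Algebra.subset_adjoin (Finset.mem_coe.mpr hx)
  let Oₖ : Subalgebra k K :=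
    { O.toSubring with algebraMap_mem' := fun c => hA₂O (A₂.algebraMap_mem c) }
  have hGO : (G : Set K) ⊆ (Oₖ : Set K) := fun x hx => hGO' x (Finset.mem_coe.mp hx)
  have hA''O : A''.toSubring ≤ O.toSubring := fun x hx => (Algebra.adjoin_le hGO : A'' ≤ Oₖ) hx
  have hA₂A'' : A₂ ≤ A'' := hGgens
  have hA''fg : A''.FG := ⟨G, hA''def.symm⟩
  have huA'' : ∀ j, u j ∈ A'' := fun j => hGA'' _ (hGu j)
  have huS : ∀ j, u j ∈ locAtCentre A''.toSubring O := fun j => le_locAtCentre _ O (huA'' j)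
  have hTS : locAtCentre A₂.toSubring O ≤ locAtCentre A''.toSubring O := locAtCentre_mono O (fun x hx => hA₂A'' hx)
  haveI hSloc : IsLocalRing (locAtCentre A''.toSubring O) := isLocalRing_locAtCentre hA''O
  haveI : IsLocalization.AtPrime (locAtCentre A''.toSubring O) (subringCentre A''.toSubring O hA''O) :=
    isLocalization_locAtCentre hA''O
  letI : Algebra k A''.toSubring := inferInstanceAs (Algebra k A'')
  haveI : Algebra.FiniteType k A''.toSubring := (A''.fg_iff_finiteType.mp hA''fg : Algebra.FiniteType k A'')
  haveI hSnoeth : IsNoetherianRing (locAtCentre A''.toSubring O) :=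
    IsLocalization.isNoetherianRing (subringCentre A''.toSubring O hA''O).primeCompl (locAtCentre A''.toSubring O)
      (Algebra.FiniteType.isNoetherianRing k A''.toSubring)
  have hdimS3 : ringKrullDim (locAtCentre A''.toSubring O) = ((3 : ℕ) : WithBot ℕ∞) := by rw [hdimS]; norm_cast
  -- §13 (b): `𝔞 := (u_{<ρ})` contains `𝔪_T · S`
  set uS : Fin 3 → locAtCentre A''.toSubring O := fun j => ⟨u j, huS j⟩ with huSdef
  set uρ : Fin ρ → locAtCentre A''.toSubring O := fun i => uS (Fin.castLE hρ3 i) with huρdef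
  have huρ : ∀ i, uρ i ∈ maximalIdeal (locAtCentre A''.toSubring O) := fun i =>
    (mem_maximalIdeal_locAtCentre_iff hA''O _).mpr (hupos (Fin.castLE hρ3 i) (by simp))
  have huS𝔞 : ∀ j : Fin 3, (j : ℕ) < ρ → uS j ∈ Ideal.span (Set.range uρ) := fun j hj =>
    Ideal.subset_span ⟨⟨j, hj⟩, congrArg uS (Fin.ext rfl)⟩
  set ι : locAtCentre A₂.toSubring O →+* locAtCentre A''.toSubring O := Subring.inclusion hTS with hιdef
  have hιval : ∀ a, ((ι a : locAtCentre A''.toSubring O) : K) = a := fun a => rfl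
  have hzS : ∀ i : Fin 3, ι (z i) ∈ Ideal.span (Set.range uρ) := by
    intro i
    obtain ⟨ε, d, hεT, hεv, hdnn, ⟨j₀, hj₀, hdj₀⟩, hzi⟩ := hzu i
    set d' : Fin 3 → ℤ := Function.update d j₀ (d j₀ - 1) with hd'def
    have hd'j₀ : d' j₀ = d j₀ - 1 := by rw [hd'def, Function.update_self]
    have hd'ne : ∀ j, j ≠ j₀ → d' j = d j := fun j hj => by rw [hd'def, Function.update_of_ne hj]
    have hd'nn : ∀ j : Fin 3, (j : ℕ) < ρ → 0 ≤ d' j := by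
      intro j hj
      by_cases hjj : j = j₀
      · rw [hjj, hd'j₀]; omega
      · rw [hd'ne j hjj]; exact hdnn j hj
    have hw'mem : ε * ∏ j, u j ^ d' j ∈ locAtCentre A''.toSubring O := by
      refine mul_mem (hTS hεT) (prod_mem fun j _ => ?_)
      by_cases hj : (j : ℕ) < ρ
      · exact zpow_mem_of_nonneg (huS j) (hd'nn j hj)
      · exact zpow_mem_of_inv_mem (huS j) (inv_mem_locAtCentre (huS j) (huzero j (not_lt.mp hj))) (d' j)
    have he : ∏ j ∈ Finset.univ.erase j₀, u j ^ d' j = ∏ j ∈ Finset.univ.erase j₀, u j ^ d j :=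
      Finset.prod_congr rfl fun j hj => by rw [hd'ne j (Finset.ne_of_mem_erase hj)]
    have hsplit : ε * ∏ j, u j ^ d j = (ε * ∏ j, u j ^ d' j) * u j₀ := by
      rw [← Finset.mul_prod_erase Finset.univ (fun j => u j ^ d j) (Finset.mem_univ j₀),
        ← Finset.mul_prod_erase Finset.univ (fun j => u j ^ d' j) (Finset.mem_univ j₀)]
      show ε * (u j₀ ^ d j₀ * ∏ j ∈ Finset.univ.erase j₀, u j ^ d j) =
        ε * (u j₀ ^ d' j₀ * ∏ j ∈ Finset.univ.erase j₀, u j ^ d' j) * u j₀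
      rw [he, hd'j₀, zpow_sub_one₀ (hu0 j₀)]
      have h0 : (u j₀)⁻¹ * u j₀ = 1 := inv_mul_cancel₀ (hu0 j₀)
      calc ε * (u j₀ ^ d j₀ * ∏ j ∈ Finset.univ.erase j₀, u j ^ d j)
          = ε * (u j₀ ^ d j₀ * ((u j₀)⁻¹ * u j₀) * ∏ j ∈ Finset.univ.erase j₀, u j ^ d j) := by rw [h0, mul_one]
        _ = ε * (u j₀ ^ d j₀ * (u j₀)⁻¹ * ∏ j ∈ Finset.univ.erase j₀, u j ^ d j) * u j₀ := by ring
    have hιz : ι (z i) = ⟨ε * ∏ j, u j ^ d' j, hw'mem⟩ * uS j₀ := by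
      apply Subtype.ext
      show ((z i : K)) = (ε * ∏ j, u j ^ d' j) * u j₀
      rw [hzi, hsplit]
    rw [hιz]
    exact Ideal.mul_mem_left _ _ (huS𝔞 j₀ hj₀)
  -- §13 (c): `E := S ⧸ 𝔞` is local; `F₁ : κ_T → E` (`𝔪_T ↦ 0`), `F : κ_T[U_{≥ρ}] → E`, `𝔫 := F⁻¹ 𝔪_E`, `P := κ_T[U]_𝔫`
  have h𝔞m : Ideal.span (Set.range uρ) ≤ maximalIdeal (locAtCentre A''.toSubring O) := by
    rw [Ideal.span_le]; rintro _ ⟨i, rfl⟩; exact huρ i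
  have h𝔞top : Ideal.span (Set.range uρ) ≠ ⊤ := fun h =>
    (maximalIdeal.isMaximal (locAtCentre A''.toSubring O)).ne_top (top_le_iff.mp (h ▸ h𝔞m))
  haveI : Nontrivial (locAtCentre A''.toSubring O ⧸ Ideal.span (Set.range uρ)) :=
    Ideal.Quotient.nontrivial_iff.mpr h𝔞top
  haveI : IsLocalRing (locAtCentre A''.toSubring O ⧸ Ideal.span (Set.range uρ)) :=
    IsLocalRing.of_surjective' (Ideal.Quotient.mk _) Ideal.Quotient.mk_surjective
  have hkill : ∀ a ∈ maximalIdeal (locAtCentre A₂.toSubring O),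
      ((Ideal.Quotient.mk (Ideal.span (Set.range uρ))).comp ι) a = 0 := by
    have hmap : (maximalIdeal (locAtCentre A₂.toSubring O)).map ι ≤ Ideal.span (Set.range uρ) := by
      rw [← hz, Ideal.map_span, Ideal.span_le]
      rintro _ ⟨_, ⟨i, rfl⟩, rfl⟩
      exact hzS i
    intro a ha
    rw [RingHom.comp_apply, Ideal.Quotient.eq_zero_iff_mem]
    exact hmap (Ideal.mem_map_of_mem ι ha)
  set F₁ : ResidueField (locAtCentre A₂.toSubring O) →+* (locAtCentre A''.toSubring O ⧸ Ideal.span (Set.range uρ)) :=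
    Ideal.Quotient.lift (maximalIdeal (locAtCentre A₂.toSubring O))
      ((Ideal.Quotient.mk (Ideal.span (Set.range uρ))).comp ι) hkill with hF₁def
  have hF₁ : ∀ a, F₁ (residue _ a) = Ideal.Quotient.mk _ (ι a) := fun a => by
    rw [hF₁def]; exact Ideal.Quotient.lift_mk _ _ _
  set zI : Fin (3 - ρ) → Fin 3 := fun i => ⟨ρ + (i : ℕ), by have := i.2; omega⟩ with hzIdef
  have hzIval : ∀ i, ((zI i : Fin 3) : ℕ) = ρ + (i : ℕ) := fun i => rfl
  have hzIρ : ∀ i, ρ ≤ ((zI i : Fin 3) : ℕ) := fun i => by rw [hzIval]; omega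
  set F : MvPolynomial (Fin (3 - ρ)) (ResidueField (locAtCentre A₂.toSubring O)) →+*
      (locAtCentre A''.toSubring O ⧸ Ideal.span (Set.range uρ)) :=
    MvPolynomial.eval₂Hom F₁ (fun i => Ideal.Quotient.mk (Ideal.span (Set.range uρ)) (uS (zI i))) with hFdef
  have hFC : ∀ r, F (MvPolynomial.C r) = F₁ r := fun r => by rw [hFdef]; exact MvPolynomial.eval₂Hom_C _ _ r
  have hFX : ∀ i, F (MvPolynomial.X i) = Ideal.Quotient.mk (Ideal.span (Set.range uρ)) (uS (zI i)) := fun i => by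
    rw [hFdef]; exact MvPolynomial.eval₂Hom_X' _ _ i
  set 𝔫 : Ideal (MvPolynomial (Fin (3 - ρ)) (ResidueField (locAtCentre A₂.toSubring O))) :=
    (maximalIdeal (locAtCentre A''.toSubring O ⧸ Ideal.span (Set.range uρ))).comap F with h𝔫def
  haveI h𝔫prime : 𝔫.IsPrime := Ideal.IsPrime.comap F
  obtain ⟨hunit, h𝔫u⟩ := primeCompl_comap_maximalIdeal F
  -- the normal form on `A''`: `R₀ := T[u] ⊆ S`, `w := ∏_{j ≥ ρ} u_j`, every `x ∈ A''` has `x · w^N ∈ R₀`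
  set R₀ : Subring K := Subring.closure ((locAtCentre A₂.toSubring O : Set K) ∪ Set.range u) with hR₀def
  have hTR₀ : ∀ x ∈ locAtCentre A₂.toSubring O, x ∈ R₀ := fun x hx => by
    rw [hR₀def]; exact Subring.subset_closure (Or.inl hx)
  have huR₀ : ∀ j, u j ∈ R₀ := fun j => by rw [hR₀def]; exact Subring.subset_closure (Or.inr ⟨j, rfl⟩)
  have hR₀S : R₀ ≤ locAtCentre A''.toSubring O := by
    rw [hR₀def, Subring.closure_le]
    rintro x (hx | ⟨j, rfl⟩)
    · exact hTS hx
    · exact huS j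
  set w : K := ∏ j ∈ Z, u j with hwdef
  have hwv : O.valuation w = 1 := by
    rw [hwdef, map_prod]; exact Finset.prod_eq_one fun j hj => huzero j ((hZ j).mp hj)
  have hwR₀ : w ∈ R₀ := by rw [hwdef]; exact prod_mem fun j _ => huR₀ j
  have huinv : ∀ j ∈ Z, NF R₀ w (u j)⁻¹ := by
    intro j hj
    refine ⟨1, ?_⟩
    rw [pow_one, hwdef, ← Finset.mul_prod_erase Z u hj, inv_mul_cancel_left₀ (hu0 j)]
    exact prod_mem fun i _ => huR₀ i
  have hNF : ∀ x ∈ A'', NF R₀ w x := by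
    intro x hx
    rw [hA''def] at hx
    induction hx using Algebra.adjoin_induction with
    | mem x hx =>
      rcases hGcases x (Finset.mem_coe.mp hx) with hx | ⟨j, rfl⟩ | ⟨j, hj, rfl⟩ | ⟨L, instL, ν, d, hν, hd, rfl⟩
      · exact NF.of_mem (hTR₀ x (le_locAtCentre _ O hx))
      · exact NF.of_mem (huR₀ j)
      · exact huinv j ((hZ j).mpr hj)
      · refine NF.sum _ _ hwR₀ fun l _ => NF.mul ?_ (NF.prod _ _ fun j _ => ?_)
        · rcases hν l with h0 | ⟨hνT, -⟩
          · rw [h0]; exact NF.zero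
          · exact NF.of_mem (hTR₀ _ hνT)
        · by_cases hj : (j : ℕ) < ρ
          · exact (NF.of_mem (huR₀ j)).zpow_of_nonneg (hd l j hj)
          · exact (NF.of_mem (huR₀ j)).zpow (huinv j ((hZ j).mpr (not_lt.mp hj))) (d l j)
    | algebraMap c => exact NF.of_mem (hTR₀ _ (le_locAtCentre _ O (hk c)))
    | add x y hx hy ihx ihy => exact ihx.add hwR₀ ihy
    | mul x y hx hy ihx ihy => exact ihx.mul ihy
  -- (c2) normal form of the fractions `s = y / x ∈ S` and the preimages under `F`
  have hloc : ∀ s : locAtCentre A''.toSubring O, ∃ b c : locAtCentre A''.toSubring O,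
      b ∈ {s : locAtCentre A''.toSubring O | (s : K) ∈ R₀} ∧ c ∈ {s : locAtCentre A''.toSubring O | (s : K) ∈ R₀} ∧
      IsUnit (Ideal.Quotient.mk (Ideal.span (Set.range uρ)) c) ∧ s * c - b ∈ Ideal.span (Set.range uρ) := by
    intro s
    obtain ⟨y, hy, x, hx, hxv, hs⟩ := (mem_locAtCentre_iff).mp s.2
    obtain ⟨N₁, hN₁⟩ := hNF y hy
    obtain ⟨N₂, hN₂⟩ := hNF x hx
    have hb : y * w ^ N₁ * w ^ N₂ ∈ R₀ := R₀.mul_mem hN₁ (R₀.pow_mem hwR₀ N₂)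
    have hc : x * w ^ N₂ * w ^ N₁ ∈ R₀ := R₀.mul_mem hN₂ (R₀.pow_mem hwR₀ N₁)
    refine ⟨⟨_, hR₀S hb⟩, ⟨_, hR₀S hc⟩, hb, hc, ?_, ?_⟩
    · refine IsUnit.map _ (notMem_maximalIdeal.mp fun hm => ?_)
      have hlt : O.valuation (x * w ^ N₂ * w ^ N₁) < 1 := (mem_maximalIdeal_locAtCentre_iff hA''O _).mp hm
      rw [map_mul, map_mul, map_pow, map_pow, hxv, hwv, one_pow, one_pow, mul_one, mul_one] at hlt
      exact lt_irrefl _ hlt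
    · have h0 : x ≠ 0 := ne_zero_of_valuation_eq_one hxv
      have hzero : s * ⟨_, hR₀S hc⟩ - ⟨_, hR₀S hb⟩ = (0 : locAtCentre A''.toSubring O) := by
        apply Subtype.ext
        show (s : K) * (x * w ^ N₂ * w ^ N₁) - y * w ^ N₁ * w ^ N₂ = 0
        rw [hs, sub_eq_zero]
        calc y / x * (x * w ^ N₂ * w ^ N₁) = (y / x * x) * (w ^ N₂ * w ^ N₁) := by ring
          _ = y * w ^ N₁ * w ^ N₂ := by rw [div_mul_cancel₀ y h0]; ring
      rw [hzero]; exact Ideal.zero_mem _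
  have hF : ∀ b ∈ {s : locAtCentre A''.toSubring O | (s : K) ∈ R₀},
      Ideal.Quotient.mk (Ideal.span (Set.range uρ)) b ∈ F.range := by
    have key : ∀ x ∈ R₀, ∃ hx : x ∈ locAtCentre A''.toSubring O,
        Ideal.Quotient.mk (Ideal.span (Set.range uρ)) ⟨x, hx⟩ ∈ F.range := by
      intro x hx
      rw [hR₀def] at hx
      induction hx using Subring.closure_induction with
      | mem x hx =>
        rcases hx with hx | ⟨j, rfl⟩
        · refine ⟨hTS hx, RingHom.mem_range.mpr ⟨MvPolynomial.C (residue _ ⟨x, hx⟩), ?_⟩⟩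
          rw [hFC, hF₁]
          rfl
        · by_cases hj : (j : ℕ) < ρ
          · refine ⟨huS j, RingHom.mem_range.mpr ⟨0, ?_⟩⟩
            rw [map_zero]
            exact (Ideal.Quotient.eq_zero_iff_mem.mpr (huS𝔞 j hj)).symm
          · have hj3 : (j : ℕ) - ρ < 3 - ρ := by have := j.2; omega
            refine ⟨huS j, RingHom.mem_range.mpr ⟨MvPolynomial.X ⟨(j : ℕ) - ρ, hj3⟩, ?_⟩⟩
            rw [hFX]
            have hjj : zI ⟨(j : ℕ) - ρ, hj3⟩ = j := Fin.ext (by rw [hzIval]; simp only; omega)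
            rw [hjj]
      | zero => exact ⟨Subring.zero_mem _, RingHom.mem_range.mpr ⟨0, by rw [map_zero]; exact (map_zero _).symm⟩⟩
      | one => exact ⟨Subring.one_mem _, RingHom.mem_range.mpr ⟨1, by rw [map_one]; exact (map_one _).symm⟩⟩
      | add x y hx hy ihx ihy =>
        obtain ⟨hxS, hx'⟩ := ihx
        obtain ⟨hyS, hy'⟩ := ihy
        obtain ⟨qx, hqx⟩ := RingHom.mem_range.mp hx'
        obtain ⟨qy, hqy⟩ := RingHom.mem_range.mp hy'
        exact ⟨add_mem hxS hyS, RingHom.mem_range.mpr ⟨qx + qy, by rw [map_add, hqx, hqy, ← map_add]; rfl⟩⟩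
      | neg x hx ih =>
        obtain ⟨hxS, hx'⟩ := ih
        obtain ⟨qx, hqx⟩ := RingHom.mem_range.mp hx'
        exact ⟨neg_mem hxS, RingHom.mem_range.mpr ⟨-qx, by rw [map_neg, hqx, ← map_neg]; rfl⟩⟩
      | mul x y hx hy ihx ihy =>
        obtain ⟨hxS, hx'⟩ := ihx
        obtain ⟨hyS, hy'⟩ := ihy
        obtain ⟨qx, hqx⟩ := RingHom.mem_range.mp hx'
        obtain ⟨qy, hqy⟩ := RingHom.mem_range.mp hy'
        exact ⟨mul_mem hxS hyS, RingHom.mem_range.mpr ⟨qx * qy, by rw [map_mul, hqx, hqy, ← map_mul]; rfl⟩⟩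
    intro b hb
    obtain ⟨hbS, h⟩ := key (b : K) hb
    exact h
  have hf : Function.Surjective (IsLocalization.lift (S := Localization.AtPrime 𝔫) hunit) :=
    lift_surjective_of_normal_form (P := Localization.AtPrime 𝔫) _ _ hloc F hF 𝔫 hunit h𝔫u
  -- §13 (d): `P` is a regular local domain of dimension `3 - ρ` (pinned by the surjection)
  have hEdim : ((3 - ρ : ℕ) : WithBot ℕ∞) ≤ ringKrullDim (locAtCentre A''.toSubring O ⧸ Ideal.span (Set.range uρ)) :=
    natCast_sub_le_ringKrullDim_quotient_span (n := 3) hdimS3 uρ huρ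
  obtain ⟨hPreg, hPdom, hdimP⟩ :=
    localization_mvPolynomial_regular_of_surjective (ResidueField (locAtCentre A₂.toSubring O)) (3 - ρ) 𝔫 _ hf hEdim
  -- §13 (e): the criterion — `S` is REGULAR and lifts of regular parameters of `P` are regular parameters of `S`
  obtain ⟨hregS, -, -, hlift1, hlift2⟩ :=
    regular_of_regular_quotient (n := 3) (ρ := ρ) hdimS3 hρ3 uρ huρ hdimP (IsLocalization.lift hunit) hf
  -- §13 (f): a generator `q ∈ 𝔫` mapping to a regular parameter of `P`, its lift `ψ ∈ T[u_{≥ρ}] ⊆ S`, and `ψ ∈ M`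
  have hdimP0 : ringKrullDim (Localization.AtPrime 𝔫) ≠ 0 := by
    rw [hdimP]
    have h : (3 - ρ : ℕ) ≠ 0 := by omega
    exact_mod_cast h
  obtain ⟨q, hq𝔫, hq1, hq2⟩ := exists_generator_map_not_mem_sq hdimP0 (algebraMap _ (Localization.AtPrime 𝔫))
    (𝔫 : Set (MvPolynomial (Fin (3 - ρ)) (ResidueField (locAtCentre A₂.toSubring O))))
    (by rw [Ideal.span_eq]; exact Localization.AtPrime.map_eq_maximalIdeal)
  have hres : ∀ e : Fin (3 - ρ) →₀ ℕ, ∃ c : locAtCentre A₂.toSubring O, residue _ c = q.coeff e := fun e =>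
    Ideal.Quotient.mk_surjective (q.coeff e)
  choose lam hlam using hres
  set ψ : locAtCentre A''.toSubring O := ∑ e ∈ q.support, ι (lam e) * ∏ i, uS (zI i) ^ (e i) with hψdef
  have hψF : Ideal.Quotient.mk (Ideal.span (Set.range uρ)) ψ = F q := by
    rw [hψdef, map_sum, hFdef, MvPolynomial.coe_eval₂Hom, MvPolynomial.eval₂_eq']
    refine Finset.sum_congr rfl fun e _ => ?_
    rw [map_mul, map_prod, ← hlam e, hF₁]
    simp only [map_pow]
  have hψπ : Ideal.Quotient.mk (Ideal.span (Set.range uρ)) ψ =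
      IsLocalization.lift (S := Localization.AtPrime 𝔫) hunit (algebraMap _ (Localization.AtPrime 𝔫) q) := by
    rw [IsLocalization.lift_eq]; exact hψF
  have hψM : ((ψ : locAtCentre A''.toSubring O) : K) ∈ M := by
    rw [hψdef]
    change (locAtCentre A''.toSubring O).subtype (∑ e ∈ q.support, ι (lam e) * ∏ i, uS (zI i) ^ (e i)) ∈ M
    rw [map_sum]
    refine sum_mem fun e _ => ?_
    rw [map_mul, map_prod]
    refine mul_mem (hA₂M _ (lam e).2) (prod_mem fun i _ => ?_)
    rw [map_pow]
    exact pow_mem (huM _ (hzIρ i)) _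
  exact ⟨hregS, ψ, hlift1 ψ _ hψπ hq1, hlift2 ψ _ hψπ hq2, hψM⟩


/-! ## §G⁗.B — the FRAME LAYER over a subring (memo §23 (F1), (F3)–(F5))
`HasExp S₀ W a`: `a = Σ_s e_s W_s` with coefficients `e_s ∈ S₀`.  Generic closure lemmas; then, for `S₀ = locAtCentre A₀ O` and a frame
`W` with RG over `S₀` («each term is bounded by the sum»), the unit/adjugate argument (F1), uniqueness, the description of the maximal
ideal (F3), integrality and equality of dimensions, regularity transfer (F4) and the transfer of a regular parameter (F5). -/

section FrameLayer

variable {K : Type} [Field K]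

/-- `a` has an expansion `Σ_s e_s W_s` with coefficients in the subring `S₀`. -/
def HasExp {ι : Type} [Fintype ι] (S₀ : Subring K) (W : ι → K) (a : K) : Prop :=
  ∃ e : ι → K, (∀ s, e s ∈ S₀) ∧ a = ∑ s, e s * W s

variable {ι : Type} [Fintype ι]

theorem hasExp_zero (S₀ : Subring K) (W : ι → K) : HasExp S₀ W 0 :=
  ⟨fun _ => 0, fun _ => S₀.zero_mem, by simp⟩

theorem hasExp_add {S₀ : Subring K} {W : ι → K} {a b : K} (ha : HasExp S₀ W a) (hb : HasExp S₀ W b) :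
    HasExp S₀ W (a + b) := by
  obtain ⟨e, he, rfl⟩ := ha
  obtain ⟨f, hf, rfl⟩ := hb
  refine ⟨fun s => e s + f s, fun s => S₀.add_mem (he s) (hf s), ?_⟩
  rw [← Finset.sum_add_distrib]
  exact Finset.sum_congr rfl fun s _ => by ring

theorem hasExp_mul_left {S₀ : Subring K} {W : ι → K} {a c : K} (hc : c ∈ S₀) (ha : HasExp S₀ W a) :
    HasExp S₀ W (c * a) := by
  obtain ⟨e, he, rfl⟩ := ha
  refine ⟨fun s => c * e s, fun s => S₀.mul_mem hc (he s), ?_⟩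
  rw [Finset.mul_sum]
  exact Finset.sum_congr rfl fun s _ => by ring

theorem hasExp_sum {S₀ : Subring K} {W : ι → K} {α : Type} (T : Finset α) (f : α → K)
    (h : ∀ i ∈ T, HasExp S₀ W (f i)) : HasExp S₀ W (∑ i ∈ T, f i) := by
  classical
  induction T using Finset.induction_on with
  | empty => rw [Finset.sum_empty]; exact hasExp_zero S₀ W
  | insert a T haT ih =>
    rw [Finset.sum_insert haT]
    exact hasExp_add (h a (Finset.mem_insert_self a T)) (ih fun i hi => h i (Finset.mem_insert_of_mem hi))

theorem hasExp_single {S₀ : Subring K} {W : ι → K} {c : K} (hc : c ∈ S₀) (s : ι) : HasExp S₀ W (c * W s) := by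
  classical
  refine ⟨fun s' => if s' = s then c else 0, fun s' => ?_, ?_⟩
  · show (if s' = s then c else 0) ∈ S₀
    split_ifs
    exacts [hc, S₀.zero_mem]
  · show c * W s = ∑ s', (if s' = s then c else 0) * W s'
    simp_rw [ite_mul, zero_mul, Finset.sum_ite_eq', Finset.mem_univ, if_true]

theorem hasExp_mul {S₀ : Subring K} {W : ι → K} (hWW : ∀ s t, HasExp S₀ W (W s * W t)) {a b : K}
    (ha : HasExp S₀ W a) (hb : HasExp S₀ W b) : HasExp S₀ W (a * b) := by
  obtain ⟨e, he, rfl⟩ := ha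
  obtain ⟨f, hf, rfl⟩ := hb
  rw [Finset.sum_mul_sum]
  refine hasExp_sum _ _ fun s _ => hasExp_sum _ _ fun t _ => ?_
  have : e s * W s * (f t * W t) = (e s * f t) * (W s * W t) := by ring
  rw [this]
  exact hasExp_mul_left (S₀.mul_mem (he s) (hf t)) (hWW s t)

variable (O : ValuationSubring K)

/-- Coefficients are unique (indeed zero sum ⇒ zero coefficients) under RG. -/
theorem hasExp_unique {S₀ : Subring K} {W : ι → K} (hWv : ∀ s, O.valuation (W s) = 1)
    (RG₀ : ∀ e : ι → K, (∀ s, e s ∈ S₀) → ∀ s₀, O.valuation (e s₀ * W s₀) ≤ O.valuation (∑ s, e s * W s))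
    {e : ι → K} (he : ∀ s, e s ∈ S₀) (h0 : ∑ s, e s * W s = 0) : ∀ s, e s = 0 := by
  intro s
  have h := RG₀ e he s
  rw [h0, map_zero, le_zero_iff, map_mul, hWv, mul_one, map_eq_zero] at h
  exact h

/-- (F3) Under RG, `Σ e_s W_s` has value `< 1` iff every coefficient has. -/
theorem valuation_exp_lt_one_iff {S₀ : Subring K} {W : ι → K}
    (hWv : ∀ s, O.valuation (W s) = 1)
    (RG₀ : ∀ e : ι → K, (∀ s, e s ∈ S₀) → ∀ s₀, O.valuation (e s₀ * W s₀) ≤ O.valuation (∑ s, e s * W s))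
    {e : ι → K} (he : ∀ s, e s ∈ S₀) : O.valuation (∑ s, e s * W s) < 1 ↔ ∀ s, O.valuation (e s) < 1 := by
  constructor
  · intro h s
    have := RG₀ e he s
    rw [map_mul, hWv, mul_one] at this
    exact lt_of_le_of_lt this h
  · intro h
    exact O.valuation.map_sum_lt one_ne_zero fun s _ => by rw [map_mul, hWv, mul_one]; exact h s

/-- (F1, units) If `c` of value `1` multiplies the frame into expansions and `1` has an expansion, then `c⁻¹` has an expansion:
the determinant of the multiplication matrix is a unit of the local ring `S₀ = locAtCentre A₀ O` (RG ⇒ the matrix is injective modulo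
`𝔪_{S₀}`), and the adjugate inverts it. -/
theorem hasExp_inv {k : Type} [Field k] [Algebra k K] {A₀ : Subalgebra k K} (hA₀O : A₀.toSubring ≤ O.toSubring)
    {W : ι → K} (hWv : ∀ s, O.valuation (W s) = 1)
    (RG₀ : ∀ e : ι → K, (∀ s, e s ∈ locAtCentre A₀.toSubring O) →
      ∀ s₀, O.valuation (e s₀ * W s₀) ≤ O.valuation (∑ s, e s * W s))
    (h1 : HasExp (locAtCentre A₀.toSubring O) W 1) {c : K} (hvc : O.valuation c = 1)
    (hcN : ∀ t, HasExp (locAtCentre A₀.toSubring O) W (c * W t)) :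
    HasExp (locAtCentre A₀.toSubring O) W c⁻¹ := by
  classical
  set S₀ : Subring K := locAtCentre A₀.toSubring O with hS₀def
  haveI : IsLocalRing S₀ := isLocalRing_locAtCentre hA₀O
  have hS₀O : S₀ ≤ O.toSubring := locAtCentre_le hA₀O
  have coe_sum : ∀ f : ι → S₀, (((∑ t, f t : S₀)) : K) = ∑ t, (f t : K) := fun f => map_sum S₀.subtype f Finset.univ
  choose Mx hMxS hMx using hcN
  set MxS : Matrix ι ι S₀ := Matrix.of fun s t => (⟨Mx t s, hMxS t s⟩ : S₀) with hMxSdef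
  have hMxSval : ∀ s t, ((MxS s t : S₀) : K) = Mx t s := fun s t => rfl
  -- the multiplication identity: `c * Σ_t e_t W_t = Σ_s (MxS e)_s W_s`
  have hcmul : ∀ e : ι → S₀, c * ∑ t, (e t : K) * W t = ∑ s, ((MxS.mulVec e) s : K) * W s := by
    intro e
    have hR : ∀ s, ((MxS.mulVec e) s : K) = ∑ t, Mx t s * (e t : K) := by
      intro s
      change ((∑ t, MxS s t * e t : S₀) : K) = _
      rw [coe_sum]
      rfl
    simp_rw [hR]
    calc c * ∑ t, (e t : K) * W t = ∑ t, (e t : K) * (c * W t) := by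
          rw [Finset.mul_sum]; exact Finset.sum_congr rfl fun t _ => by ring
      _ = ∑ t, (e t : K) * ∑ s, Mx t s * W s := Finset.sum_congr rfl fun t _ => by rw [hMx t]
      _ = ∑ t, ∑ s, Mx t s * (e t : K) * W s := by
          refine Finset.sum_congr rfl fun t _ => ?_
          rw [Finset.mul_sum]; exact Finset.sum_congr rfl fun s _ => by ring
      _ = ∑ s, ∑ t, Mx t s * (e t : K) * W s := Finset.sum_comm
      _ = ∑ s, (∑ t, Mx t s * (e t : K)) * W s := Finset.sum_congr rfl fun s _ => by rw [Finset.sum_mul]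
  -- RG ⇒ the matrix is injective modulo `𝔪_{S₀}`
  have hker : ∀ e : ι → S₀, (∀ s, (MxS.mulVec e) s ∈ IsLocalRing.maximalIdeal S₀) →
      ∀ t, e t ∈ IsLocalRing.maximalIdeal S₀ := by
    intro e he t
    have hlt : O.valuation (∑ s, ((MxS.mulVec e) s : K) * W s) < 1 :=
      O.valuation.map_sum_lt one_ne_zero fun s _ => by
        rw [map_mul, hWv, mul_one]; exact (mem_maximalIdeal_locAtCentre_iff hA₀O _).mp (he s)
    rw [← hcmul, map_mul, hvc, one_mul] at hlt
    have h := RG₀ (fun t => (e t : K)) (fun t => (e t).2) t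
    rw [map_mul, hWv, mul_one] at h
    exact (mem_maximalIdeal_locAtCentre_iff hA₀O _).mpr (lt_of_le_of_lt h hlt)
  have hdet : IsUnit MxS.det := by
    by_contra hnu
    have hm : MxS.det ∈ IsLocalRing.maximalIdeal S₀ := by
      rw [IsLocalRing.mem_maximalIdeal, mem_nonunits_iff]; exact hnu
    have h0 : (MxS.map (IsLocalRing.residue S₀)).det = 0 := by
      rw [← RingHom.mapMatrix_apply, ← RingHom.map_det]
      exact (IsLocalRing.residue_eq_zero_iff _).mpr hm
    obtain ⟨vb, hvb0, hvb⟩ := Matrix.exists_mulVec_eq_zero_iff.mpr h0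
    choose e he using fun t => Ideal.Quotient.mk_surjective (I := IsLocalRing.maximalIdeal S₀) (vb t)
    have hme : ∀ s, (MxS.mulVec e) s ∈ IsLocalRing.maximalIdeal S₀ := by
      intro s
      rw [← IsLocalRing.residue_eq_zero_iff]
      have hs := congr_fun hvb s
      rw [Pi.zero_apply] at hs
      rw [← hs]
      simp only [Matrix.mulVec, dotProduct, map_sum, map_mul, Matrix.map_apply]
      exact Finset.sum_congr rfl fun t _ => by rw [← he t]; rfl
    have hall := hker e hme
    apply hvb0
    funext t
    rw [← he t, Pi.zero_apply]
    exact Ideal.Quotient.eq_zero_iff_mem.mpr (hall t)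
  have hv1 : O.valuation ((MxS.det : S₀) : K) = 1 := by
    have hnlt : ¬ O.valuation ((MxS.det : S₀) : K) < 1 := fun h =>
      ((not_isUnit_locAtCentre_iff hA₀O _).mpr h) hdet
    exact le_antisymm ((O.valuation_le_one_iff _).mpr (hS₀O (MxS.det).2)) (not_lt.mp hnlt)
  have hδ0 : ((MxS.det : S₀) : K) ≠ 0 := ne_zero_of_valuation_eq_one hv1
  have hδinv : ((MxS.det : S₀) : K)⁻¹ ∈ S₀ := inv_mem_locAtCentre (MxS.det).2 hv1
  -- the adjugate identity: `det · W_r = c · Σ_t adj_{t r} W_t`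
  have hent : ∀ s r, ∑ t, MxS s t * MxS.adjugate t r = if s = r then MxS.det else 0 := by
    intro s r
    have := congr_fun (congr_fun (Matrix.mul_adjugate MxS) s) r
    rw [Matrix.mul_apply, Matrix.smul_apply, Matrix.one_apply, smul_eq_mul, mul_ite, mul_one, mul_zero] at this
    exact this
  have hadj : ∀ r, ((MxS.det : S₀) : K) * W r = c * ∑ t, ((MxS.adjugate t r : S₀) : K) * W t := by
    intro r
    symm
    calc c * ∑ t, ((MxS.adjugate t r : S₀) : K) * W t
        = ∑ t, ((MxS.adjugate t r : S₀) : K) * (c * W t) := by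
          rw [Finset.mul_sum]; exact Finset.sum_congr rfl fun t _ => by ring
      _ = ∑ t, ((MxS.adjugate t r : S₀) : K) * ∑ s, Mx t s * W s :=
          Finset.sum_congr rfl fun t _ => by rw [hMx t]
      _ = ∑ t, ∑ s, ((MxS s t : S₀) : K) * ((MxS.adjugate t r : S₀) : K) * W s := by
          refine Finset.sum_congr rfl fun t _ => ?_
          rw [Finset.mul_sum]
          exact Finset.sum_congr rfl fun s _ => by rw [hMxSval]; ring
      _ = ∑ s, ∑ t, ((MxS s t : S₀) : K) * ((MxS.adjugate t r : S₀) : K) * W s := Finset.sum_comm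
      _ = ∑ s, ((∑ t, MxS s t * MxS.adjugate t r : S₀) : K) * W s := by
          refine Finset.sum_congr rfl fun s _ => ?_
          rw [← Finset.sum_mul, coe_sum]
          rfl
      _ = ∑ s, (if s = r then ((MxS.det : S₀) : K) else 0) * W s := by
          refine Finset.sum_congr rfl fun s _ => ?_
          rw [hent s r]
          split_ifs <;> rfl
      _ = ((MxS.det : S₀) : K) * W r := by
          rw [Finset.sum_eq_single r (fun s _ hs => by rw [if_neg hs, zero_mul])
            (fun h => absurd (Finset.mem_univ r) h), if_pos rfl]
  -- the expansion of `c⁻¹`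
  obtain ⟨ε, hεS, hε1⟩ := h1
  have hc0 : c ≠ 0 := ne_zero_of_valuation_eq_one hvc
  have key : (1 : K) = c * ∑ t, (∑ r, ((MxS.det : S₀) : K)⁻¹ * ε r * ((MxS.adjugate t r : S₀) : K)) * W t := by
    calc (1 : K) = ∑ r, ε r * W r := hε1
      _ = ∑ r, ε r * (((MxS.det : S₀) : K)⁻¹ * (c * ∑ t, ((MxS.adjugate t r : S₀) : K) * W t)) :=
          Finset.sum_congr rfl fun r _ => by rw [← hadj r, ← mul_assoc _ _ (W r), inv_mul_cancel₀ hδ0, one_mul]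
      _ = ∑ r, ∑ t, c * ((((MxS.det : S₀) : K)⁻¹ * ε r * ((MxS.adjugate t r : S₀) : K)) * W t) := by
          refine Finset.sum_congr rfl fun r _ => ?_
          rw [Finset.mul_sum, Finset.mul_sum, Finset.mul_sum]
          exact Finset.sum_congr rfl fun t _ => by ring
      _ = ∑ t, ∑ r, c * ((((MxS.det : S₀) : K)⁻¹ * ε r * ((MxS.adjugate t r : S₀) : K)) * W t) := Finset.sum_comm
      _ = c * ∑ t, (∑ r, ((MxS.det : S₀) : K)⁻¹ * ε r * ((MxS.adjugate t r : S₀) : K)) * W t := by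
          rw [Finset.mul_sum]
          refine Finset.sum_congr rfl fun t _ => ?_
          rw [Finset.sum_mul, Finset.mul_sum]
  refine ⟨fun t => ∑ r, ((MxS.det : S₀) : K)⁻¹ * ε r * ((MxS.adjugate t r : S₀) : K), fun t =>
    sum_mem fun r _ => S₀.mul_mem (S₀.mul_mem hδinv (hεS r)) (MxS.adjugate t r).2, ?_⟩
  calc c⁻¹ = c⁻¹ * 1 := (mul_one _).symm
    _ = c⁻¹ * (c * ∑ t, (∑ r, ((MxS.det : S₀) : K)⁻¹ * ε r * ((MxS.adjugate t r : S₀) : K)) * W t) := by rw [← key]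
    _ = ∑ t, (∑ r, ((MxS.det : S₀) : K)⁻¹ * ε r * ((MxS.adjugate t r : S₀) : K)) * W t := by
        rw [← mul_assoc, inv_mul_cancel₀ hc0, one_mul]

/-- (F1) `S := locAtCentre A'' O = Σ_s W_s S₀` when `A''` is spanned by the frame over `S₀ := locAtCentre A₀ O` with RG. -/
theorem hasExp_of_mem_locAtCentre {k : Type} [Field k] [Algebra k K] {A₀ A'' : Subalgebra k K}
    (hA''O : A''.toSubring ≤ O.toSubring) (h0le : A₀ ≤ A'')
    {W : ι → K} (hWA'' : ∀ s, W s ∈ A'') (hWv : ∀ s, O.valuation (W s) = 1)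
    (RG₀ : ∀ e : ι → K, (∀ s, e s ∈ locAtCentre A₀.toSubring O) →
      ∀ s₀, O.valuation (e s₀ * W s₀) ≤ O.valuation (∑ s, e s * W s))
    (hgenN : ∀ a ∈ A'', HasExp (locAtCentre A₀.toSubring O) W a)
    {a : K} (ha : a ∈ locAtCentre A''.toSubring O) : HasExp (locAtCentre A₀.toSubring O) W a := by
  have hA₀O : A₀.toSubring ≤ O.toSubring := fun x hx => hA''O (h0le hx)
  obtain ⟨y, hy, c, hc, hvc, rfl⟩ := mem_locAtCentre_iff.mp ha
  rw [div_eq_mul_inv]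
  have hWW : ∀ s t, HasExp (locAtCentre A₀.toSubring O) W (W s * W t) := fun s t =>
    hgenN _ (A''.mul_mem (hWA'' s) (hWA'' t))
  exact hasExp_mul hWW (hgenN y hy)
    (hasExp_inv O hA₀O hWv RG₀ (hgenN 1 A''.one_mem) hvc fun t => hgenN _ (A''.mul_mem hc (hWA'' t)))

end FrameLayer

section FrameLayer2

variable {K : Type} [Field K] {ι : Type} [Fintype ι] (O : ValuationSubring K)

/-- (dimension) `S = locAtCentre A'' O` is finite (free) over `S₀ = locAtCentre A₀ O`, hence integral: equal Krull dimensions. -/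
theorem ringKrullDim_eq_of_frame {k : Type} [Field k] [Algebra k K] {A₀ A'' : Subalgebra k K}
    (hA''O : A''.toSubring ≤ O.toSubring) (h0le : A₀ ≤ A'')
    {W : ι → K} (hWA'' : ∀ s, W s ∈ A'') (hWv : ∀ s, O.valuation (W s) = 1)
    (RG₀ : ∀ e : ι → K, (∀ s, e s ∈ locAtCentre A₀.toSubring O) →
      ∀ s₀, O.valuation (e s₀ * W s₀) ≤ O.valuation (∑ s, e s * W s))
    (hgenN : ∀ a ∈ A'', HasExp (locAtCentre A₀.toSubring O) W a) :
    ringKrullDim (locAtCentre A₀.toSubring O) = ringKrullDim (locAtCentre A''.toSubring O) := by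
  classical
  have hle : locAtCentre A₀.toSubring O ≤ locAtCentre A''.toSubring O :=
    locAtCentre_mono O (fun x hx => h0le hx)
  set S₀ : Subring K := locAtCentre A₀.toSubring O with hS₀def
  set S : Subring K := locAtCentre A''.toSubring O with hSdef
  have hWS : ∀ s, W s ∈ S := fun s => le_locAtCentre _ O (hWA'' s)
  letI : Algebra S₀ S := (Subring.inclusion hle).toAlgebra
  haveI : Module.Finite S₀ S := by
    refine ⟨⟨Finset.univ.image (fun s => (⟨W s, hWS s⟩ : S)), ?_⟩⟩
    rw [eq_top_iff]
    rintro a -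
    obtain ⟨e, heS, hea⟩ := hasExp_of_mem_locAtCentre O hA''O h0le hWA'' hWv RG₀ hgenN a.2
    have ha : a = ∑ s, (⟨e s, heS s⟩ : S₀) • (⟨W s, hWS s⟩ : S) := by
      apply Subtype.ext
      rw [hea]
      change _ = S.subtype (∑ s, _)
      rw [map_sum]
      refine Finset.sum_congr rfl fun s _ => ?_
      rw [Algebra.smul_def]
      rfl
    rw [ha]
    exact Submodule.sum_mem _ fun s _ => Submodule.smul_mem _ _
      (Submodule.subset_span (Finset.mem_coe.mpr (Finset.mem_image_of_mem _ (Finset.mem_univ s))))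
  have hinj : Function.Injective (algebraMap S₀ S) := fun a b h =>
    Subtype.ext (by have := congrArg (fun x : S => (x : K)) h; exact this)
  exact Literature.RingTheory.KrullDimension.ringKrullDim_eq_of_isIntegral hinj

/-- (F3)+(F4) `𝔪_S = 𝔪_{S₀} S`, so `S` is regular when `S₀` is (equal dimensions). -/
theorem isRegularLocalRing_of_frame {k : Type} [Field k] [Algebra k K] {A₀ A'' : Subalgebra k K}
    (hA''O : A''.toSubring ≤ O.toSubring) (h0le : A₀ ≤ A'') (hA''fg : A''.FG)
    {W : ι → K} (hWA'' : ∀ s, W s ∈ A'') (hWv : ∀ s, O.valuation (W s) = 1)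
    (RG₀ : ∀ e : ι → K, (∀ s, e s ∈ locAtCentre A₀.toSubring O) →
      ∀ s₀, O.valuation (e s₀ * W s₀) ≤ O.valuation (∑ s, e s * W s))
    (hgenN : ∀ a ∈ A'', HasExp (locAtCentre A₀.toSubring O) W a)
    [hreg₀ : IsRegularLocalRing (locAtCentre A₀.toSubring O)] :
    IsRegularLocalRing (locAtCentre A''.toSubring O) := by
  classical
  have hA₀O : A₀.toSubring ≤ O.toSubring := fun x hx => hA''O (h0le hx)
  have hle : locAtCentre A₀.toSubring O ≤ locAtCentre A''.toSubring O :=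
    locAtCentre_mono O (fun x hx => h0le hx)
  set S₀ : Subring K := locAtCentre A₀.toSubring O with hS₀def
  set S : Subring K := locAtCentre A''.toSubring O with hSdef
  have hWS : ∀ s, W s ∈ S := fun s => le_locAtCentre _ O (hWA'' s)
  haveI hSloc : IsLocalRing S := isLocalRing_locAtCentre hA''O
  haveI : IsLocalization.AtPrime S (subringCentre A''.toSubring O hA''O) := isLocalization_locAtCentre hA''O
  letI : Algebra k A''.toSubring := inferInstanceAs (Algebra k A'')
  haveI : Algebra.FiniteType k A''.toSubring := (A''.fg_iff_finiteType.mp hA''fg : Algebra.FiniteType k A'')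
  haveI hSnoeth : IsNoetherianRing S :=
    IsLocalization.isNoetherianRing (subringCentre A''.toSubring O hA''O).primeCompl S
      (Algebra.FiniteType.isNoetherianRing k A''.toSubring)
  obtain ⟨G₀, hG₀card, hG₀span⟩ := Submodule.FG.exists_span_finset_card_eq_spanFinrank
    (IsNoetherian.noetherian (IsLocalRing.maximalIdeal S₀))
  set ιh : S₀ →+* S := Subring.inclusion hle with hιhdef
  have hmS : IsLocalRing.maximalIdeal S = Ideal.span ((G₀.image ιh : Finset S) : Set S) := by
    apply le_antisymm
    · intro a ha
      have hva : O.valuation (a : K) < 1 := (mem_maximalIdeal_locAtCentre_iff hA''O a).mp ha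
      obtain ⟨e, heS, hea⟩ := hasExp_of_mem_locAtCentre O hA''O h0le hWA'' hWv RG₀ hgenN a.2
      rw [hea] at hva
      have hve := (valuation_exp_lt_one_iff O hWv RG₀ heS).mp hva
      have hmem : ∀ s, ιh ⟨e s, heS s⟩ ∈ Ideal.span ((G₀.image ιh : Finset S) : Set S) := by
        intro s
        have h1 : (⟨e s, heS s⟩ : S₀) ∈ IsLocalRing.maximalIdeal S₀ :=
          (mem_maximalIdeal_locAtCentre_iff hA₀O _).mpr (hve s)
        rw [← hG₀span] at h1
        have h2 := Ideal.mem_map_of_mem ιh h1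
        rw [Ideal.map_span] at h2
        rw [Finset.coe_image]
        exact h2
      have ha' : a = ∑ s, ιh ⟨e s, heS s⟩ * ⟨W s, hWS s⟩ := by
        apply Subtype.ext
        rw [hea]
        change _ = S.subtype (∑ s, _)
        rw [map_sum]
        exact Finset.sum_congr rfl fun s _ => rfl
      rw [ha']
      exact Ideal.sum_mem _ fun s _ => Ideal.mul_mem_right _ _ (hmem s)
    · rw [Ideal.span_le]
      intro x hx
      obtain ⟨g, hg, rfl⟩ := Finset.mem_image.mp (Finset.mem_coe.mp hx)
      have hg1 : g ∈ IsLocalRing.maximalIdeal S₀ := by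
        rw [← hG₀span]; exact Ideal.subset_span (Finset.mem_coe.mpr hg)
      exact (mem_maximalIdeal_locAtCentre_iff hA''O _).mpr ((mem_maximalIdeal_locAtCentre_iff hA₀O g).mp hg1)
  have hdimeq := ringKrullDim_eq_of_frame O hA''O h0le hWA'' hWv RG₀ hgenN
  apply IsRegularLocalRing.of_spanFinrank_maximalIdeal_le
  rw [← hdimeq, ← hreg₀.spanFinrank_maximalIdeal, ← hG₀card, hmS]
  exact_mod_cast (Submodule.spanFinrank_span_le_ncard_of_finite (Finset.finite_toSet _)).trans
    (by rw [Set.ncard_coe_finset]; exact Finset.card_image_le)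

/-- (F5) a regular parameter of `S₀` stays a regular parameter of `S = ⊕ W_s S₀` (freeness + a unit coordinate of `1`). -/
theorem regularParameter_of_frame {k : Type} [Field k] [Algebra k K] {A₀ A'' : Subalgebra k K}
    (hA''O : A''.toSubring ≤ O.toSubring) (h0le : A₀ ≤ A'')
    {W : ι → K} (hWA'' : ∀ s, W s ∈ A'') (hWv : ∀ s, O.valuation (W s) = 1)
    (RG₀ : ∀ e : ι → K, (∀ s, e s ∈ locAtCentre A₀.toSubring O) →
      ∀ s₀, O.valuation (e s₀ * W s₀) ≤ O.valuation (∑ s, e s * W s))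
    (hgenN : ∀ a ∈ A'', HasExp (locAtCentre A₀.toSubring O) W a)
    [hreg₀ : IsRegularLocalRing (locAtCentre A₀.toSubring O)]
    [hregS : IsRegularLocalRing (locAtCentre A''.toSubring O)]
    (ψ₀ : locAtCentre A₀.toSubring O) (hψ1 : ψ₀ ∈ IsLocalRing.maximalIdeal (locAtCentre A₀.toSubring O))
    (hψ2 : ψ₀ ∉ (IsLocalRing.maximalIdeal (locAtCentre A₀.toSubring O)) ^ 2)
    (ψ : locAtCentre A''.toSubring O) (hψψ₀ : (ψ : K) = ψ₀) :
    ψ ∈ IsLocalRing.maximalIdeal (locAtCentre A''.toSubring O) ∧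
      ψ ∉ (IsLocalRing.maximalIdeal (locAtCentre A''.toSubring O)) ^ 2 := by
  classical
  have hA₀O : A₀.toSubring ≤ O.toSubring := fun x hx => hA''O (h0le hx)
  have hS₀O : (locAtCentre A₀.toSubring O) ≤ O.toSubring := locAtCentre_le hA₀O
  have coe_sum : ∀ f : ι → (locAtCentre A₀.toSubring O), (((∑ t, f t : (locAtCentre A₀.toSubring O))) : K) = ∑ t, (f t : K) := fun f => map_sum (locAtCentre A₀.toSubring O).subtype f Finset.univ
  refine ⟨(mem_maximalIdeal_locAtCentre_iff hA''O _).mpr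
    (by rw [hψψ₀]; exact (mem_maximalIdeal_locAtCentre_iff hA₀O ψ₀).mp hψ1), fun h => ?_⟩
  -- every element of `𝔪_S²` has an expansion with coefficients in `𝔪_{(locAtCentre A₀.toSubring O)}²`
  choose d hdS hd using fun s t => hgenN (W s * W t) (A''.mul_mem (hWA'' s) (hWA'' t))
  have hQ : ∀ m ∈ (IsLocalRing.maximalIdeal (locAtCentre A''.toSubring O)) ^ 2, ∃ e : ι → (locAtCentre A₀.toSubring O),
      (∀ s, e s ∈ (IsLocalRing.maximalIdeal (locAtCentre A₀.toSubring O)) ^ 2) ∧ ((m : (locAtCentre A''.toSubring O)) : K) = ∑ s, (e s : K) * W s := by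
    intro m hm
    rw [pow_two] at hm
    refine Submodule.mul_induction_on hm ?_ ?_
    · intro m hm n hn
      obtain ⟨a, haS, hma⟩ := hasExp_of_mem_locAtCentre O hA''O h0le hWA'' hWv RG₀ hgenN m.2
      obtain ⟨b, hbS, hnb⟩ := hasExp_of_mem_locAtCentre O hA''O h0le hWA'' hWv RG₀ hgenN n.2
      have hva : ∀ s, O.valuation (a s) < 1 := (valuation_exp_lt_one_iff O hWv RG₀ haS).mp
        (by rw [← hma]; exact (mem_maximalIdeal_locAtCentre_iff hA''O m).mp hm)
      have hvb : ∀ s, O.valuation (b s) < 1 := (valuation_exp_lt_one_iff O hWv RG₀ hbS).mp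
        (by rw [← hnb]; exact (mem_maximalIdeal_locAtCentre_iff hA''O n).mp hn)
      refine ⟨fun u => ∑ s, ∑ t, (⟨a s, haS s⟩ * ⟨b t, hbS t⟩ : (locAtCentre A₀.toSubring O)) * ⟨d s t u, hdS s t u⟩, fun u => ?_, ?_⟩
      · refine Ideal.sum_mem _ fun s _ => Ideal.sum_mem _ fun t _ => Ideal.mul_mem_right _ _ ?_
        rw [pow_two]
        exact Ideal.mul_mem_mul ((mem_maximalIdeal_locAtCentre_iff hA₀O _).mpr (hva s))
          ((mem_maximalIdeal_locAtCentre_iff hA₀O _).mpr (hvb t))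
      · have hR : ∀ u, ((∑ s, ∑ t, (⟨a s, haS s⟩ * ⟨b t, hbS t⟩ : (locAtCentre A₀.toSubring O)) * ⟨d s t u, hdS s t u⟩ : (locAtCentre A₀.toSubring O)) : K) =
            ∑ s, ∑ t, a s * b t * d s t u := by
          intro u
          rw [coe_sum]
          refine Finset.sum_congr rfl fun s _ => ?_
          rw [coe_sum]
          rfl
        simp_rw [hR]
        change (m : K) * (n : K) = _
        rw [hma, hnb, Finset.sum_mul_sum]
        calc ∑ s, ∑ t, a s * W s * (b t * W t) = ∑ s, ∑ t, a s * b t * (W s * W t) :=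
              Finset.sum_congr rfl fun s _ => Finset.sum_congr rfl fun t _ => by ring
          _ = ∑ s, ∑ t, ∑ u, a s * b t * d s t u * W u := by
              refine Finset.sum_congr rfl fun s _ => Finset.sum_congr rfl fun t _ => ?_
              rw [hd s t, Finset.mul_sum]
              exact Finset.sum_congr rfl fun u _ => by ring
          _ = ∑ s, ∑ u, ∑ t, a s * b t * d s t u * W u :=
              Finset.sum_congr rfl fun s _ => Finset.sum_comm
          _ = ∑ u, ∑ s, ∑ t, a s * b t * d s t u * W u := Finset.sum_comm
          _ = ∑ u, (∑ s, ∑ t, a s * b t * d s t u) * W u := by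
              refine Finset.sum_congr rfl fun u _ => ?_
              rw [Finset.sum_mul]
              exact Finset.sum_congr rfl fun s _ => by rw [Finset.sum_mul]
    · rintro x y ⟨e, he, hx⟩ ⟨f, hf, hy⟩
      refine ⟨fun s => e s + f s, fun s => Ideal.add_mem _ (he s) (hf s), ?_⟩
      change (x : K) + (y : K) = _
      rw [hx, hy, ← Finset.sum_add_distrib]
      exact Finset.sum_congr rfl fun s _ => by rw [Subring.coe_add]; ring
  obtain ⟨e, he2, hψe⟩ := hQ ψ h
  rw [hψψ₀] at hψe
  obtain ⟨ε, hεS, hε1⟩ := hgenN 1 A''.one_mem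
  -- uniqueness of coefficients: `e_s = ψ₀ ε_s`
  have hdiff : ∀ s, (e s : K) - (ψ₀ : K) * ε s = 0 :=
    hasExp_unique O hWv RG₀ (e := fun s => (e s : K) - (ψ₀ : K) * ε s)
      (fun s => (locAtCentre A₀.toSubring O).sub_mem (e s).2 ((locAtCentre A₀.toSubring O).mul_mem ψ₀.2 (hεS s))) (by
        simp_rw [sub_mul, Finset.sum_sub_distrib, mul_assoc, ← Finset.mul_sum]
        rw [← hε1, ← hψe, mul_one, sub_self])
  -- a unit coordinate of `1`
  have hex : ∃ s₀, ¬ O.valuation (ε s₀ * W s₀) < 1 := by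
    by_contra hall
    push Not at hall
    have := O.valuation.map_sum_lt one_ne_zero (fun s (_ : s ∈ Finset.univ) => hall s)
    rw [← hε1, map_one] at this
    exact lt_irrefl _ this
  obtain ⟨s₀, hs₀⟩ := hex
  rw [map_mul, hWv, mul_one, not_lt] at hs₀
  have hε1v : O.valuation (ε s₀) = 1 :=
    le_antisymm ((O.valuation_le_one_iff _).mpr (hS₀O (hεS s₀))) hs₀
  have hunit : IsUnit (⟨ε s₀, hεS s₀⟩ : (locAtCentre A₀.toSubring O)) := by
    by_contra hnu
    exact absurd hε1v (ne_of_lt ((not_isUnit_locAtCentre_iff hA₀O _).mp hnu))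
  have hmem : ψ₀ * ⟨ε s₀, hεS s₀⟩ ∈ (IsLocalRing.maximalIdeal (locAtCentre A₀.toSubring O)) ^ 2 := by
    have heq : ψ₀ * ⟨ε s₀, hεS s₀⟩ = e s₀ := Subtype.ext (by
      have := hdiff s₀
      rw [sub_eq_zero] at this
      exact this.symm)
    rw [heq]; exact he2 s₀
  obtain ⟨w, hw⟩ := hunit
  apply hψ2
  have : ψ₀ = ψ₀ * ⟨ε s₀, hεS s₀⟩ * ↑w⁻¹ := by rw [← hw, mul_assoc, Units.mul_inv, mul_one]
  rw [this]
  exact Ideal.mul_mem_right _ _ hmem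

end FrameLayer2

/-! ## §G⁗.C — PORT 4⁗ PROVED: `theorem frameChartPort : FrameChartPort p` (memo §23.4 (F0)–(F5)) -/

set_option maxHeartbeats 1600000 in
/-- **PORT 4⁗ PROVED** (memo §23.4 (F0)–(F5), kernel-checked, sorry-free).  `A'' := k[gens A₂, u, u_{≥ρ}⁻¹, t]`; the frame-free chart ring
`S₀ := locAtCentre k[gens A₂, u, u_{≥ρ}⁻¹] O` is regular with a parameter `ψ ∈ M` by Port 4b's argument (Part A, its dimension `3` coming from
`S := locAtCentre A'' O` by integrality), `S = ⊕_s W_s S₀` is free over `S₀` with `𝔪_S = 𝔪_{S₀} S` by RG/DG (Part B), hence regular of the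
same dimension, and `ψ` stays a regular parameter. [folklore] -/
theorem frameChartPort (p : ℕ) [Fact p.Prime] : FrameChartPort p := by
  intro k _ K _ _ O A hAO hAfg hFrac hdimA hdim3 hzd M A₂ hA₂O hA₂fg hAp hA₂M hreg₂ hdimT z hzT hz0 hzv hzspan
    S _ W hWO hWv hRG x y hx hy hxp hyp hvx hvy hLI hV hP hDG t htO hAt h1t hWt hWWt ρ hρ u hu0 hupos huzero huM hupres hzu L _ σ htu
  classical
  haveI := hFrac
  haveI := hreg₂
  have hp : p.Prime := Fact.out
  haveI : NeZero p := ⟨hp.ne_zero⟩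
  have hk : ∀ c : k, algebraMap k K c ∈ A₂ := fun c => A₂.algebraMap_mem c
  have huO : ∀ j, u j ∈ O := fun j => (O.valuation_le_one_iff _).mp (by
    by_cases hj : (j : ℕ) < ρ
    · exact (hupos j hj).le
    · exact (huzero j (not_lt.mp hj)).le)
  have huinvO : ∀ j : Fin 3, ρ ≤ (j : ℕ) → (u j)⁻¹ ∈ O := fun j hj =>
    (O.valuation_le_one_iff _).mp (by rw [map_inv₀, huzero j hj, inv_one])
  obtain ⟨gens₂, hgens₂⟩ := hA₂fg
  have hgensA₂ : ∀ x ∈ gens₂, x ∈ A₂ := fun x hx => by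
    rw [← hgens₂]; exact Algebra.subset_adjoin (Finset.mem_coe.mpr hx)
  have hTM : ∀ r ∈ locAtCentre A₂.toSubring O, r ∈ M := hA₂M
  -- the parameters as elements of `T` and `𝔪_T = (z)`
  set zT : Fin 3 → locAtCentre A₂.toSubring O := fun i => ⟨z i, hzT i⟩ with hzTdef
  have hzspanT : Ideal.span (Set.range zT) = IsLocalRing.maximalIdeal (locAtCentre A₂.toSubring O) := by
    apply le_antisymm
    · rw [Ideal.span_le]
      rintro _ ⟨i, rfl⟩
      exact (mem_maximalIdeal_locAtCentre_iff hA₂O _).mpr (hzv i)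
    · intro r hr
      obtain ⟨b, hbT, hrb⟩ := hzspan r r.2 ((mem_maximalIdeal_locAtCentre_iff hA₂O r).mp hr)
      have hr' : r = ∑ i, (⟨b i, hbT i⟩ : locAtCentre A₂.toSubring O) * zT i := by
        apply Subtype.ext
        rw [hrb]
        change _ = (locAtCentre A₂.toSubring O).subtype
          (∑ i : Fin 3, (⟨b i, hbT i⟩ : locAtCentre A₂.toSubring O) * zT i)
        rw [map_sum]
        exact Finset.sum_congr rfl fun i _ => rfl
      rw [hr']
      exact Ideal.sum_mem _ fun i _ => Ideal.mul_mem_left _ _ (Ideal.subset_span ⟨i, rfl⟩)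
  have hzuT : ∀ i : Fin 3, ∃ (ε : K) (d : Fin 3 → ℤ), ε ∈ locAtCentre A₂.toSubring O ∧ O.valuation ε = 1 ∧
      (∀ j : Fin 3, (j : ℕ) < ρ → 0 ≤ d j) ∧ (∃ j : Fin 3, (j : ℕ) < ρ ∧ 0 < d j) ∧ ((zT i : K)) = ε * ∏ j, u j ^ d j := hzu
  -- (F0) the frame-free chart generators `G₀ = gens A₂ ∪ u ∪ u_{≥ρ}⁻¹` and `A₀'' := k[G₀]`
  set Z : Finset (Fin 3) := Finset.univ.filter (fun j => ρ ≤ (j : ℕ)) with hZdef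
  have hZ : ∀ j : Fin 3, j ∈ Z ↔ ρ ≤ (j : ℕ) := fun j => by simp [hZdef]
  set G₀ : Finset K := gens₂ ∪ Finset.univ.image u ∪ Z.image (fun j => (u j)⁻¹) with hG₀def
  have hG₀gens : ∀ g ∈ gens₂, g ∈ G₀ := fun g hg => by
    rw [hG₀def]; exact Finset.mem_union_left _ (Finset.mem_union_left _ hg)
  have hG₀u : ∀ j, u j ∈ G₀ := fun j => by
    rw [hG₀def]
    exact Finset.mem_union_left _ (Finset.mem_union_right _ (Finset.mem_image.mpr ⟨j, Finset.mem_univ _, rfl⟩))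
  have hG₀uinv : ∀ j : Fin 3, ρ ≤ (j : ℕ) → (u j)⁻¹ ∈ G₀ := fun j hj => by
    rw [hG₀def]
    exact Finset.mem_union_right _ (Finset.mem_image.mpr ⟨j, (hZ j).mpr hj, rfl⟩)
  have hG₀cases : ∀ x ∈ G₀, x ∈ gens₂ ∨ (∃ j, x = u j) ∨ (∃ j : Fin 3, ρ ≤ (j : ℕ) ∧ x = (u j)⁻¹) := by
    intro x hx
    rw [hG₀def] at hx
    rcases Finset.mem_union.mp hx with hx | hx
    · rcases Finset.mem_union.mp hx with hx | hx
      · exact Or.inl hx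
      · obtain ⟨j, -, rfl⟩ := Finset.mem_image.mp hx
        exact Or.inr (Or.inl ⟨j, rfl⟩)
    · obtain ⟨j, hj, rfl⟩ := Finset.mem_image.mp hx
      exact Or.inr (Or.inr ⟨j, (hZ j).mp hj, rfl⟩)
  have hG₀O : ∀ x ∈ G₀, x ∈ O := by
    intro x hx
    rcases hG₀cases x hx with hx | ⟨j, rfl⟩ | ⟨j, hj, rfl⟩
    · exact hA₂O (hgensA₂ x hx)
    · exact huO j
    · exact huinvO j hj
  set A₀'' : Subalgebra k K := Algebra.adjoin k (G₀ : Set K) with hA₀''def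
  have hG₀A₀'' : ∀ x ∈ G₀, x ∈ A₀'' := fun x hx => Algebra.subset_adjoin (Finset.mem_coe.mpr hx)
  let Oₖ : Subalgebra k K :=
    { O.toSubring with algebraMap_mem' := fun c => hA₂O (A₂.algebraMap_mem c) }
  have hG₀O' : (G₀ : Set K) ⊆ (Oₖ : Set K) := fun x hx => by
    change x ∈ O; exact hG₀O x (Finset.mem_coe.mp hx)
  have hA₀''O : A₀''.toSubring ≤ O.toSubring := fun x hx => (Algebra.adjoin_le hG₀O' : A₀'' ≤ Oₖ) hx
  have hA₂A₀'' : A₂ ≤ A₀'' := by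
    rw [← hgens₂]; exact Algebra.adjoin_le fun x hx => hG₀A₀'' x (hG₀gens x (Finset.mem_coe.mp hx))
  have hTS₀ : locAtCentre A₂.toSubring O ≤ locAtCentre A₀''.toSubring O :=
    locAtCentre_mono O (fun x hx => hA₂A₀'' hx)
  have hA₀''S₀ : ∀ x ∈ A₀'', x ∈ locAtCentre A₀''.toSubring O := fun x hx => le_locAtCentre _ O hx
  -- the frame chart `A'' := k[G₀ ∪ t]`
  set G : Finset K := G₀ ∪ t with hGdef
  set A'' : Subalgebra k K := Algebra.adjoin k (G : Set K) with hA''def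
  have hGA'' : ∀ x ∈ G, x ∈ A'' := fun x hx => Algebra.subset_adjoin (Finset.mem_coe.mpr hx)
  have hGO : ∀ x ∈ G, x ∈ O := by
    intro x hx
    rw [hGdef] at hx
    rcases Finset.mem_union.mp hx with hx | hx
    · exact hG₀O x hx
    · exact htO x hx
  have hGO' : (G : Set K) ⊆ (Oₖ : Set K) := fun x hx => by
    change x ∈ O; exact hGO x (Finset.mem_coe.mp hx)
  have hA''O : A''.toSubring ≤ O.toSubring := fun x hx => (Algebra.adjoin_le hGO' : A'' ≤ Oₖ) hx
  have hG₀G : ∀ x ∈ G₀, x ∈ G := fun x hx => by rw [hGdef]; exact Finset.mem_union_left _ hx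
  have htG : ∀ a ∈ t, a ∈ G := fun a ha => by rw [hGdef]; exact Finset.mem_union_right _ ha
  have h0le : A₀'' ≤ A'' := Algebra.adjoin_le fun x hx => hGA'' x (hG₀G x (Finset.mem_coe.mp hx))
  have htA'' : ∀ a ∈ t, a ∈ A'' := fun a ha => hGA'' a (htG a ha)
  have hAA'' : A ≤ A'' := hAt.trans (Algebra.adjoin_le fun x hx => htA'' x (Finset.mem_coe.mp hx))
  have hA''fg : A''.FG := ⟨G, hA''def.symm⟩
  have hWA'' : ∀ s, W s ∈ A'' := fun s => htA'' _ (hWt s)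
  -- (F2 input) the `M`-monomial layer: every element of `A₀''` is `Σ_{a,b<p} m_{ab} x^a y^b` with `m_{ab} ∈ M`
  set mono : Fin p × Fin p → K := fun ab => x ^ (ab.1 : ℕ) * y ^ (ab.2 : ℕ) with hmonodef
  have hmonoRed : ∀ (m : K), m ∈ M → ∀ a b : ℕ, HasExp M.toSubring mono (m * (x ^ a * y ^ b)) := by
    intro m hm a b
    have hx' : x ^ a = (x ^ p) ^ (a / p) * x ^ (a % p) := by rw [← pow_mul, ← pow_add, Nat.div_add_mod]
    have hy' : y ^ b = (y ^ p) ^ (b / p) * y ^ (b % p) := by rw [← pow_mul, ← pow_add, Nat.div_add_mod]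
    have key : HasExp M.toSubring mono ((m * ((x ^ p) ^ (a / p) * (y ^ p) ^ (b / p))) *
        mono (⟨a % p, Nat.mod_lt _ hp.pos⟩, ⟨b % p, Nat.mod_lt _ hp.pos⟩)) :=
      hasExp_single (S₀ := M.toSubring) (M.mul_mem hm (M.mul_mem (pow_mem hxp _) (pow_mem hyp _))) _
    have heq : m * (x ^ a * y ^ b) = (m * ((x ^ p) ^ (a / p) * (y ^ p) ^ (b / p))) *
        mono (⟨a % p, Nat.mod_lt _ hp.pos⟩, ⟨b % p, Nat.mod_lt _ hp.pos⟩) := by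
      simp only [hmonodef]
      rw [hx', hy']; ring
    rw [heq]; exact key
  have hmonoWW : ∀ s t, HasExp M.toSubring mono (mono s * mono t) := by
    intro s t
    have : mono s * mono t = 1 * (x ^ ((s.1 : ℕ) + t.1) * y ^ ((s.2 : ℕ) + t.2)) := by
      simp only [hmonodef]; ring
    rw [this]; exact hmonoRed 1 M.one_mem _ _
  have hN₁A₀'' : ∀ a ∈ A₀'', HasExp M.toSubring mono a := by
    intro a ha
    rw [hA₀''def] at ha
    induction ha using Algebra.adjoin_induction with
    | mem g hg =>
      rcases hG₀cases g (Finset.mem_coe.mp hg) with hg | ⟨j, rfl⟩ | ⟨j, hj, rfl⟩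
      · have := hmonoRed g (hTM _ (le_locAtCentre _ O (hgensA₂ g hg))) 0 0
        simpa using this
      · obtain ⟨e, a, b, hj⟩ := hupres j
        have hzM : (∏ i, z i ^ e i) ∈ M := prod_mem fun i _ => zpow_mem (hTM _ (hzT i)) _
        rw [hj]; exact hmonoRed _ hzM a b
      · have := hmonoRed (u j)⁻¹ (M.inv_mem (huM j hj)) 0 0
        simpa using this
    | algebraMap c =>
      have := hmonoRed _ (hTM _ (le_locAtCentre _ O (hk c))) 0 0
      simpa using this
    | add _ _ _ _ ih₁ ih₂ => exact hasExp_add ih₁ ih₂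
    | mul _ _ _ _ ih₁ ih₂ => exact hasExp_mul hmonoWW ih₁ ih₂
  -- (F2) RG over the `M`-monomial layer, from DG and the ultrametric inequality
  have hRG₁ : ∀ e : S → K, (∀ s, HasExp M.toSubring mono (e s)) →
      ∀ s₀, O.valuation (e s₀ * W s₀) ≤ O.valuation (∑ s, e s * W s) := by
    intro e he s₀
    choose m hmM hme using he
    have htot : ∑ s, e s * W s =
        ∑ l : S × (Fin p × Fin p), m l.1 l.2 * (W l.1 * (x ^ (l.2.1 : ℕ) * y ^ (l.2.2 : ℕ))) := by
      rw [Fintype.sum_prod_type]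
      refine Finset.sum_congr rfl fun s _ => ?_
      rw [hme s, Finset.sum_mul]
      refine Finset.sum_congr rfl fun ab _ => ?_
      simp only [hmonodef]; ring
    rw [htot, hme s₀, Finset.sum_mul]
    refine Valuation.map_sum_le _ fun ab _ => ?_
    have h := hDG (fun l => m l.1 l.2) (fun l => hmM l.1 l.2) (s₀, ab)
    have heq : m s₀ ab * mono ab * W s₀ = m s₀ ab * (W s₀ * (x ^ (ab.1 : ℕ) * y ^ (ab.2 : ℕ))) := by
      simp only [hmonodef]; ring
    rw [heq]; exact h
  -- (F2) RG over `S₀ := locAtCentre A₀'' O` (common denominator of value `1`)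
  have RG₀ : ∀ e : S → K, (∀ s, e s ∈ locAtCentre A₀''.toSubring O) →
      ∀ s₀, O.valuation (e s₀ * W s₀) ≤ O.valuation (∑ s, e s * W s) := by
    intro e he s₀
    have hfr : ∀ s, ∃ a c : K, a ∈ A₀'' ∧ c ∈ A₀'' ∧ O.valuation c = 1 ∧ e s = a / c := fun s => by
      obtain ⟨a, ha, c, hc, hvc, h⟩ := mem_locAtCentre_iff.mp (he s)
      exact ⟨a, c, ha, hc, hvc, h⟩
    choose a c haA hcA hvc hec using hfr
    have hc0 : ∀ s, c s ≠ 0 := fun s => ne_zero_of_valuation_eq_one (hvc s)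
    set C : K := ∏ s, c s with hCdef
    have hvC : O.valuation C = 1 := by
      rw [hCdef, map_prod]; exact Finset.prod_eq_one fun s _ => hvc s
    have hCe : ∀ s, HasExp M.toSubring mono (C * e s) := by
      intro s
      have heq : C * e s = (∏ s' ∈ Finset.univ.erase s, c s') * a s := by
        rw [hCdef, ← Finset.prod_erase_mul _ _ (Finset.mem_univ s), hec s]
        have := hc0 s
        field_simp
      rw [heq]
      exact hN₁A₀'' _ (A₀''.mul_mem (prod_mem fun s' _ => hcA s') (haA s))
    have h := hRG₁ (fun s => C * e s) hCe s₀
    have heq : ∑ s, C * e s * W s = C * ∑ s, e s * W s := by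
      rw [Finset.mul_sum]; exact Finset.sum_congr rfl fun s _ => by ring
    have hL : O.valuation (C * e s₀ * W s₀) = O.valuation (e s₀ * W s₀) := by
      rw [mul_assoc, map_mul, hvC, one_mul]
    have hR : O.valuation (∑ s, C * e s * W s) = O.valuation (∑ s, e s * W s) := by
      rw [heq, map_mul, hvC, one_mul]
    rw [hL, hR] at h
    exact h
  -- (F1 input) the normal forms: `t ⊆ N := Σ_s W_s S₀`, hence `A'' ⊆ N`
  have hcoefNF : ∀ (ν : K) (d : Fin 3 → ℤ), (ν = 0 ∨ (ν ∈ locAtCentre A₂.toSubring O ∧ O.valuation ν = 1)) →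
      (∀ j : Fin 3, (j : ℕ) < ρ → 0 ≤ d j) → ν * ∏ j, u j ^ d j ∈ locAtCentre A₀''.toSubring O := by
    intro ν d hν hd
    have hν' : ν ∈ locAtCentre A₀''.toSubring O := by
      rcases hν with rfl | ⟨h, -⟩
      · exact Subring.zero_mem _
      · exact hTS₀ h
    refine Subring.mul_mem _ hν' (prod_mem fun j _ => ?_)
    by_cases hj : (j : ℕ) < ρ
    · exact zpow_mem_of_nonneg (hA₀''S₀ _ (hG₀A₀'' _ (hG₀u j))) (hd j hj)
    · exact zpow_mem_of_inv_mem (hA₀''S₀ _ (hG₀A₀'' _ (hG₀u j)))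
        (hA₀''S₀ _ (hG₀A₀'' _ (hG₀uinv j (not_lt.mp hj)))) (d j)
  have htExp : ∀ a ∈ t, HasExp (locAtCentre A₀''.toSubring O) W a := by
    intro a ha
    obtain ⟨ν, d, hν, hd, rfl⟩ := htu a ha
    refine hasExp_sum _ _ fun l _ => ?_
    have heq : ν l * W (σ l) * ∏ j, u j ^ d l j = (ν l * ∏ j, u j ^ d l j) * W (σ l) := by ring
    rw [heq]
    exact hasExp_single (hcoefNF (ν l) (d l) (hν l) (hd l)) (σ l)
  have h1 : HasExp (locAtCentre A₀''.toSubring O) W 1 := htExp 1 h1t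
  have hWW : ∀ s s', HasExp (locAtCentre A₀''.toSubring O) W (W s * W s') := fun s s' => htExp _ (hWWt s s')
  have hgenN : ∀ a ∈ A'', HasExp (locAtCentre A₀''.toSubring O) W a := by
    intro a ha
    rw [hA''def] at ha
    induction ha using Algebra.adjoin_induction with
    | mem g hg =>
      have hg' : g ∈ G := Finset.mem_coe.mp hg
      rw [hGdef] at hg'
      rcases Finset.mem_union.mp hg' with hg' | hg'
      · have := hasExp_mul_left (hA₀''S₀ _ (hG₀A₀'' g hg')) h1
        rwa [mul_one] at this
      · exact htExp g hg'
    | algebraMap c =>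
      have := hasExp_mul_left (hA₀''S₀ _ (hA₂A₀'' (hk c))) h1
      rwa [mul_one] at this
    | add _ _ _ _ ih₁ ih₂ => exact hasExp_add ih₁ ih₂
    | mul _ _ _ _ ih₁ ih₂ => exact hasExp_mul hWW ih₁ ih₂
  -- dimensions: `dim S = 3` (the centre is closed, `dim A'' = dim A = 3`), `dim S₀ = dim S` (integrality)
  have hdimAeq : ringKrullDim A = 3 := ringKrullDim_eq_three_of_locAtCentre O A hAO hdimA hdim3
  have hdimA'' : ringKrullDim A'' = 3 := by
    rw [Summit.ResolutionOfSingularities.ResolutionOfSingularities.Theorems.RadicialJung.CleanModels.ringKrullDim_eq_of_fg_of_le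
      hAfg hA''fg hAA'', hdimAeq]
  have hmaxS : (subringCentre A''.toSubring O hA''O).IsMaximal := hzd A''.toSubring hA''O (fun x hx => hAA'' hx)
  have hdimS : ringKrullDim (locAtCentre A''.toSubring O) = 3 := by
    rw [Summit.ResolutionOfSingularities.ResolutionOfSingularities.Theorems.RadicialJung.CleanModels.ringKrullDim_locAtCentre_eq_of_isMaximal
      A'' hA''fg O hA''O hmaxS, hdimA'']
  have hdimS₀ : ringKrullDim (locAtCentre A₀''.toSubring O) = 3 := by
    rw [ringKrullDim_eq_of_frame O hA''O h0le hWA'' hWv RG₀ hgenN]; exact hdimS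
  -- Part A on the frame-free chart: `S₀` is regular with a parameter `ψ₀ ∈ M`
  have hG₀cases' : ∀ x ∈ G₀, x ∈ A₂ ∨ (∃ j, x = u j) ∨ (∃ j : Fin 3, ρ ≤ (j : ℕ) ∧ x = (u j)⁻¹) ∨
      (∃ (L : Type) (_ : Fintype L) (ν : L → K) (d : L → Fin 3 → ℤ),
        (∀ l, ν l = 0 ∨ (ν l ∈ locAtCentre A₂.toSubring O ∧ O.valuation (ν l) = 1)) ∧
        (∀ l, ∀ j : Fin 3, (j : ℕ) < ρ → 0 ≤ d l j) ∧ x = ∑ l, ν l * ∏ j, u j ^ d l j) := by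
    intro x hx
    rcases hG₀cases x hx with hx | h | h
    · exact Or.inl (hgensA₂ x hx)
    · exact Or.inr (Or.inl h)
    · exact Or.inr (Or.inr (Or.inl h))
  obtain ⟨hreg₀, ψ₀, hψ₀1, hψ₀2, hψ₀M⟩ := port_regularParameter_core O M A₂ hA₂O hA₂M hreg₂ zT hzspanT ρ hρ u hu0 hupos
    huzero huM hzuT G₀ hG₀O hG₀u hG₀uinv hA₂A₀'' hG₀cases' hdimS₀
  -- Part B: `S` is regular and `ψ₀` stays a regular parameter
  haveI : IsRegularLocalRing (locAtCentre A₀''.toSubring O) := hreg₀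
  have hregS : IsRegularLocalRing (locAtCentre A''.toSubring O) :=
    isRegularLocalRing_of_frame O hA''O h0le hA''fg hWA'' hWv RG₀ hgenN
  haveI := hregS
  have hle : locAtCentre A₀''.toSubring O ≤ locAtCentre A''.toSubring O := locAtCentre_mono O (fun x hx => h0le hx)
  refine ⟨A'', hA''O, hAA'', hA''fg, hregS, ⟨(ψ₀ : K), hle ψ₀.2⟩, ?_⟩
  obtain ⟨hψ1, hψ2⟩ := regularParameter_of_frame O hA''O h0le hWA'' hWv RG₀ hgenN ψ₀ hψ₀1 hψ₀2 ⟨(ψ₀ : K), hle ψ₀.2⟩ rfl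
  exact ⟨hψ1, hψ2, hψ₀M⟩

/-! ## §H THE COMPOSITION (kernel-checked): PORTS 1⁗ (proved), 2′ (proved, over `k^p`), 3 (✓, verbatim), 4⁗ (proved, §G⁗.C) and the
exit lemma give THEOREM T⁗'s slice; T′_fin's slice is the COROLLARY `W := b` (constant frame). -/

section Composition

open AlgebraicGeometry CategoryTheory

set_option maxHeartbeats 1600000 in
/-- **THEOREM T⁗'s slice from the ports** — modulo F-02 in LU³ form (`hLU3`, applied to the field `k^p`), F-32 (`hEmb`) and the typed
commutative-algebra statement PORT 4⁗ (`hPort`, proved above as `frameChartPort`).  SORRY-FREE composition; data flow = the file header.  `hreg`, `hnd`, `htd`-free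
except in PORT 3. [folklore] -/
theorem cleanLU3DefectPRankTwoFrame_of_ports (p : ℕ) [Fact p.Prime]
    (hLU3 : ∀ (k : Type) [Field k], LocalUniformization3 k)
    (hEmb : ∀ (Z : Scheme.{0}) [IsIntegral Z] [IsNoetherian Z], Scheme.IsRegular Z →
      Scheme.IsExcellent Z → ∀ (X : Set Z), IsClosed X → X ≠ Set.univ → topologicalKrullDim X ≤ 2 →
        ∃ (Z' : Scheme.{0}) (π : Z' ⟶ Z), IsProper π ∧ Function.Surjective π.base ∧
          (∃ U : Z.Opens, (U : Set Z) = Xᶜ ∧ IsIso (π ∣_ U)) ∧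
          IsStrictNormalCrossingsDivisor Z' (π.base ⁻¹' X))
    (hPort : FrameChartPort p) :
    CleanLU3DefectPRankTwoFrameAt p := by
  intro k _ _ K _ _ O A hAO hAfg hFrac hdimA hreg hdim3 hzd g₀ hg₀ hdefect htd hnd hP2 Sb _ b hb S _ W hWO hPI hWmul hW1 hdegW
  classical
  haveI := hFrac
  have hp : p.Prime := Fact.out
  haveI : CharP K p := charP_of_injective_algebraMap (algebraMap k K).injective p
  have hk : ∀ c : k, algebraMap k K c ∈ O := fun c => hAO (A.algebraMap_mem c)
  -- `v W_s = 1` (residual `p`-independence)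
  have hWv : ∀ s, O.valuation (W s) = 1 := valuation_eq_one_of_residuallyPIndependentFamily O W hPI
  -- §1⁗ graded data in the frame
  obtain ⟨M, hM, hg₀M, hpM, hV, hRG, x, y, hx, hy, hvx, hvy, hP, hLI, cf, hcfM, hsum, hcfO⟩ :=
    port_gradedDataFrame p O g₀ hg₀ hdefect hP2 W hPI hWmul hW1 hdegW
  -- ## re-base `A` to the subfield `k₀ = k^p` (over which it is still finitely generated: `k = Σ_s k₀ b_s`)
  set k₀ : Subfield k := (frobenius k p).fieldRange with hk₀def
  letI : Algebra k₀ K := Algebra.compHom K k₀.subtype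
  haveI inst1 := IsScalarTower.of_algebraMap_eq (R := k₀) (S := k) (A := K) (fun _ => rfl)
  have halg₀ : ∀ c : k₀, algebraMap k₀ K c = algebraMap k K (c : k) := fun _ => rfl
  set B : Sb → K := fun s => algebraMap k K (b s) with hBdef
  let A₀ : Subalgebra k₀ K := A.restrictScalars k₀
  have hmemA₀ : ∀ x : K, x ∈ A₀ ↔ x ∈ A := fun _ => Subalgebra.mem_restrictScalars k₀
  obtain ⟨t, ht⟩ := hAfg
  set t₀ : Finset K := t ∪ Finset.univ.image B with ht₀def
  have hBt₀ : ∀ s, B s ∈ (t₀ : Set K) := fun s => by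
    rw [ht₀def, Finset.coe_union]; exact Or.inr (Finset.mem_coe.mpr (Finset.mem_image_of_mem B (Finset.mem_univ s)))
  have htt₀ : ∀ y ∈ (t : Set K), y ∈ (t₀ : Set K) := fun y hy => by
    rw [ht₀def, Finset.coe_union]; exact Or.inl hy
  have ht₀ : Algebra.adjoin k₀ (t₀ : Set K) = A₀ := by
    apply le_antisymm
    · refine Algebra.adjoin_le ?_
      intro x hx
      rw [ht₀def, Finset.coe_union] at hx
      rcases hx with hx | hx
      · exact (hmemA₀ _).mpr (by rw [← ht]; exact Algebra.subset_adjoin hx)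
      · obtain ⟨s, -, rfl⟩ := Finset.mem_image.mp (Finset.mem_coe.mp hx)
        exact (hmemA₀ _).mpr (A.algebraMap_mem (b s))
    · intro x hx
      have hx' : x ∈ Algebra.adjoin k (t : Set K) := by rw [ht]; exact (hmemA₀ x).mp hx
      have hBad : ∀ s, B s ∈ Algebra.adjoin k₀ (t₀ : Set K) := fun s => Algebra.subset_adjoin (hBt₀ s)
      clear hx
      induction hx' using Algebra.adjoin_induction with
      | mem y hy => exact Algebra.subset_adjoin (htt₀ y hy)
      | algebraMap c =>
        obtain ⟨d, hd⟩ := hb c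
        rw [hd, map_sum]
        refine sum_mem fun i _ => ?_
        have hdi : algebraMap k K (d i ^ p) =
            algebraMap k₀ K ⟨d i ^ p, RingHom.mem_fieldRange.mpr ⟨d i, frobenius_def _ _⟩⟩ := by
          rw [halg₀]
        rw [map_mul, hdi]
        exact mul_mem (Subalgebra.algebraMap_mem _ _) (hBad i)
      | add y z _ _ hy hz => exact add_mem hy hz
      | mul y z _ _ hy hz => exact mul_mem hy hz
  have hA₀fg : A₀.FG := ⟨t₀, ht₀⟩
  haveI hfr₀ : IsFractionRing A₀ K := ‹IsFractionRing A K›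
  have hdimA₀ : ringKrullDim A₀ ≤ 3 := hdimA
  have hA₀O : A₀.toSubring ≤ O.toSubring := hAO
  have hdim3₀ : ringKrullDim (locAtCentre A₀.toSubring O) = 3 := hdim3
  have hzd₀ : ∀ (T : Subring K) (hT : T ≤ O.toSubring), A₀.toSubring ≤ T → (subringCentre T O hT).IsMaximal := hzd
  have ht₀A : ∀ a ∈ t₀, a ∈ A := fun a ha =>
    (hmemA₀ a).mp (by rw [← ht₀]; exact Algebra.subset_adjoin (Finset.mem_coe.mpr ha))
  -- ## the twist-field identification over `k₀` (memo §10 patch: constants of `k₀` ARE `p`-th powers in `K`)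
  have htwist : ∀ g₁ : K, (IntermediateField.adjoin k₀ ((fun x : K => x ^ p) '' (t₀ : Set K) ∪ {g₁})).toSubfield =
      Subfield.closure (Set.range (frobenius K p) ∪ {g₁}) := by
    intro g₁
    rw [TwistModel.adjoin_twist_toSubfield_eq p A₀ (t₀ : Set K) ht₀ g₁]
    apply le_antisymm
    · apply Subfield.closure_le.mpr
      rintro x ((hx | hx) | hx)
      · obtain ⟨c, rfl⟩ := hx
        obtain ⟨d, hd⟩ := RingHom.mem_fieldRange.mp c.2
        refine Subfield.subset_closure (Or.inl ⟨algebraMap k K d, ?_⟩)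
        rw [frobenius_def, ← map_pow, ← frobenius_def, hd, halg₀]
      · exact Subfield.subset_closure (Or.inl hx)
      · exact Subfield.subset_closure (Or.inr hx)
    · exact Subfield.closure_mono (Set.union_subset_union_left _ Set.subset_union_right)
  -- ## the generator list `tW := {1} ∪ t₀ ∪ W ∪ W·W` (all in `O`)
  set tW : Finset K := insert 1 (t₀ ∪ Finset.univ.image W ∪ Finset.univ.image (fun q : S × S => W q.1 * W q.2)) with htWdef
  have h1tW : (1 : K) ∈ tW := by rw [htWdef]; exact Finset.mem_insert_self _ _
  have ht₀W : ∀ a ∈ t₀, a ∈ tW := fun a ha => by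
    rw [htWdef]; exact Finset.mem_insert_of_mem (Finset.mem_union_left _ (Finset.mem_union_left _ ha))
  have hWtW : ∀ s, W s ∈ tW := fun s => by
    rw [htWdef]
    exact Finset.mem_insert_of_mem (Finset.mem_union_left _ (Finset.mem_union_right _
      (Finset.mem_image.mpr ⟨s, Finset.mem_univ _, rfl⟩)))
  have hWWtW : ∀ s s' : S, W s * W s' ∈ tW := fun s s' => by
    rw [htWdef]
    exact Finset.mem_insert_of_mem (Finset.mem_union_right _ (Finset.mem_image.mpr ⟨(s, s'), Finset.mem_univ _, rfl⟩))
  have htWcases : ∀ a ∈ tW, a = 1 ∨ a ∈ t₀ ∨ (∃ s, a = W s) ∨ (∃ s s' : S, a = W s * W s') := by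
    intro a ha
    rw [htWdef, Finset.mem_insert, Finset.mem_union, Finset.mem_union] at ha
    rcases ha with rfl | (ha | ha) | ha
    · exact Or.inl rfl
    · exact Or.inr (Or.inl ha)
    · obtain ⟨s, -, rfl⟩ := Finset.mem_image.mp ha
      exact Or.inr (Or.inr (Or.inl ⟨s, rfl⟩))
    · obtain ⟨q, -, rfl⟩ := Finset.mem_image.mp ha
      exact Or.inr (Or.inr (Or.inr ⟨q.1, q.2, rfl⟩))
  have htWO : ∀ a ∈ tW, a ∈ O := by
    intro a ha
    rcases htWcases a ha with rfl | ha | ⟨s, rfl⟩ | ⟨s, s', rfl⟩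
    · exact O.one_mem
    · exact hAO (ht₀A a ha)
    · exact hWO s
    · exact mul_mem (hWO s) (hWO s')
  have hA₀tW : A₀ ≤ Algebra.adjoin k₀ (tW : Set K) := by
    rw [← ht₀]
    exact Algebra.adjoin_mono fun a ha => Finset.mem_coe.mpr (ht₀W a (Finset.mem_coe.mp ha))
  -- ## the finite set to monomialise: `x^p`, `y^p` and the non-zero graded coefficients of the members of `tW`
  set F : Finset K := (insert (x ^ p) (insert (y ^ p)
    ((tW ×ˢ (Finset.univ : Finset (S × (Fin p × Fin p)))).image (fun q => cf q.1 q.2)))).filter (fun f => f ≠ 0)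
    with hFdef
  have hFM : ∀ f ∈ F, f ∈ M := by
    intro f hf
    rw [hFdef, Finset.mem_filter, Finset.mem_insert, Finset.mem_insert, Finset.mem_image] at hf
    rcases hf with ⟨rfl | rfl | ⟨q, hq, rfl⟩, -⟩
    · exact hpM x
    · exact hpM y
    · exact hcfM q.1 q.2
  have hF0 : ∀ f ∈ F, f ≠ 0 := fun f hf => (Finset.mem_filter.mp hf).2
  have hxpF : x ^ p ∈ F := Finset.mem_filter.mpr ⟨by simp, pow_ne_zero _ hx⟩
  have hypF : y ^ p ∈ F := Finset.mem_filter.mpr ⟨by simp, pow_ne_zero _ hy⟩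
  have hcfF : ∀ a ∈ tW, ∀ l, cf a l ≠ 0 → cf a l ∈ F := by
    intro a ha l hne
    refine Finset.mem_filter.mpr ⟨Finset.mem_insert_of_mem (Finset.mem_insert_of_mem ?_), hne⟩
    exact Finset.mem_image.mpr ⟨(a, l), Finset.mem_product.mpr ⟨ha, Finset.mem_univ _⟩, rfl⟩
  -- §2′ the monomialising `k₀`-model `T := locAtCentre A₂ O ⊆ M` (Port 2b core over `k₀`; consumes F-02 at `k^p` and F-32)
  obtain ⟨A₂, hA₂O, hA₂fg, hAp, hR₂M, hreg₂, z₂, hspan₂, hdimR₂, hz0, hfac⟩ :=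
    port_monomialModel_core p (hLU3 _) hEmb O A₀ hA₀O hA₀fg hdimA₀ hdim3₀ hzd₀ t₀ ht₀ htwist g₀ M hM F hFM hF0
  haveI := hreg₂
  -- `K`-valued parameters
  set z : Fin 3 → K := fun i => (z₂ i : K) with hzdef
  have hzT : ∀ i, z i ∈ locAtCentre A₂.toSubring O := fun i => (z₂ i).2
  have hz0' : ∀ i, z i ≠ 0 := fun i => hz0 i
  have hzv : ∀ i, O.valuation (z i) < 1 := by
    intro i
    have hi : z₂ i ∈ maximalIdeal _ := by rw [← hspan₂]; exact Ideal.subset_span ⟨i, rfl⟩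
    exact (mem_maximalIdeal_locAtCentre_iff hA₂O _).mp hi
  have hzspan : ∀ r : K, r ∈ locAtCentre A₂.toSubring O → O.valuation r < 1 →
      ∃ b : Fin 3 → K, (∀ i, b i ∈ locAtCentre A₂.toSubring O) ∧ r = ∑ i, b i * z i := by
    intro r hr hvr
    have hm : (⟨r, hr⟩ : locAtCentre A₂.toSubring O) ∈ maximalIdeal _ :=
      (mem_maximalIdeal_locAtCentre_iff hA₂O _).mpr hvr
    rw [← hspan₂, Ideal.mem_span_range_iff_exists_fun] at hm
    obtain ⟨b, hb⟩ := hm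
    refine ⟨fun i => (b i : K), fun i => (b i).2, ?_⟩
    have h := congrArg (fun w : locAtCentre A₂.toSubring O => (w : K)) hb
    simp only at h
    rw [← h]
    push_cast
    rfl
  have hfac' : ∀ f ∈ F, ∃ (ε : K) (e : Fin 3 → ℤ), ε ∈ locAtCentre A₂.toSubring O ∧ O.valuation ε = 1 ∧
      f = ε * ∏ i, z i ^ e i := hfac
  choose! ε ex hεT hεv hfeq using hfac'
  have hzM : ∀ i, z i ∈ M := fun i => hR₂M _ (hzT i)
  have hzV : ∀ i, ∃ w : K, w ≠ 0 ∧ O.valuation (z i) = O.valuation (w ^ p) := fun i => hV _ (hzM i) (hz0' i)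
  have hxA : x ^ p = ε (x ^ p) * ∏ i, z i ^ ex (x ^ p) i := hfeq _ hxpF
  have hyB : y ^ p = ε (y ^ p) * ∏ i, z i ^ ex (y ^ p) i := hfeq _ hypF
  -- exponent data of the non-zero graded pieces (the frame factor `W_s` is a `v`-unit and is dropped)
  set pieces : Finset (K × (S × (Fin p × Fin p))) := (tW ×ˢ Finset.univ).filter (fun q => cf q.1 q.2 ≠ 0) with hpieces
  set E : Finset ((Fin 3 → ℤ) × (Fin p × Fin p)) := pieces.image (fun q => (ex (cf q.1 q.2), q.2.2)) with hEdef
  have hE : ∀ e ∈ E, O.valuation ((∏ i, z i ^ e.1 i) * (x ^ (e.2.1 : ℕ) * y ^ (e.2.2 : ℕ))) ≤ 1 := by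
    intro e he
    obtain ⟨q, hq, rfl⟩ := Finset.mem_image.mp he
    obtain ⟨hq1, hq2⟩ := Finset.mem_filter.mp hq
    have hat : q.1 ∈ tW := (Finset.mem_product.mp hq1).1
    have hF' : cf q.1 q.2 ∈ F := hcfF q.1 hat q.2 hq2
    have hval : O.valuation (cf q.1 q.2 * (W q.2.1 * (x ^ (q.2.2.1 : ℕ) * y ^ (q.2.2.2 : ℕ)))) ≤ 1 :=
      (O.valuation_le_one_iff _).mpr (hcfO q.1 (htWO q.1 hat) q.2)
    rw [hfeq _ hF', map_mul, map_mul, map_mul, hεv _ hF', hWv, one_mul, one_mul, ← map_mul] at hval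
    simpa using hval
  -- §3 the toric chart (✓ PORT 3, VERBATIM; `k`-facing only through `htd`)
  obtain ⟨ρ, hρ, c, a, b', u, ha, hb', hu, hupos, huzero, hzu, hEu⟩ :=
    port_toricChart p O A hAO ⟨t, ht⟩ hdimA hdim3 htd hx hy hP z hz0' hzv hzV (ε (x ^ p)) (ε (y ^ p))
      (hεv _ hxpF) (hεv _ hypF) (ex (x ^ p)) (ex (y ^ p)) hxA hyB E hE
  -- (PB0): the value-zero chart monomials involve no `x`, `y`, hence lie in `M`
  have hab0 : ∀ j : Fin 3, ρ ≤ (j : ℕ) → a j = 0 ∧ b' j = 0 := by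
    intro j hj
    obtain ⟨W', hW0, hW'⟩ := exists_valuation_prod_zpow_eq O z hzV (c j)
    exact exponents_eq_zero_of_valuation_eq_one O hP (ha j) (hb' j) hW0 hW' (by rw [← hu j]; exact huzero j hj)
  have huM : ∀ j : Fin 3, ρ ≤ (j : ℕ) → u j ∈ M := by
    intro j hj
    obtain ⟨ha0, hb0⟩ := hab0 j hj
    rw [hu j, ha0, hb0, pow_zero, pow_zero, mul_one, mul_one]
    exact prod_mem fun i _ => zpow_mem (hzM i) _
  have hu0 : ∀ j, u j ≠ 0 := by
    intro j
    rw [hu j]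
    exact mul_ne_zero (Finset.prod_ne_zero_iff.mpr fun i _ => zpow_ne_zero _ (hz0' i))
      (mul_ne_zero (pow_ne_zero _ hx) (pow_ne_zero _ hy))
  have hupres : ∀ j : Fin 3, ∃ (e : Fin 3 → ℤ) (a₁ b₁ : ℕ), u j = (∏ i, z i ^ e i) * (x ^ a₁ * y ^ b₁) :=
    fun j => ⟨c j, a j, b' j, hu j⟩
  -- the unit factors `α^i β^j` are units of `T`
  have hunit : ∀ (ia ib : ℤ), ε (x ^ p) ^ ia * ε (y ^ p) ^ ib ∈ locAtCentre A₂.toSubring O ∧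
      O.valuation (ε (x ^ p) ^ ia * ε (y ^ p) ^ ib) = 1 := fun ia ib =>
    ⟨mul_mem (zpow_mem_locAtCentre (hεT _ hxpF) (hεv _ hxpF) ia)
        (zpow_mem_locAtCentre (hεT _ hypF) (hεv _ hypF) ib),
      by rw [map_mul, map_zpow₀, map_zpow₀, hεv _ hxpF, hεv _ hypF, one_zpow, one_zpow, one_mul]⟩
  have hzu' : ∀ i : Fin 3, ∃ (ε' : K) (d : Fin 3 → ℤ), ε' ∈ locAtCentre A₂.toSubring O ∧ O.valuation ε' = 1 ∧
      (∀ j : Fin 3, (j : ℕ) < ρ → 0 ≤ d j) ∧ (∃ j : Fin 3, (j : ℕ) < ρ ∧ 0 < d j) ∧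
      z i = ε' * ∏ j, u j ^ d j := by
    intro i
    obtain ⟨d, ia, ib, hd, hdpos, hzi⟩ := hzu i
    exact ⟨_, d, (hunit ia ib).1, (hunit ia ib).2, hd, hdpos, hzi⟩
  -- the members of `tW` as unit-weighted sums of frame-chart monomials with `d_{<ρ} ≥ 0`
  choose! dE iaE ibE hdE hkerE hmonE using hEu
  have htu' : ∀ a₀ ∈ tW, ∃ (ν : S × (Fin p × Fin p) → K) (d : S × (Fin p × Fin p) → Fin 3 → ℤ),
      (∀ l, ν l = 0 ∨ (ν l ∈ locAtCentre A₂.toSubring O ∧ O.valuation (ν l) = 1)) ∧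
      (∀ l, ∀ j : Fin 3, (j : ℕ) < ρ → 0 ≤ d l j) ∧ a₀ = ∑ l, ν l * W (Prod.fst l) * ∏ j, u j ^ d l j := by
    intro a₀ ha₀
    have hmemE : ∀ l, cf a₀ l ≠ 0 → (ex (cf a₀ l), l.2) ∈ E := fun l hne =>
      Finset.mem_image.mpr ⟨(a₀, l), Finset.mem_filter.mpr ⟨Finset.mem_product.mpr ⟨ha₀, Finset.mem_univ _⟩, hne⟩, rfl⟩
    refine ⟨fun l => if cf a₀ l = 0 then 0 else
        ε (cf a₀ l) * (ε (x ^ p) ^ iaE (ex (cf a₀ l), l.2) * ε (y ^ p) ^ ibE (ex (cf a₀ l), l.2)),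
      fun l => if cf a₀ l = 0 then 0 else dE (ex (cf a₀ l), l.2), ?_, ?_, ?_⟩
    · intro l
      by_cases h0 : cf a₀ l = 0
      · exact Or.inl (by simp [h0])
      · refine Or.inr ?_
        simp only [h0, if_false]
        have hF' := hcfF a₀ ha₀ l h0
        exact ⟨mul_mem (hεT _ hF') (hunit _ _).1,
          by rw [map_mul, hεv _ hF', (hunit _ _).2, one_mul]⟩
    · intro l j hj
      by_cases h0 : cf a₀ l = 0
      · simp [h0]
      · simp only [h0, if_false]
        exact hdE _ (hmemE l h0) j hj
    · conv_lhs => rw [← hsum a₀]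
      refine Finset.sum_congr rfl fun l _ => ?_
      by_cases h0 : cf a₀ l = 0
      · simp [h0]
      · simp only [h0, if_false]
        have hF' := hcfF a₀ ha₀ l h0
        have hmon := hmonE _ (hmemE l h0)
        simp only at hmon
        calc cf a₀ l * (W l.1 * (x ^ (l.2.1 : ℕ) * y ^ (l.2.2 : ℕ)))
            = (ε (cf a₀ l) * ∏ i, z i ^ ex (cf a₀ l) i) * (W l.1 * (x ^ (l.2.1 : ℕ) * y ^ (l.2.2 : ℕ))) := by
              rw [← hfeq _ hF']
          _ = ε (cf a₀ l) * W l.1 * ((∏ i, z i ^ ex (cf a₀ l) i) * (x ^ (l.2.1 : ℕ) * y ^ (l.2.2 : ℕ))) := by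
              ring
          _ = ε (cf a₀ l) * (ε (x ^ p) ^ iaE (ex (cf a₀ l), l.2) * ε (y ^ p) ^ ibE (ex (cf a₀ l), l.2)) *
                W l.1 * ∏ j, u j ^ dE (ex (cf a₀ l), l.2) j := by
              rw [hmon]; ring
  -- §G⁗ the regular frame-chart algebra and its regular parameter in `M` (the typed obligation PORT 4⁗)
  obtain ⟨A'', hA''O, hA₀A'', hA''fg, hreg'', ψ, hψ1, hψ2, hψM⟩ :=
    hPort k₀ K O A₀ hA₀O hA₀fg hfr₀ hdimA₀ hdim3₀ hzd₀ M A₂ hA₂O hA₂fg hAp hR₂M hreg₂ hdimR₂ z hzT hz0' hzv hzspan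
      S W hWO hWv hRG x y hx hy (hpM x) (hpM y) hvx hvy hLI hV hP
      (fun m hm l₀ => valuation_term_le_double_sum hp O M hV W hWv hRG hx hy hP m hm l₀)
      tW htWO hA₀tW h1tW hWtW hWWtW ρ hρ u hu0 hupos huzero huM hupres hzu'
      (S × (Fin p × Fin p)) Prod.fst htu'
  -- ## back to `k`: the same subring is a finitely generated `k`-subalgebra containing `A`
  obtain ⟨gens, hgens⟩ := hA''fg
  let A''k : Subalgebra k K :=
    { toSubsemiring := A''.toSubsemiring
      algebraMap_mem' := fun c₁ => hA₀A'' ((hmemA₀ _).mpr (A.algebraMap_mem c₁)) }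
  have hmemA''k : ∀ w : K, w ∈ A''k ↔ w ∈ A'' := fun _ => Iff.rfl
  have hAA'' : A ≤ A''k := fun w hw => (hmemA''k w).mpr (hA₀A'' ((hmemA₀ w).mpr hw))
  have hA''kfg : A''k.FG := by
    refine ⟨gens, le_antisymm ?_ ?_⟩
    · refine Algebra.adjoin_le ?_
      intro g hg
      rw [SetLike.mem_coe, hmemA''k, ← hgens]
      exact Algebra.subset_adjoin hg
    · intro w hw
      have hw' : w ∈ Algebra.adjoin k₀ (gens : Set K) := by rw [hgens]; exact (hmemA''k w).mp hw
      have hle : Algebra.adjoin k₀ (gens : Set K) ≤ (Algebra.adjoin k (gens : Set K)).restrictScalars k₀ :=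
        Algebra.adjoin_le fun g hg => Algebra.subset_adjoin hg
      exact (Subalgebra.mem_restrictScalars k₀).mp (hle hw')
  have hA''kO : A''k.toSubring ≤ O.toSubring := fun w hw => hA''O hw
  -- exit: clean form (3) (✓ VERBATIM)
  obtain ⟨cM, hcM⟩ := (hM _).mp hψM
  exact cleanLUConcl_of_parameter O A A''k hA''kO hAA'' hA''kfg hreg'' g₀ ψ hψ1 hψ2 cM hcM

/-- **THEOREM T⁗** (rev 2): F-02 consumed in its main-theorem form `CossartPiltant2019` (✓ `CossartPiltant2019.lu3`) and PORT 4⁗ DISCHARGED by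
`frameChartPort` — the frame slice modulo F-32 (`hEmb`) alone. [folklore] -/
theorem cleanLU3DefectPRankTwoFrame_of_cossartPiltant2019 (p : ℕ) [Fact p.Prime]
    (hCP : CossartPiltant2019.{0})
    (hEmb : ∀ (Z : Scheme.{0}) [IsIntegral Z] [IsNoetherian Z], Scheme.IsRegular Z →
      Scheme.IsExcellent Z → ∀ (X : Set Z), IsClosed X → X ≠ Set.univ → topologicalKrullDim X ≤ 2 →
        ∃ (Z' : Scheme.{0}) (π : Z' ⟶ Z), IsProper π ∧ Function.Surjective π.base ∧
          (∃ U : Z.Opens, (U : Set Z) = Xᶜ ∧ IsIso (π ∣_ U)) ∧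
          IsStrictNormalCrossingsDivisor Z' (π.base ⁻¹' X))
    : CleanLU3DefectPRankTwoFrameAt p :=
  cleanLU3DefectPRankTwoFrame_of_ports p (fun k _ => hCP.lu3 k) hEmb (frameChartPort p)

/-- **T′_fin ⊂ T⁗** (kernel-checked): the finite-`p`-rank SEPARABLE slice of `Lens5_TPrime.lean` is the case «constant frame `W := b`»
of the frame slice — its two separability binders (`SepGenerated k K`, residual `p`-independence of `b`) are exactly what makes the
constants a residually `p`-independent frame with `[K : K^p(b)] = [K : k K^p] = p³` (§A).  Hence every ARITHMETIC hypothesis on `k`,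
`K/k`, `κ_v/k` in T′ was an artefact of choosing the frame inside `k`. [folklore] -/
theorem cleanLU3DefectPRankTwoSepFin_of_frame (p : ℕ) [Fact p.Prime] (hFrame : CleanLU3DefectPRankTwoFrameAt p) :
    CleanLU3DefectPRankTwoSepFinAt p := by
  intro k _ _ K _ _ O A hAO hAfg hFrac hdimA hreg hdim3 hzd g₀ hg₀ hdefect htd hnd hP2 hsep S _ b hb hPI
  classical
  haveI := hFrac
  have hp : p.Prime := Fact.out
  haveI : CharP K p := charP_of_injective_algebraMap (algebraMap k K).injective p
  have hk : ∀ c : k, algebraMap k K c ∈ O := fun c => hAO (A.algebraMap_mem c)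
  have hdimAeq : ringKrullDim A = 3 := ringKrullDim_eq_three_of_locAtCentre O A hAO hdimA hdim3
  -- `[K : k·K^p] = p³` (§A) and `k·K^p = K^p(b)`
  have hdeg : Module.finrank (Subfield.closure (Set.range (algebraMap k K) ∪ Set.range (frobenius K p))) K = p ^ 3 :=
    PDegreeSep.pDegreeThreeOfSepGenerated p k K A hAfg hFrac hdimAeq hsep
  have hcl : Subfield.closure (Set.range (fun s => algebraMap k K (b s)) ∪ Set.range (fun x : K => x ^ p)) =
      Subfield.closure (Set.range (algebraMap k K) ∪ Set.range (frobenius K p)) := by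
    apply le_antisymm
    · apply Subfield.closure_le.mpr
      rintro z (⟨s, rfl⟩ | ⟨w, rfl⟩)
      · exact Subfield.subset_closure (Or.inl ⟨b s, rfl⟩)
      · refine Subfield.subset_closure (Or.inr ⟨w, ?_⟩)
        show frobenius K p w = w ^ p
        exact frobenius_def ..
    · apply Subfield.closure_le.mpr
      rintro z (⟨c₀, rfl⟩ | ⟨w, rfl⟩)
      · obtain ⟨d, hd⟩ := hb c₀
        rw [hd, map_sum]
        refine sum_mem fun i _ => ?_
        rw [map_mul, map_pow]
        exact mul_mem (Subfield.subset_closure (Or.inr ⟨algebraMap k K (d i), rfl⟩))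
          (Subfield.subset_closure (Or.inl ⟨i, rfl⟩))
      · refine Subfield.subset_closure (Or.inr ⟨w, ?_⟩)
        show w ^ p = frobenius K p w
        exact (frobenius_def ..).symm
  have hdegW : Module.finrank (Subfield.closure (Set.range (fun s => algebraMap k K (b s)) ∪ Set.range (fun x : K => x ^ p))) K
      = p ^ 3 := by
    rw [hcl]; exact hdeg
  refine hFrame k K O A hAO hAfg hFrac hdimA hreg hdim3 hzd g₀ hg₀ hdefect htd hnd hP2 S b hb S
    (fun s => algebraMap k K (b s)) (fun s => hk (b s)) hPI ?_ ?_ hdegW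
  · intro s t
    obtain ⟨d, hd⟩ := hb (b s * b t)
    refine ⟨fun u => algebraMap k K (d u), ?_⟩
    rw [← map_mul, hd, map_sum]
    exact Finset.sum_congr rfl fun u _ => by rw [map_mul, map_pow]
  · obtain ⟨d, hd⟩ := hb 1
    refine ⟨fun u => algebraMap k K (d u), ?_⟩
    have h := congrArg (algebraMap k K) hd
    rw [map_one, map_sum] at h
    rw [h]
    exact Finset.sum_congr rfl fun u _ => by rw [map_mul, map_pow]

/-- Hence THEOREM T′_fin's final theorem is recovered from T⁗'s, modulo the same inputs (`CossartPiltant2019`, F-32). [folklore] -/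
theorem cleanLU3DefectPRankTwoSepFin_of_cossartPiltant2019' (p : ℕ) [Fact p.Prime]
    (hCP : CossartPiltant2019.{0})
    (hEmb : ∀ (Z : Scheme.{0}) [IsIntegral Z] [IsNoetherian Z], Scheme.IsRegular Z →
      Scheme.IsExcellent Z → ∀ (X : Set Z), IsClosed X → X ≠ Set.univ → topologicalKrullDim X ≤ 2 →
        ∃ (Z' : Scheme.{0}) (π : Z' ⟶ Z), IsProper π ∧ Function.Surjective π.base ∧
          (∃ U : Z.Opens, (U : Set Z) = Xᶜ ∧ IsIso (π ∣_ U)) ∧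
          IsStrictNormalCrossingsDivisor Z' (π.base ⁻¹' X))
    : CleanLU3DefectPRankTwoSepFinAt p :=
  cleanLU3DefectPRankTwoSepFin_of_frame p (cleanLU3DefectPRankTwoFrame_of_cossartPiltant2019 p hCP hEmb)

end Composition

/-! ## §I (rev 3) `p`-MONOMIAL FRAMES — (MULT), (1), (DEG) discharged: the slice over «`r` elements of `O_v` with `p`-independent residues and
`[K : K^p] = p^{r+3}`»

A frame need not be given axiomatically.  For `w : Fin r → O_v` let `W_e := ∏ i, w_i^{e_i}` (`e : Fin r → Fin p`) be its `p^r` `p`-MONOMIALS.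
(MULT) and (1) hold identically (`w_i^p ∈ K^p`, exponents add mod `p`), so a monomial frame is subject to two conditions only: (RPI) for the
monomial family — literally «the residues `w̄_i` are `p`-independent in `κ_v` over `κ_v^p`» — and (DEG), which by the tower `K^p ⊆ K^p(W) ⊆ K` and
`[K^p(W) : K^p] = p^r` (§D, from RG over `K^p`, where IR is trivial) is the numerical invariant `[K : K^p] = p^{r+3}` of `K` ALONE
(`cleanLU3DefectPRankTwoPMon_of_frame`).  Since `[K : K^p] = p^3·[k : k^p]` for `K/k` finitely generated of transcendence degree `3` (the degree of
imperfection is additive: invariant under finite extensions — count `[L : K^p]` two ways — and `+1` per transcendental element — `k(y) = ⊕ k^p(y) e_i`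
for a `k^p`-basis `e_i` of `k`; Becker–MacLane 1940, Bourbaki A.V §13 ex.; BY HAND, memo CLASSBC §25), the kernel slice `CleanLU3DefectPRankTwoPMonAt p`
reads, for `k` of finite `p`-rank `r₀ = log_p [k : k^p]`: (P2) and «`O_v` contains `r₀` elements whose residues are `p`-independent over `κ_v^p`»,
i.e. `[κ_v : κ_v^p] ≥ [k : k^p]` — which for `κ_v/k` algebraic (automatic under (P2) + `htd`, ✓ currency §K) is `[κ_v : κ_v^p] = [k : k^p] < ∞`.
Case `r = 0` (`W = {1}`, `[K : K^p] = p³`) is THEOREM T's perfect-ground slice with the perfectness of `k` replaced by the one number `[K : K^p]`. -/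

section PMonomialFrames

/-- The `p`-monomials `W_e := ∏ i, w_i ^ {e_i}` (`0 ≤ e_i < p`) of a finite family `w : Fin r → K`. [folklore] -/
def pMonomial (p : ℕ) {K : Type} [Field K] {r : ℕ} (w : Fin r → K) (e : Fin r → Fin p) : K := ∏ i, w i ^ (e i : ℕ)

theorem pMonomial_mem (p : ℕ) {K : Type} [Field K] {r : ℕ} (O : ValuationSubring K) (w : Fin r → K) (hw : ∀ i, w i ∈ O)
    (e : Fin r → Fin p) : pMonomial p w e ∈ O := by
  unfold pMonomial
  exact prod_mem fun i _ => pow_mem (hw i) _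

/-- Exponents add modulo `p`; the carries are a `p`-th power. [folklore] -/
theorem pMonomial_mul_eq (p : ℕ) [NeZero p] {K : Type} [Field K] {r : ℕ} (w : Fin r → K) (e e' : Fin r → Fin p) :
    pMonomial p w e * pMonomial p w e' = (∏ i, w i ^ (((e i : ℕ) + e' i) / p)) ^ p * pMonomial p w (e + e') := by
  unfold pMonomial
  rw [← Finset.prod_pow, ← Finset.prod_mul_distrib, ← Finset.prod_mul_distrib]
  refine Finset.prod_congr rfl fun i _ => ?_
  rw [← pow_mul, ← pow_add, ← pow_add, Pi.add_apply, Fin.val_add]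
  congr 1
  exact (Nat.div_add_mod' _ _).symm

/-- (MULT) for monomial frames. [folklore] -/
theorem pMonomial_mult (p : ℕ) [NeZero p] {K : Type} [Field K] {r : ℕ} (w : Fin r → K) (e e' : Fin r → Fin p) :
    ∃ d : (Fin r → Fin p) → K, pMonomial p w e * pMonomial p w e' = ∑ u, d u ^ p * pMonomial p w u := by
  classical
  refine ⟨Pi.single (e + e') (∏ i, w i ^ (((e i : ℕ) + e' i) / p)), ?_⟩
  rw [Finset.sum_eq_single (e + e'), Pi.single_eq_same, pMonomial_mul_eq]
  · intro u _ hu; rw [Pi.single_eq_of_ne hu, zero_pow (NeZero.ne p), zero_mul]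
  · intro h; exact absurd (Finset.mem_univ _) h

/-- (1) for monomial frames: `W_0 = 1`. [folklore] -/
theorem pMonomial_one (p : ℕ) [NeZero p] {K : Type} [Field K] {r : ℕ} (w : Fin r → K) :
    ∃ d : (Fin r → Fin p) → K, ∑ u, d u ^ p * pMonomial p w u = 1 := by
  classical
  refine ⟨Pi.single 0 1, ?_⟩
  rw [Finset.sum_eq_single (0 : Fin r → Fin p), Pi.single_eq_same, one_pow, one_mul]
  · unfold pMonomial
    exact Finset.prod_eq_one fun i _ => by simp
  · intro u _ hu; rw [Pi.single_eq_of_ne hu, zero_pow (NeZero.ne p), zero_mul]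
  · intro h; exact absurd (Finset.mem_univ _) h

/-- **THEOREM T⁗′'s slice** (`p`-monomial frames): `stub_cleanLU3DefectNonDiscrete` at `p` on {`[Γ : pΓ] = p²`, `k` of finite `p`-rank,
`r` elements `w_i ∈ O_v` whose `p`-monomials are residually `p`-independent (= residues `p`-independent over `κ_v^p`), `[K : K^p] = p^{r+3}`}.
NO (MULT)/(1)/(DEG), no hypothesis on `K/k` or `κ_v/k`.  Binders through `hnd` are those of the lead's stub (token-identical with §B″). [folklore] -/
def CleanLU3DefectPRankTwoPMonAt (p : ℕ) : Prop :=
    ∀ (k : Type) [Field k] [CharP k p] (K : Type) [Field K] [Algebra k K]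
    (O : ValuationSubring K) (A : Subalgebra k K), A.toSubring ≤ O.toSubring → A.FG → IsFractionRing A K →
    ringKrullDim A ≤ 3 → IsRegularLocalRing (locAtCentre A.toSubring O) →
    ringKrullDim (locAtCentre A.toSubring O) = 3 →
    (∀ (T : Subring K) (hT : T ≤ O.toSubring), A.toSubring ≤ T → (subringCentre T O hT).IsMaximal) →
    ∀ g₀ : K, (∀ c : K, c ^ p ≠ g₀) →
    (∀ f₀ : K, ∃ f₁ : K, O.valuation (g₀ - f₁ ^ p) < O.valuation (g₀ - f₀ ^ p)) →
    (∀ hk : ∀ c : k, algebraMap k K c ∈ O, transcendenceDefect k O hk ≠ 0) →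
    ¬ (∃ π : K, π ≠ 0 ∧ (∀ x : K, O.valuation x < 1 → O.valuation x ≤ O.valuation π) ∧
      (∀ x : K, x ≠ 0 → ∃ n : ℕ, O.valuation π ^ n ≤ O.valuation x)) →
    PRankTwoAt p O →
    ∀ (Sb : Type) [Fintype Sb] (b : Sb → k), IsPSpanningFamily p b →
    ∀ (r : ℕ) (w : Fin r → K), (∀ i, w i ∈ O) → ResiduallyPIndependentFamily p O (pMonomial p w) →
    Module.finrank (Subfield.closure (Set.range (fun x : K => x ^ p))) K = p ^ (r + 3) →
    CleanLUConcl p k K O A g₀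

/-- **T⁗′ ⊂ T⁗** (kernel): a lifted residually `p`-independent family `w` with `[K : K^p] = p^{r+3}` yields the `p`-monomial frame
`W = pMonomial p w` on `S = (Fin r → Fin p)`: (W ⊆ O) trivially, (RPI) = hypothesis, (MULT)/(1) identically, (DEG) by the tower
`[K : K^p] = [K : K^p(W)]·[K^p(W) : K^p] = [K : K^p(W)]·p^r` (§D `finrank_adjoin_frame_eq_card`, RG over `K^p` from §C with trivial IR). [folklore] -/
theorem cleanLU3DefectPRankTwoPMon_of_frame (p : ℕ) [Fact p.Prime] (hFrame : CleanLU3DefectPRankTwoFrameAt p) :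
    CleanLU3DefectPRankTwoPMonAt p := by
  intro k _ _ K _ _ O A hAO hAfg hFrac hdimA hreg hdim3 hzd g₀ hg₀ hdefect htd hnd hP2 Sb _ b hb r w hwO hPI hK
  classical
  have hp : p.Prime := Fact.out
  haveI : NeZero p := ⟨hp.ne_zero⟩
  haveI : CharP K p := charP_of_injective_algebraMap (algebraMap k K).injective p
  set W : (Fin r → Fin p) → K := pMonomial p w with hWdef
  -- `K^p` = the subfield generated by the `p`-th powers
  set Kp : Subfield K := (frobenius K p).fieldRange with hKpdef
  have hcl : Subfield.closure (Set.range (fun x : K => x ^ p)) = Kp := by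
    apply le_antisymm
    · refine Subfield.closure_le.mpr ?_
      rintro z ⟨u, rfl⟩
      exact RingHom.mem_fieldRange.mpr ⟨u, frobenius_def ..⟩
    · intro z hz
      obtain ⟨u, rfl⟩ := RingHom.mem_fieldRange.mp hz
      exact Subfield.subset_closure ⟨u, (frobenius_def ..).symm⟩
  have hKp : Module.finrank Kp K = p ^ (r + 3) := by rw [← hcl]; exact hK
  -- RG over `K^p` (IR is trivial for `K^p` itself), hence `K^p`-linear independence of the monomials
  have hIR : ∀ m : K, m ∈ Kp → O.valuation m = 1 → ∃ u : K, O.valuation (m - u ^ p) < 1 := by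
    intro m hm _
    obtain ⟨u, rfl⟩ := RingHom.mem_fieldRange.mp hm
    exact ⟨u, by rw [frobenius_def, sub_self, map_zero]; exact zero_lt_one⟩
  have hRG : ∀ c : (Fin r → Fin p) → K, (∀ i, c i ∈ Kp) →
      O.valuation (∑ i, c i * W i) = Finset.univ.sup (fun i => O.valuation (c i)) :=
    fun c hc => valuation_sum_mul_family_eq_sup O Kp hIR W hPI c hc
  have hBli : LinearIndependent Kp W := by
    rw [Fintype.linearIndependent_iff]
    intro g hg i
    have hsum : ∑ i, (g i : K) * W i = 0 := by
      have : ∑ i, (g i : K) * W i = ∑ i, g i • W i :=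
        Finset.sum_congr rfl fun i _ => (Subfield.smul_def (g i) _).symm
      rw [this, hg]
    have hv := hRG (fun i => (g i : K)) (fun i => (g i).2)
    rw [hsum, map_zero] at hv
    have hle : O.valuation (g i : K) ≤ Finset.univ.sup (fun i => O.valuation (g i : K)) :=
      Finset.le_sup (f := fun i => O.valuation (g i : K)) (Finset.mem_univ i)
    rw [← hv, le_zero_iff, map_eq_zero] at hle
    exact_mod_cast hle
  have hWmul : ∀ s t, ∃ d : (Fin r → Fin p) → K, W s * W t = ∑ u, d u ^ p * W u := pMonomial_mult p w
  have hW1 : ∃ d : (Fin r → Fin p) → K, ∑ u, d u ^ p * W u = 1 := pMonomial_one p w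
  -- degrees: `[K^p(W) : K^p] = p^r`, hence `[K : K^p(W)] = p³`
  have hF₀deg : Module.finrank Kp (IntermediateField.adjoin Kp (Set.range W)) = p ^ r := by
    rw [finrank_adjoin_frame_eq_card W hWmul hW1 hBli, Fintype.card_fun, Fintype.card_fin, Fintype.card_fin]
  have hF₀ : (IntermediateField.adjoin Kp (Set.range W)).toSubfield =
      Subfield.closure (Set.range W ∪ Set.range (fun x : K => x ^ p)) := by
    rw [IntermediateField.adjoin_toSubfield]
    have hrange : Set.range (algebraMap Kp K) = Set.range (fun x : K => x ^ p) := by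
      ext z
      constructor
      · rintro ⟨c, rfl⟩
        obtain ⟨u, hu⟩ := RingHom.mem_fieldRange.mp c.2
        refine ⟨u, ?_⟩
        show u ^ p = (c : K)
        rw [← hu, frobenius_def]
      · rintro ⟨u, rfl⟩
        refine ⟨⟨u ^ p, RingHom.mem_fieldRange.mpr ⟨u, frobenius_def ..⟩⟩, ?_⟩
        rfl
    rw [hrange, Set.union_comm]
  have hdeg : Module.finrank (Subfield.closure (Set.range W ∪ Set.range (fun x : K => x ^ p))) K = p ^ 3 := by
    have htower := Module.finrank_mul_finrank Kp (IntermediateField.adjoin Kp (Set.range W)) K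
    rw [hF₀deg, hKp, pow_add] at htower
    have h3 : Module.finrank (IntermediateField.adjoin Kp (Set.range W)) K = p ^ 3 :=
      Nat.eq_of_mul_eq_mul_left (pow_pos hp.pos r) htower
    have h' : Module.finrank (IntermediateField.adjoin Kp (Set.range W)).toSubfield K = p ^ 3 := h3
    rw [hF₀] at h'
    exact h'
  exact hFrame k K O A hAO hAfg hFrac hdimA hreg hdim3 hzd g₀ hg₀ hdefect htd hnd hP2 Sb b hb (Fin r → Fin p) W
    (fun e => pMonomial_mem p O w hwO e) hPI hWmul hW1 hdeg

open AlgebraicGeometry CategoryTheory in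
/-- **THEOREM T⁗′** (kernel, inputs F-02 = the named fact `CossartPiltant2019` and F-32): the (P2)-slice of the lead's stub for a ground field
of finite `p`-rank and `r` elements of `O_v` with `p`-independent residues, `[K : K^p] = p^{r+3}` — no frame axioms, no separability. [folklore] -/
theorem cleanLU3DefectPRankTwoPMon_of_cossartPiltant2019 (p : ℕ) [Fact p.Prime]
    (hCP : CossartPiltant2019.{0})
    (hEmb : ∀ (Z : Scheme.{0}) [IsIntegral Z] [IsNoetherian Z], Scheme.IsRegular Z →
      Scheme.IsExcellent Z → ∀ (X : Set Z), IsClosed X → X ≠ Set.univ → topologicalKrullDim X ≤ 2 →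
        ∃ (Z' : Scheme.{0}) (π : Z' ⟶ Z), IsProper π ∧ Function.Surjective π.base ∧
          (∃ U : Z.Opens, (U : Set Z) = Xᶜ ∧ IsIso (π ∣_ U)) ∧
          IsStrictNormalCrossingsDivisor Z' (π.base ⁻¹' X))
    : CleanLU3DefectPRankTwoPMonAt p :=
  cleanLU3DefectPRankTwoPMon_of_frame p (cleanLU3DefectPRankTwoFrame_of_cossartPiltant2019 p hCP hEmb)

end PMonomialFrames

end Summit.ResolutionOfSingularities.ResolutionOfSingularities.Cruxes.DescentPerfectToAll.CpSibling.TFrame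

end
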